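import Literature.Analysis.FluidPDE.Tao2016AveragedNS.DefectWeight
import Literature.Analysis.FluidPDE.Tao2016AveragedNS.SeedScaleFiring
import Literature.Analysis.FluidPDE.Tao2016AveragedNS.SeedScaleSharpIgnition
import HarnessLib

/-!
# Tao's gate is certified on the whole weighted half-plane (reach interface, wide a-priori budget)

**Honest framing.** low prior, high value-of-information experiment on Tao's machine paradigm; NOT a
claim that NS blows up. This file is Literature-side bookkeeping for the cell `pub-fluidc`: it
formalises [cite: Tao2016AveragedNS, §5.5 Theorem 5.3] (the delayed, abrupt firing of the
five-mode quadratic circuit (5.5)) along FORCED PSEUDO-ORBITS, and packages the result as an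
instance of bp3's typed `ReachCertificate` interface. Nothing here is a statement about the
Navier–Stokes equations.

**What is new relative to `DefectWeight.lean`.** There the sufficiency side of the reach interface
was proved under the PAIR of budgets `δ₀ + 2δ ≤ ε²e^{-M}/8` (the a-priori budget inherited verbatim
from `SeedScaleIgnition`'s `section Eighth`) and `δ₀ + 1.27·δ/√M ≤ 1.2532·u`
(`u = ε²e^{-M}/√M`, the clock-propagator-weighted ignition budget). On the defect axis the first
constraint was the binding one (`ε_d < ε²e^{-M}/16` certified versus `ε_d ≥ ε²e^{-M}` impossible:
a residual factor `16` that is an artefact of the bootstrap, `defectAxis_binding_constraint`).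
Here the ENTIRE a-priori chain (ignition window, entry state, transition, equipartition, firing)
is re-run under the WIDE A-PRIORI BUDGET

  `WideBudget M ε δ δ₀ : δ₀ ≤ ε²e^{-M}/2 ∧ δ ≤ ε²e^{-M}`,

which is NECESSARY for any reach certificate of the gate (`isEmpty_reachCertificate_of_ge`:
`ρ < 1.2535·u ≤ ε²e^{-M}/60`; `isEmpty_reachCertificate_of_seed_le`: `ε_d < ε²e^{-M}`), hence can
never again be the binding constraint. Consequences (§4):

* `taoReachHalfPlane`: a reach certificate for EVERY `(ρ, ε_d)` in the open weighted half-plane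
  `ρ + 1.27·ε_d/√M < 1.2532·u` (`ρ, ε_d ≥ 0`) — one linear constraint, no a-priori side condition;
* `taoReach_defectAxis_wide` / `defectAxis_phases_wide`: on the defect axis the gate is certified
  for `ε_d < 0.9867·ε²e^{-M}` and admits no certificate for `ε_d ≥ ε²e^{-M}`: the sup-size of an
  adversarial forcing a Theorem-5.3 stage tolerates is its own seed rate `ε²e^{-M}`, decided to
  within the factor `1.0135` (was `16`);
* `taoReach_phases_wide`: the certified / impossible regions of the `(ρ, ε_d)` plane
  (certified: the open weighted half-plane; impossible: `ρ ≥ 1.2535·u` or `ε_d ≥ ε²e^{-M}`).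

**Why the wide budget suffices (numerics).** The a-priori bootstrap uses the budget only through
astronomically slack inequalities: the majorant clock needs `ε⁻¹M(δ₀t + δt²/2) ≤ t/320`, i.e.
`2.5·Mεe^{-M} ≤ 1/320` (we have `Mε ≤ 1/40`, `e^{-M} ≤ 10⁻⁶`); the energy excess needs
`M(7δ₀ + 32δ)/2 ≤ 1/16000` (`18·Mε²e^{-M} ≤ 1/16000`); the trigger bound `|c| ≤ 3ε²e^{-M/2}` on
`[0,1]` needs `(δ₀ + δ + ε²e^{-M}(1 + 36ε²e^{-M}))·(50/49) ≤ 3ε²e^{-M}` (`2.55·50/49 ≤ 3`); the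
transition and firing phases
compare `δ ≤ ε²e^{-M}` with the trigger level `ε²/K¹⁰ ≥ ε²e^{-M}·K^{2990}`. Every statement of
§1–§3 is the verbatim analogue of the landed primed (`…'`) / weighted (`…W`) lemma with the
hypothesis `δ₀ + 2δ ≤ ε²e^{-M}/8` replaced by the explicit binder `(hB : WideBudget M ε δ δ₀)`
(names `…_w`); the proofs change only where the budget is consumed numerically.

What is NOT claimed: nothing on the necessity side beyond the landed `isEmpty_…` theorems (the
strip `1.2532u - 1.27ε_d/√M ≤ ρ < 1.2535u`, `ε_d < ε²e^{-M}`, stays undecided, and so does the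
segment `0.9867·ε²e^{-M} ≤ ε_d < ε²e^{-M}` of the defect axis); nothing for cycle times other than
`2` on the sufficiency side; nothing about Navier–Stokes.

Layout. §0 the wide budget. §1 a-priori bounds on the ignition window, entry-state lemmas, the fine
carrier / Gaussian clock lemmas (`namespace Ignition`, `IgnitionSharp`). §2 transition,
equipartition and firing after the entry time (`namespace Ignition`). §3 the weighted ignition
analysis and Theorem 5.3 along approximate trajectories and pseudo-orbits (`namespace
IgnitionSharp`, root). §4 the reach interface: `firesAtTwo_halfPlane`, `taoReachHalfPlane`, the defect
axis, the phase portrait.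
-/

noncomputable section

open Real Set MeasureTheory Metric
open scoped NNReal
open Literature.Analysis.FluidPDE.FluidComputer (ReachCertificate)

namespace Literature.Analysis.FluidPDE.Tao2016AveragedNS

open NegKick (clockInt clockInt_zero)
/-! ## §0. The wide a-priori budget -/

/-- **The wide a-priori budget** of an approximate trajectory of Tao's gate: datum error
`δ₀ ≤ ε²e^{-M}/2` and defect `δ ≤ ε²e^{-M}`. Both bounds are NECESSARY for any reach certificate
(`isEmpty_reachCertificate_of_ge`, `isEmpty_reachCertificate_of_seed_le`), so running the a-priori
bootstrap under this budget makes it non-binding once and for all.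
[cite: Tao2016AveragedNS, §5.5 Theorem 5.3] -/
def WideBudget (M ε δ δ₀ : ℝ) : Prop :=
  δ₀ ≤ ε ^ 2 * exp (-M) / 2 ∧ δ ≤ ε ^ 2 * exp (-M)

/-- The a-priori budget `δ₀ + 2δ ≤ ε²e^{-M}/8` of `SeedScaleIgnition`'s `section Eighth` (with
`δ₀, δ ≥ 0`) implies the wide budget. [cite: Tao2016AveragedNS, §5.5] -/
theorem wideBudget_of_eighth {M ε δ δ₀ : ℝ} (hδ₀ : 0 ≤ δ₀) (hδ : 0 ≤ δ)
    (hη : δ₀ + 2 * δ ≤ ε ^ 2 * exp (-M) / 8) : WideBudget M ε δ δ₀ := by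
  have hs : 0 ≤ ε ^ 2 * exp (-M) := by positivity
  exact ⟨by linarith, by linarith⟩

/-- The weighted half-plane `δ₀ + 1.27·δ/√M ≤ 1.2532·ε²e^{-M}/√M` (with `δ₀, δ ≥ 0`, `√M ≥ 77`)
lies inside the wide budget, with room: `δ₀ ≤ ε²e^{-M}/60` and `δ ≤ (3133/3175)ε²e^{-M}`.
[cite: Tao2016AveragedNS, §5.5] -/
theorem wideBudget_of_weighted {M ε δ δ₀ : ℝ} (h77 : 77 ≤ Real.sqrt M) (hδ₀ : 0 ≤ δ₀) (hδ : 0 ≤ δ)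
    (hW : δ₀ + 127 / 100 * δ / Real.sqrt M ≤ 3133 / 2500 * (ε ^ 2 * exp (-M)) / Real.sqrt M) :
    δ₀ ≤ ε ^ 2 * exp (-M) / 60 ∧ δ ≤ 3133 / 3175 * (ε ^ 2 * exp (-M)) := by
  have hM0 : 0 < Real.sqrt M := by linarith
  have h1 : δ₀ * Real.sqrt M + 127 / 100 * δ ≤ 3133 / 2500 * (ε ^ 2 * exp (-M)) := by
    have := mul_le_mul_of_nonneg_right hW hM0.le
    have e1 : (δ₀ + 127 / 100 * δ / Real.sqrt M) * Real.sqrt M =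
        δ₀ * Real.sqrt M + 127 / 100 * δ := by field_simp
    have e2 : 3133 / 2500 * (ε ^ 2 * exp (-M)) / Real.sqrt M * Real.sqrt M =
        3133 / 2500 * (ε ^ 2 * exp (-M)) := by field_simp
    rw [e1, e2] at this; exact this
  have h2 : δ₀ * 77 ≤ δ₀ * Real.sqrt M := mul_le_mul_of_nonneg_left h77 hδ₀
  constructor
  · nlinarith
  · nlinarith

/-- The wide budget from the weighted half-plane. [cite: Tao2016AveragedNS, §5.5] -/
theorem wideBudget_of_weighted' {M ε δ δ₀ : ℝ} (h77 : 77 ≤ Real.sqrt M) (hδ₀ : 0 ≤ δ₀) (hδ : 0 ≤ δ)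
    (hW : δ₀ + 127 / 100 * δ / Real.sqrt M ≤ 3133 / 2500 * (ε ^ 2 * exp (-M)) / Real.sqrt M) :
    WideBudget M ε δ δ₀ := by
  obtain ⟨h1, h2⟩ := wideBudget_of_weighted h77 hδ₀ hδ hW
  have hs : 0 ≤ ε ^ 2 * exp (-M) := by positivity
  exact ⟨by linarith, by linarith⟩

/-! ## §1. A-priori bounds on the ignition window under the wide budget -/

namespace Ignition

/-- Numerics of the wide budget: `Mεe^{-M} ≤ 1/(4·10⁷)`, `M·ε²e^{-M} ≤ 10⁻⁶`, `ε²e^{-M} ≤ ε/10⁶`,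
`ε² ≤ 10⁻⁵` (from `Mε ≤ 1/40`, `ε ≤ 1`, `e^{-M} ≤ 10⁻⁶`). [cite: Tao2016AveragedNS, §5.5] -/
theorem wide_params {K M ε : ℝ} (hK : 2 * 20 ^ 42 * (Nat.factorial 42 : ℝ) + 16 ≤ K)
    (hML : 3000 * Real.log K ≤ M) (hMK : M ≤ K ^ 10) (hε : 0 < ε)
    (hεle : ε ≤ exp (-(10 * M)) / K ^ 100) :
    M * ε * exp (-M) ≤ 1 / 40000000 ∧ M * (ε ^ 2 * exp (-M)) ≤ 1 / 1000000 ∧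
      ε ^ 2 * exp (-M) ≤ ε / 1000000 ∧ ε ^ 2 ≤ 1 / 100000 := by
  obtain ⟨-, hε1, hε2, hexpM, hMe, -, -, -, -⟩ := ignition_params hK hML hMK hε hεle
  have h1 : M * ε * exp (-M) ≤ 1 / 40 * (1 / 1000000) :=
    mul_le_mul hMe hexpM (exp_pos _).le (by norm_num)
  have h2 : M * (ε ^ 2 * exp (-M)) = M * ε * exp (-M) * ε := by ring
  have h3 : M * ε * exp (-M) * ε ≤ 1 / 40 * (1 / 1000000) * 1 :=
    mul_le_mul h1 hε1 hε.le (by norm_num)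
  have h4 : ε ^ 2 * exp (-M) = ε * (ε * exp (-M)) := by ring
  have h5 : ε * exp (-M) ≤ 1 * (1 / 1000000) := mul_le_mul hε1 hexpM (exp_pos _).le zero_le_one
  have h6 : ε * (ε * exp (-M)) ≤ ε * (1 * (1 / 1000000)) := mul_le_mul_of_nonneg_left h5 hε.le
  exact ⟨by linarith, by rw [h2]; linarith, by rw [h4]; linarith, hε2⟩

section Approx

variable {K M ε δ δ₀ T : ℝ} {Y V : ℝ → Fin 5 → ℝ}
  (hY : ∀ t, HasDerivAt Y (V t) t)
  (hV : ∀ t ∈ Ico 0 T, ‖V t - delayCircuitWith K M ε (Y t)‖ ≤ δ)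
  (hR : ∀ t ∈ Ico 0 T, ‖Y t‖ ≤ 2) (hT : 2 ≤ T)
include hY hV hR hT

section Wide

variable (hK : 2 * 20 ^ 42 * (Nat.factorial 42 : ℝ) + 16 ≤ K) (hML : 3000 * Real.log K ≤ M)
  (hMK : M ≤ K ^ 10) (hε : 0 < ε) (hεle : ε ≤ exp (-(10 * M)) / K ^ 100)
  (h0 : ‖Y 0 - delayInit‖ ≤ δ₀)
include hK hML hMK hε hεle h0

omit hY hR in
/-- The WIDE budget in absolute terms: `δ₀, δ ≥ 0`, `δ₀ ≤ ε²e^{-M}/2`, `δ₀ ≤ 1`, `δ ≤ ε²e^{-M}`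
and `ε²e^{-M} ≤ 10⁻⁶` (compare `budget_facts'`, whose third and fifth components were
`δ₀ + 2δ ≤ ε²e^{-M}/8` and `7δ₀ + 32δ ≤ 2ε²e^{-M}`). [cite: Tao2016AveragedNS, §5.5] -/
theorem budget_facts_w (hB : WideBudget M ε δ δ₀) :
    0 ≤ δ₀ ∧ 0 ≤ δ ∧ δ₀ ≤ ε ^ 2 * exp (-M) / 2 ∧ δ₀ ≤ 1 ∧
      δ ≤ ε ^ 2 * exp (-M) ∧ ε ^ 2 * exp (-M) ≤ 1 / 1000000 := by
  obtain ⟨hM6000, hε1, hε2, hexpM, -, -, -, h77, -⟩ := ignition_params hK hML hMK hε hεle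
  have hδ := defect_nonneg hV hT
  have hδ₀ : 0 ≤ δ₀ := (norm_nonneg _).trans h0
  have hs0 : 0 ≤ ε ^ 2 * exp (-M) := by positivity
  have hs1 : ε ^ 2 * exp (-M) ≤ 1 / 1000000 := by
    have : exp (-M) ≤ 1 := by linarith
    nlinarith
  exact ⟨hδ₀, hδ, hB.1, by linarith [hB.1], hB.2, hs1⟩

omit hY hR in
/-- **The majorant clock on the window**: `G⁺(t) ≤ Mt²/2 + t²/16000 + t/320` for `t ∈ [0, 8/5]`.
[cite: Tao2016AveragedNS, §5.5] -/
theorem clockSup_le_w (hB : WideBudget M ε δ δ₀) {t : ℝ} (ht : t ∈ Icc (0 : ℝ) (8 / 5)) :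
    clockSup M ε δ δ₀ t ≤ M * t ^ 2 / 2 + t ^ 2 / 16000 + t / 320 := by
  obtain ⟨hM6000, hε1, -, hexpM, hMe, -, hMse, -, -⟩ := ignition_params hK hML hMK hε hεle
  obtain ⟨hδ₀, hδ, hη8, -, h732, -⟩ := budget_facts_w hV hT hK hML hMK hε hεle h0 hB
  have hM0 : 0 < M := by linarith
  have hsplit : clockSup M ε δ δ₀ t =
      M * t ^ 2 / 2 + M * t ^ 2 / 2 * (7 * δ₀ + 32 * δ) + ε⁻¹ * M * (δ₀ * t + δ * t ^ 2 / 2) := by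
    unfold clockSup; field_simp; ring
  rw [hsplit]
  obtain ⟨hMe6, hMs6, -, -⟩ := wide_params hK hML hMK hε hεle
  have h1 : M * t ^ 2 / 2 * (7 * δ₀ + 32 * δ) ≤ t ^ 2 / 16000 := by
    have h11 : 7 * δ₀ + 32 * δ ≤ 36 * (ε ^ 2 * exp (-M)) := by
      have : 0 ≤ ε ^ 2 * exp (-M) := by positivity
      linarith
    have : M * (7 * δ₀ + 32 * δ) ≤ 36 * (M * (ε ^ 2 * exp (-M))) := by
      have := mul_le_mul_of_nonneg_left h11 hM0.le
      linarith
    nlinarith [sq_nonneg t]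
  have h2 : ε⁻¹ * M * (δ₀ * t + δ * t ^ 2 / 2) ≤ t / 320 := by
    have h21 : δ₀ * t + δ * t ^ 2 / 2 ≤ (δ₀ + 2 * δ) * t := by
      have : 0 ≤ δ * t * (4 - t) := mul_nonneg (mul_nonneg hδ ht.1) (by linarith [ht.2])
      nlinarith
    have h5 : δ₀ + 2 * δ ≤ 5 / 2 * (ε ^ 2 * exp (-M)) := by linarith
    have h22 : ε⁻¹ * M * ((δ₀ + 2 * δ) * t) ≤ ε⁻¹ * M * (5 / 2 * (ε ^ 2 * exp (-M)) * t) :=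
      mul_le_mul_of_nonneg_left (mul_le_mul_of_nonneg_right h5 ht.1) (by positivity)
    have h23 : ε⁻¹ * M * (5 / 2 * (ε ^ 2 * exp (-M)) * t) = 5 / 2 * (M * ε * exp (-M)) * t := by
      field_simp
    calc ε⁻¹ * M * (δ₀ * t + δ * t ^ 2 / 2) ≤ ε⁻¹ * M * ((δ₀ + 2 * δ) * t) :=
          mul_le_mul_of_nonneg_left h21 (by positivity)
      _ ≤ 5 / 2 * (M * ε * exp (-M)) * t := by rw [← h23]; exact h22
      _ ≤ t / 320 := by nlinarith [ht.1]
  linarith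

/-- **The trigger on the first unit of time**: `|c(t)| ≤ 3ε²e^{-M/2}` for `t ∈ [0,1]`
(budget `≤ ε²e^{-M}/8`, clock `G⁺(1) ≤ M/2 + 1/50`). [cite: Tao2016AveragedNS, §5.5] -/
theorem abs_c_le_unit_w (hB : WideBudget M ε δ δ₀) {t : ℝ} (ht : t ∈ Icc (0 : ℝ) 1) :
    |Y t 2| ≤ 3 * ε ^ 2 * exp (-(M / 2)) := by
  obtain ⟨hM6000, hε1, -, hexpM, hMe, -, hMse, -, -⟩ := ignition_params hK hML hMK hε hεle
  obtain ⟨hδ₀, hδ, hη8, hδ₀1, h732, hs1⟩ := budget_facts_w hV hT hK hML hMK hε hεle h0 hB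
  have hM : 0 ≤ M := by linarith
  have ht' : t ∈ Icc (0 : ℝ) (8 / 5) := ⟨ht.1, by linarith [ht.2]⟩
  have hup := c_le hY hV hR hT h0 hδ₀1 hε hM ht'
  have hlo := c_ge hY hV hR hT h0 hδ₀1 hε hM ht'
  have hG1 : clockSup M ε δ δ₀ t ≤ M / 2 + 1 / 50 := by
    have h1 := clockSup_le_w hV hT hK hML hMK hε hεle h0 hB ht'
    have ht2 : t ^ 2 ≤ 1 := pow_le_one₀ ht.1 ht.2
    have h2 : M * t ^ 2 ≤ M := by nlinarith
    linarith [ht.2]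
  -- e^{G⁺(t)} ≤ (50/49)·e^{M/2}
  have he50 : exp (1 / 50 : ℝ) ≤ 50 / 49 := by
    have h := add_one_le_exp (-(1 / 50 : ℝ))
    have h' : exp (1 / 50 : ℝ) * exp (-(1 / 50 : ℝ)) = 1 := by rw [← exp_add]; simp
    nlinarith [exp_pos (1 / 50 : ℝ), exp_pos (-(1 / 50 : ℝ))]
  have hexpG : exp (clockSup M ε δ δ₀ t) ≤ 50 / 49 * exp (M / 2) := by
    calc exp (clockSup M ε δ δ₀ t) ≤ exp (M / 2 + 1 / 50) := exp_le_exp.2 hG1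
      _ = exp (1 / 50) * exp (M / 2) := by rw [← exp_add]; ring_nf
      _ ≤ 50 / 49 * exp (M / 2) := mul_le_mul_of_nonneg_right he50 (exp_pos _).le
  set s : ℝ := ε ^ 2 * exp (-M) with hs
  have hs0 : 0 < s := by positivity
  have hpre : δ₀ + (s * (1 + 7 * δ₀ + 32 * δ) + δ) * t ≤ 51 / 20 * s := by
    have h11 : 7 * δ₀ + 32 * δ ≤ 36 * s := by linarith
    have h1 : s * (1 + 7 * δ₀ + 32 * δ) ≤ s * (1 + 36 * s) :=
      mul_le_mul_of_nonneg_left (by linarith) hs0.le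
    have h2 : (s * (1 + 7 * δ₀ + 32 * δ) + δ) * t ≤ s * (1 + 36 * s) + δ := by
      have : 0 ≤ s * (1 + 7 * δ₀ + 32 * δ) + δ := by positivity
      nlinarith [ht.2]
    have h3 : s * (36 * s) ≤ s * (1 / 20) := mul_le_mul_of_nonneg_left (by linarith) hs0.le
    nlinarith
  have hpre' : δ₀ + δ * t ≤ 51 / 20 * s := by
    have : δ * t ≤ (s * (1 + 7 * δ₀ + 32 * δ) + δ) * t := by
      apply mul_le_mul_of_nonneg_right _ ht.1; nlinarith
    linarith
  have hkey : 51 / 20 * s * (50 / 49 * exp (M / 2)) ≤ 3 * ε ^ 2 * exp (-(M / 2)) := by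
    have : s * exp (M / 2) = ε ^ 2 * exp (-(M / 2)) := by
      rw [hs, mul_assoc, ← exp_add]; ring_nf
    nlinarith [exp_pos (M / 2)]
  have hE : 0 ≤ exp (clockSup M ε δ δ₀ t) := (exp_pos _).le
  rw [abs_le]; constructor
  · have : (δ₀ + δ * t) * exp (clockSup M ε δ δ₀ t) ≤ 51 / 20 * s * (50 / 49 * exp (M / 2)) :=
      mul_le_mul hpre' hexpG hE (by positivity)
    linarith
  · have : (δ₀ + (s * (1 + 7 * δ₀ + 32 * δ) + δ) * t) * exp (clockSup M ε δ δ₀ t) ≤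
        51 / 20 * s * (50 / 49 * exp (M / 2)) := mul_le_mul hpre hexpG hE (by positivity)
    linarith

/-- **The clock on the first unit of time**: `-ε ≤ b(t) ≤ 2ε` for `t ∈ [0,1]`.
[cite: Tao2016AveragedNS, §5.5 (5.5)] -/
theorem b_bounds_unit_w (hB : WideBudget M ε δ δ₀) {t : ℝ} (ht : t ∈ Icc (0 : ℝ) 1) : -ε ≤ Y t 1 ∧ Y t 1 ≤ 2 * ε := by
  obtain ⟨hM6000, hε1, -, hexpM, hMe, -, hMse, -, -⟩ := ignition_params hK hML hMK hε hεle
  obtain ⟨hδ₀, hδ, hη8, hδ₀1, h732, hs1⟩ := budget_facts_w hV hT hK hML hMK hε hεle h0 hB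
  have hM : 0 ≤ M := by linarith
  have ht' : t ∈ Icc (0 : ℝ) (8 / 5) := ⟨ht.1, by linarith [ht.2]⟩
  constructor
  · -- ḃ ≥ -ε⁻¹MC₁² - δ with C₁ = 3ε²e^{-M/2}
    set C : ℝ := 3 * ε ^ 2 * exp (-(M / 2)) with hC
    have hC2 : ε⁻¹ * M * C ^ 2 = 9 * M * ε ^ 3 * exp (-M) := by
      have : exp (-(M / 2)) ^ 2 = exp (-M) := by rw [← exp_nat_mul]; ring_nf
      rw [hC, mul_pow, mul_pow, this]; field_simp; ring
    set β : ℝ := ε⁻¹ * M * C ^ 2 + δ with hβ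
    have hβ0 : 0 ≤ β := by rw [hβ]; positivity
    have hmono := Thm53.monotoneOn_sub_of_le_deriv (s := Icc (0 : ℝ) 1) (f := fun s => Y s 1)
      (φ := fun _ => -β) (Φ := fun u => -β * u)
      (convex_Icc 0 1) (fun u _ => hasDerivAt_coord (hY u) 1)
      (fun u _ => by simpa using (hasDerivAt_id u).const_mul (-β))
      (fun u hu => by
        have hu' : u ∈ Icc (0 : ℝ) (8 / 5) := ⟨hu.1, by linarith [hu.2]⟩
        have hθ := (abs_le.1 (abs_coord_defect_le (hV u (mem_Ico_of_mem_window hT hu')) 1)).1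
        rw [field_one] at hθ
        have hc : Y u 2 ^ 2 ≤ C ^ 2 := by
          have := abs_c_le_unit_w hY hV hR hT hK hML hMK hε hεle h0 hB hu
          rw [← sq_abs]; exact pow_le_pow_left₀ (abs_nonneg _) this 2
        have h1 : 0 ≤ ε * Y u 0 ^ 2 := by positivity
        have h2 : ε⁻¹ * M * Y u 2 ^ 2 ≤ ε⁻¹ * M * C ^ 2 :=
          mul_le_mul_of_nonneg_left hc (by positivity)
        show -β ≤ V u 1
        linarith)
    have h := hmono (left_mem_Icc.2 zero_le_one) ht ht.1
    have hb0 := (abs_le.1 (abs_init_coord_le h0).1).1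
    simp only [mul_zero, sub_zero] at h
    have h3 : β * t ≤ β := by nlinarith [ht.2]
    have h4 : 9 * M * ε ^ 3 * exp (-M) ≤ ε / 1000 := by
      have := mul_le_mul_of_nonneg_left hMse (by positivity : (0 : ℝ) ≤ 9 * ε)
      nlinarith
    have h5 : δ₀ + δ ≤ ε / 8 := by
      obtain ⟨-, -, hsε6, -⟩ := wide_params hK hML hMK hε hεle
      linarith
    have h6 : β = 9 * M * ε ^ 3 * exp (-M) + δ := by rw [hβ, hC2]
    nlinarith
  · have h := b_le hY hV hR hT h0 hδ₀1 hε hM ht'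
    have h1 : (ε * (1 + 7 * δ₀ + 32 * δ) + δ) * t ≤ ε * (1 + 7 * δ₀ + 32 * δ) + δ := by
      have : 0 ≤ ε * (1 + 7 * δ₀ + 32 * δ) + δ := by positivity
      nlinarith [ht.2]
    have h2 : ε * (7 * δ₀ + 32 * δ) ≤ ε / 4 := by nlinarith
    have h3 : δ₀ + δ ≤ ε / 8 := by nlinarith
    nlinarith

/-- **The outputs on the first unit of time**: `|d(t)|, |ã(t)| ≤ 7e^{-M/2}` for `t ∈ [0,1]`
(the rotor drive is `ε⁻²|c||a| ≤ 6e^{-M/2}`, plus the defect). [cite: Tao2016AveragedNS, §5.5 (5.5)] -/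
theorem de_le_unit_w (hB : WideBudget M ε δ δ₀) {t : ℝ} (ht : t ∈ Icc (0 : ℝ) 1) :
    |Y t 3| ≤ 7 * exp (-(M / 2)) ∧ |Y t 4| ≤ 7 * exp (-(M / 2)) := by
  obtain ⟨hM6000, hε1, -, hexpM, hMe, -, hMse, -, -⟩ := ignition_params hK hML hMK hε hεle
  obtain ⟨hδ₀, hδ, hη8, hδ₀1, h732, hs1⟩ := budget_facts_w hV hT hK hML hMK hε hεle h0 hB
  set ρ : ℝ := 2 * δ + 6 * exp (-(M / 2)) with hρ
  have hρ0 : 0 ≤ ρ := by positivity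
  set u : ℝ → ℝ := fun s => Y s 3 * Y s 3 + Y s 4 * Y s 4 with hu
  obtain ⟨hd0, he0⟩ := (abs_init_coord_le h0).2.2
  suffices hmain : ∀ μ : ℝ, 0 < μ → Real.sqrt (u t + μ ^ 2) ≤ 2 * δ₀ + μ + ρ * t by
    have hfin : 2 * δ₀ + ρ * t ≤ 7 * exp (-(M / 2)) := by
      have h1 : ρ * t ≤ ρ := by nlinarith [ht.2]
      have h2 : 2 * δ₀ + 2 * δ ≤ exp (-(M / 2)) := by
        obtain ⟨-, -, -, hε2w⟩ := wide_params hK hML hMK hε hεle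
        have h3ε : 3 * ε ^ 2 ≤ 1 := by linarith
        have h21 : 3 * (ε ^ 2 * exp (-M)) ≤ exp (-(M / 2)) :=
          calc 3 * (ε ^ 2 * exp (-M)) = 3 * ε ^ 2 * exp (-M) := by ring
            _ ≤ 1 * exp (-M) := mul_le_mul_of_nonneg_right h3ε (exp_pos _).le
            _ ≤ exp (-(M / 2)) := by rw [one_mul]; exact exp_le_exp.2 (by linarith)
        linarith
      linarith
    have hd : ∀ μ : ℝ, 0 < μ → |Y t 3| ≤ 7 * exp (-(M / 2)) + μ := fun μ hμ => by
      have : |Y t 3| ≤ Real.sqrt (u t + μ ^ 2) :=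
        abs_le_sqrt (by simp only [hu]; nlinarith [mul_self_nonneg (Y t 4)])
      linarith [hmain μ hμ]
    have he : ∀ μ : ℝ, 0 < μ → |Y t 4| ≤ 7 * exp (-(M / 2)) + μ := fun μ hμ => by
      have : |Y t 4| ≤ Real.sqrt (u t + μ ^ 2) :=
        abs_le_sqrt (by simp only [hu]; nlinarith [mul_self_nonneg (Y t 3)])
      linarith [hmain μ hμ]
    exact ⟨le_of_forall_pos_le_add fun μ hμ => hd μ hμ,
      le_of_forall_pos_le_add fun μ hμ => he μ hμ⟩
  intro μ hμ
  set h : ℝ → ℝ := fun s => Real.sqrt (u s + μ ^ 2) with hh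
  have hupos : ∀ s, 0 < u s + μ ^ 2 := fun s => by
    have : 0 ≤ u s := by simp only [hu]; nlinarith [mul_self_nonneg (Y s 3), mul_self_nonneg (Y s 4)]
    positivity
  have hdu : ∀ s, HasDerivAt u (Y s 3 * V s 3 + Y s 3 * V s 3 + (Y s 4 * V s 4 + Y s 4 * V s 4)) s :=
    fun s => by
      have h3 := hasDerivAt_coord (hY s) 3
      have h4 := hasDerivAt_coord (hY s) 4
      exact ((h3.mul h3).add (h4.mul h4)).congr_deriv (by ring)
  have hder : ∀ s, HasDerivAt h
      ((Y s 3 * V s 3 + Y s 3 * V s 3 + (Y s 4 * V s 4 + Y s 4 * V s 4)) /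
        (2 * Real.sqrt (u s + μ ^ 2))) s := fun s =>
    ((hdu s).add_const (μ ^ 2)).sqrt (hupos s).ne'
  have hbound : ∀ s ∈ Icc (0 : ℝ) 1,
      (Y s 3 * V s 3 + Y s 3 * V s 3 + (Y s 4 * V s 4 + Y s 4 * V s 4)) /
        (2 * Real.sqrt (u s + μ ^ 2)) ≤ ρ := by
    intro s hs
    have hs' : s ∈ Icc (0 : ℝ) (8 / 5) := ⟨hs.1, by linarith [hs.2]⟩
    have hhpos : 0 < Real.sqrt (u s + μ ^ 2) := Real.sqrt_pos.2 (hupos s)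
    rw [div_le_iff₀ (by positivity)]
    have hVs := hV s (mem_Ico_of_mem_window hT hs')
    have hθ3 := abs_coord_defect_le hVs 3
    have hθ4 := abs_coord_defect_le hVs 4
    rw [field_three] at hθ3
    rw [field_four] at hθ4
    have hcs : |Y s 2| ≤ 3 * ε ^ 2 * exp (-(M / 2)) :=
      abs_c_le_unit_w hY hV hR hT hK hML hMK hε hεle h0 hB hs
    have ha : |Y s 0| ≤ 2 := abs_apply_le_of_norm_le (hR s (mem_Ico_of_mem_window hT hs')) 0
    have hds : |Y s 3| ≤ Real.sqrt (u s + μ ^ 2) :=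
      abs_le_sqrt (by simp only [hu]; nlinarith [mul_self_nonneg (Y s 4)])
    have hes : |Y s 4| ≤ Real.sqrt (u s + μ ^ 2) :=
      abs_le_sqrt (by simp only [hu]; nlinarith [mul_self_nonneg (Y s 3)])
    -- split V₃ = F₃ + θ₃, V₄ = F₄ + θ₄; the pump terms cancel: d·F₃ + ã·F₄ = ε⁻²·c·a·d
    have hid : Y s 3 * V s 3 + Y s 4 * V s 4 =
        Y s 3 * (V s 3 - ((ε ^ 2)⁻¹ * Y s 2 * Y s 0 - K * Y s 3 * Y s 4)) +
        Y s 4 * (V s 4 - K * Y s 3 ^ 2) + (ε ^ 2)⁻¹ * (Y s 2 * Y s 0 * Y s 3) := by ring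
    have h1 : |Y s 3 * (V s 3 - ((ε ^ 2)⁻¹ * Y s 2 * Y s 0 - K * Y s 3 * Y s 4))| ≤
        Real.sqrt (u s + μ ^ 2) * δ := by
      rw [abs_mul]; exact mul_le_mul hds hθ3 (abs_nonneg _) hhpos.le
    have h2 : |Y s 4 * (V s 4 - K * Y s 3 ^ 2)| ≤ Real.sqrt (u s + μ ^ 2) * δ := by
      rw [abs_mul]; exact mul_le_mul hes hθ4 (abs_nonneg _) hhpos.le
    have h3 : |(ε ^ 2)⁻¹ * (Y s 2 * Y s 0 * Y s 3)| ≤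
        (ε ^ 2)⁻¹ * (3 * ε ^ 2 * exp (-(M / 2)) * 2 * Real.sqrt (u s + μ ^ 2)) := by
      rw [abs_mul, abs_of_pos (by positivity : (0 : ℝ) < (ε ^ 2)⁻¹), abs_mul, abs_mul]
      refine mul_le_mul_of_nonneg_left ?_ (by positivity)
      exact mul_le_mul (mul_le_mul hcs ha (abs_nonneg _) (by positivity)) hds (abs_nonneg _)
        (by positivity)
    have h3' : (ε ^ 2)⁻¹ * (3 * ε ^ 2 * exp (-(M / 2)) * 2 * Real.sqrt (u s + μ ^ 2)) =
        6 * exp (-(M / 2)) * Real.sqrt (u s + μ ^ 2) := by field_simp; ring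
    rw [h3'] at h3
    have e1 := (le_abs_self _).trans h1
    have e2 := (le_abs_self _).trans h2
    have e3 := (le_abs_self _).trans h3
    have hsum : Y s 3 * V s 3 + Y s 4 * V s 4 ≤ ρ * Real.sqrt (u s + μ ^ 2) := by
      rw [hid, hρ]
      linarith
    linarith
  have hanti := Thm53.antitoneOn_sub_of_deriv_le (Φ := fun s => ρ * s)
    (convex_Icc (0 : ℝ) 1) (fun s _ => hder s)
    (fun s _ => ((hasDerivAt_id s).const_mul ρ).congr_deriv (by simp)) hbound
  have hmono := hanti (left_mem_Icc.2 zero_le_one) ht ht.1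
  have hh0 : h 0 ≤ 2 * δ₀ + μ := by
    simp only [hh, hu]
    have hsq : Y 0 3 * Y 0 3 + Y 0 4 * Y 0 4 + μ ^ 2 ≤ (|Y 0 3| + |Y 0 4| + μ) ^ 2 :=
      sq_add_sq_add_sq_le _ _ _ hμ.le
    calc Real.sqrt (Y 0 3 * Y 0 3 + Y 0 4 * Y 0 4 + μ ^ 2)
        ≤ Real.sqrt ((|Y 0 3| + |Y 0 4| + μ) ^ 2) := Real.sqrt_le_sqrt hsq
      _ = |Y 0 3| + |Y 0 4| + μ := Real.sqrt_sq (by positivity)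
      _ ≤ 2 * δ₀ + μ := by linarith
  simp only [mul_zero, sub_zero] at hmono
  show h t ≤ 2 * δ₀ + μ + ρ * t
  linarith

/-- **The carrier on the first unit of time**: `a(t)² ≥ 999/1000` for `t ∈ [0,1]`
(energy `≥ 1 - 2ε²e^{-M}`, and `b², c², d², ã²` are `≤ 4ε², 9ε⁴e^{-M}, 49e^{-M}, 49e^{-M}`).
[cite: Tao2016AveragedNS, §5.5 (energy-con)] -/
theorem a_sq_ge_unit_w (hB : WideBudget M ε δ δ₀) {t : ℝ} (ht : t ∈ Icc (0 : ℝ) 1) : 999 / 1000 ≤ Y t 0 ^ 2 := by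
  obtain ⟨hM6000, hε1, hε2, hexpM, hMe, -, hMse, -, -⟩ := ignition_params hK hML hMK hε hεle
  obtain ⟨hδ₀, hδ, hη8, hδ₀1, h732, hs1⟩ := budget_facts_w hV hT hK hML hMK hε hεle h0 hB
  have ht' : t ∈ Icc (0 : ℝ) (8 / 5) := ⟨ht.1, by linarith [ht.2]⟩
  have hE := (abs_le.1 (abs_energy_sub_one_le hY hV hR hT h0 hδ₀1 ht')).1
  rw [energy_five] at hE
  obtain ⟨hb1, hb2⟩ := b_bounds_unit_w hY hV hR hT hK hML hMK hε hεle h0 hB ht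
  have hc := abs_c_le_unit_w hY hV hR hT hK hML hMK hε hεle h0 hB ht
  obtain ⟨hd, he⟩ := de_le_unit_w hY hV hR hT hK hML hMK hε hεle h0 hB ht
  have hb : Y t 1 ^ 2 ≤ 4 * ε ^ 2 := by nlinarith
  have hsq : ∀ x C : ℝ, |x| ≤ C → x ^ 2 ≤ C ^ 2 := fun x C h => by
    rw [← sq_abs]; exact pow_le_pow_left₀ (abs_nonneg x) h 2
  have hc2 := hsq _ _ hc
  have hd2 := hsq _ _ hd
  have he2 := hsq _ _ he
  have hex : exp (-(M / 2)) ^ 2 = exp (-M) := by rw [← exp_nat_mul]; ring_nf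
  have h1 : (3 * ε ^ 2 * exp (-(M / 2))) ^ 2 ≤ 1 / 1000000 := by
    rw [mul_pow, hex]; nlinarith
  have h2 : (7 * exp (-(M / 2))) ^ 2 ≤ 49 / 1000000 := by
    rw [mul_pow, hex]; nlinarith
  nlinarith

/-- **The clock on the first unit of time, from below**: `b(t) ≥ -δ₀ + (99/100)εt` on `[0,1]`
(`ḃ ≥ (999/1000)ε - 9Mε³e^{-M} - δ`). [cite: Tao2016AveragedNS, §5.5 (5.5)] -/
theorem b_ge_unit_w (hB : WideBudget M ε δ δ₀) {t : ℝ} (ht : t ∈ Icc (0 : ℝ) 1) : -δ₀ + 99 / 100 * ε * t ≤ Y t 1 := by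
  obtain ⟨hM6000, hε1, -, hexpM, hMe, -, hMse, -, -⟩ := ignition_params hK hML hMK hε hεle
  obtain ⟨hδ₀, hδ, hη8, hδ₀1, h732, hs1⟩ := budget_facts_w hV hT hK hML hMK hε hεle h0 hB
  set C : ℝ := 3 * ε ^ 2 * exp (-(M / 2)) with hC
  have hC2 : ε⁻¹ * M * C ^ 2 = 9 * M * ε ^ 3 * exp (-M) := by
    have : exp (-(M / 2)) ^ 2 = exp (-M) := by rw [← exp_nat_mul]; ring_nf
    rw [hC, mul_pow, mul_pow, this]; field_simp; ring
  have hrate : 99 / 100 * ε ≤ ε * (999 / 1000) - (ε⁻¹ * M * C ^ 2 + δ) := by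
    rw [hC2]
    have h4 : 9 * M * ε ^ 3 * exp (-M) ≤ ε / 1000 := by nlinarith
    have h5 : δ ≤ ε / 1000 := by nlinarith
    nlinarith
  have hmono := Thm53.monotoneOn_sub_of_le_deriv (s := Icc (0 : ℝ) 1) (f := fun s => Y s 1)
    (φ := fun _ => 99 / 100 * ε) (Φ := fun u => 99 / 100 * ε * u)
    (convex_Icc 0 1) (fun u _ => hasDerivAt_coord (hY u) 1)
    (fun u _ => by simpa using (hasDerivAt_id u).const_mul (99 / 100 * ε))
    (fun u hu => by
      have hu' : u ∈ Icc (0 : ℝ) (8 / 5) := ⟨hu.1, by linarith [hu.2]⟩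
      have hθ := (abs_le.1 (abs_coord_defect_le (hV u (mem_Ico_of_mem_window hT hu')) 1)).1
      rw [field_one] at hθ
      have hc : Y u 2 ^ 2 ≤ C ^ 2 := by
        have := abs_c_le_unit_w hY hV hR hT hK hML hMK hε hεle h0 hB hu
        rw [← sq_abs]; exact pow_le_pow_left₀ (abs_nonneg _) this 2
      have ha := a_sq_ge_unit_w hY hV hR hT hK hML hMK hε hεle h0 hB hu
      have h1 : ε * (999 / 1000) ≤ ε * Y u 0 ^ 2 := mul_le_mul_of_nonneg_left ha hε.le
      have h2 : ε⁻¹ * M * Y u 2 ^ 2 ≤ ε⁻¹ * M * C ^ 2 :=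
        mul_le_mul_of_nonneg_left hc (by positivity)
      linarith)
  have h := hmono (left_mem_Icc.2 zero_le_one) ht ht.1
  have hb0 := (abs_le.1 (abs_init_coord_le h0).1).1
  simp only [mul_zero, sub_zero] at h
  linarith

/-- **The clock integral on the first unit of time, from below**:
`G(u) ≥ (99/200)Mu² - ε⁻¹Mδ₀u ≥ (99/200)Mu² - 1/320` on `[0,1]`. [cite: Tao2016AveragedNS, §5.5] -/
theorem clockInt_ge_unit_w (hB : WideBudget M ε δ δ₀) {u : ℝ} (hu : u ∈ Icc (0 : ℝ) 1) :
    99 / 200 * M * u ^ 2 - 1 / 320 ≤ clockInt ε M Y u := by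
  obtain ⟨hM6000, hε1, -, hexpM, hMe, -, hMse, -, -⟩ := ignition_params hK hML hMK hε hεle
  obtain ⟨hδ₀, hδ, hη8, hδ₀1, h732, hs1⟩ := budget_facts_w hV hT hK hML hMK hε hεle h0 hB
  have hM0 : 0 < M := by linarith
  have hmono := Thm53.monotoneOn_sub_of_le_deriv (s := Icc (0 : ℝ) 1) (f := clockInt ε M Y)
    (φ := fun r => ε⁻¹ * M * (-δ₀ + 99 / 100 * ε * r))
    (Φ := fun r => ε⁻¹ * M * (-δ₀ * r + 99 / 100 * ε * r ^ 2 / 2)) (convex_Icc 0 1)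
    (fun r _ => hasDerivAt_clockIntA hY r)
    (fun r _ => by
      have h := (((hasDerivAt_id' r).const_mul (-δ₀)).add
        (((hasDerivAt_pow 2 r).const_mul (99 / 100 * ε)).div_const 2)).const_mul (ε⁻¹ * M)
      refine h.congr_deriv ?_
      have e : ((2 : ℕ) : ℝ) * r ^ (2 - 1) = 2 * r := by norm_num
      rw [e]; ring)
    (fun r hr => mul_le_mul_of_nonneg_left
      (b_ge_unit_w hY hV hR hT hK hML hMK hε hεle h0 hB hr) (by positivity))
  have h := hmono (left_mem_Icc.2 zero_le_one) hu hu.1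
  simp only [clockInt_zero, mul_zero] at h
  have h1 : ε⁻¹ * M * (-δ₀ * u + 99 / 100 * ε * u ^ 2 / 2) =
      99 / 200 * M * u ^ 2 - ε⁻¹ * M * δ₀ * u := by field_simp; ring
  have h2 : ε⁻¹ * M * δ₀ * u ≤ 1 / 320 := by
    obtain ⟨hMe6, -, -, -⟩ := wide_params hK hML hMK hε hεle
    have h21 : ε⁻¹ * M * δ₀ ≤ ε⁻¹ * M * (5 / 2 * (ε ^ 2 * exp (-M))) :=
      mul_le_mul_of_nonneg_left (by linarith) (by positivity)
    have h22 : ε⁻¹ * M * (5 / 2 * (ε ^ 2 * exp (-M))) = 5 / 2 * (M * ε * exp (-M)) := by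
      field_simp
    have h24 : 0 ≤ ε⁻¹ * M * δ₀ := by positivity
    nlinarith [hu.1, hu.2]
  nlinarith [h, h1, h2]

omit hR in
/-- **Persistence of the discounted trigger**: if `G ≥ -1/100` on `[0,τ]`, `τ ≤ 8/5`, then
`D(t) ≥ D(r) - (102/100)δ(t - r)` for `0 ≤ r ≤ t ≤ τ` (`D' ≥ -δe^{-G}`). [cite: Tao2016AveragedNS, §5.5] -/
theorem disc_persist_w (hB : WideBudget M ε δ δ₀) {τ : ℝ} (hτ : τ ≤ 8 / 5)
    (hG : ∀ u ∈ Icc (0 : ℝ) τ, -(1 / 100) ≤ clockInt ε M Y u) {r t : ℝ} (hr : 0 ≤ r)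
    (hrt : r ≤ t) (ht : t ≤ τ) :
    Y r 2 * exp (-clockInt ε M Y r) - 102 / 100 * δ * (t - r) ≤
      Y t 2 * exp (-clockInt ε M Y t) := by
  obtain ⟨hδ₀, hδ, -, -, -, -⟩ := budget_facts_w hV hT hK hML hMK hε hεle h0 hB
  have he : exp (1 / 100 : ℝ) ≤ 102 / 100 := by
    have h := add_one_le_exp (-(1 / 100 : ℝ))
    have h' : exp (1 / 100 : ℝ) * exp (-(1 / 100 : ℝ)) = 1 := by rw [← exp_add]; simp
    nlinarith [exp_pos (1 / 100 : ℝ), exp_pos (-(1 / 100 : ℝ))]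
  have hmono := Thm53.monotoneOn_sub_of_le_deriv (s := Icc (0 : ℝ) τ)
    (f := fun s => Y s 2 * exp (-clockInt ε M Y s)) (φ := fun _ => -(102 / 100 * δ))
    (Φ := fun u => -(102 / 100 * δ) * u) (convex_Icc 0 τ) (fun u _ => hasDerivAt_discA hY u)
    (fun u _ => by simpa using (hasDerivAt_id u).const_mul (-(102 / 100 * δ)))
    (fun u hu => by
      have hu' : u ∈ Icc (0 : ℝ) (8 / 5) := ⟨hu.1, hu.2.trans hτ⟩
      have h1 := disc_deriv_geA hV hT hu' (K := K)
      have h2 : exp (-clockInt ε M Y u) ≤ 102 / 100 :=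
        (exp_le_exp.2 (by linarith [hG u hu])).trans he
      have h3 : 0 ≤ ε ^ 2 * exp (-M) * Y u 0 ^ 2 * exp (-clockInt ε M Y u) := by positivity
      have h4 : δ * exp (-clockInt ε M Y u) ≤ 102 / 100 * δ := by nlinarith [exp_pos (-clockInt ε M Y u)]
      nlinarith [exp_pos (-clockInt ε M Y u)])
  have h := hmono ⟨hr, hrt.trans ht⟩ ⟨hr.trans hrt, ht⟩ hrt
  simp only at h
  linarith

/-! ## §4. If the trigger stayed below `ε²`: the clock keeps running and the deposit is amplified -/

omit hR in
/-- If `|c| ≤ ε²` on the window, the clock integral stays `≥ -1/100` there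
(`b ≥ -δ₀ - (8/5)(Mε³ + δ)`, and `ε⁻¹M` times that is `≤ 1/160`). [cite: Tao2016AveragedNS, §5.5] -/
theorem clockInt_ge_of_small_w (hB : WideBudget M ε δ δ₀) (hc : ∀ t ∈ Icc (0 : ℝ) (8 / 5), |Y t 2| ≤ ε ^ 2) {u : ℝ}
    (hu : u ∈ Icc (0 : ℝ) (8 / 5)) : -(1 / 100) ≤ clockInt ε M Y u := by
  obtain ⟨hM6000, hε1, hε2, hexpM, hMe, hMe2, hMse, h77, hsM⟩ := ignition_params hK hML hMK hε hεle
  obtain ⟨hδ₀, hδ, hη8, hδ₀1, h732, hs1⟩ := budget_facts_w hV hT hK hML hMK hε hεle h0 hB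
  have hM0 : 0 < M := by linarith
  have hb0 := (abs_le.1 (abs_init_coord_le h0).1).1
  -- the clock floor β
  obtain ⟨β, hβ⟩ : ∃ β : ℝ, β = δ₀ + 8 / 5 * (M * ε ^ 3 + δ) := ⟨_, rfl⟩
  have hβ0 : 0 ≤ β := by rw [hβ]; positivity
  have hbfloor : ∀ v ∈ Icc (0 : ℝ) (8 / 5), -β ≤ Y v 1 := by
    intro v hv
    have h := b_sub_ge_of_small hY hV hT hK hML hMK hε hεle hc le_rfl hv.1 hv.2
    have h1 : (M * ε ^ 3 + δ) * (v - 0) ≤ (M * ε ^ 3 + δ) * (8 / 5) :=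
      mul_le_mul_of_nonneg_left (by linarith [hv.2]) (by positivity)
    rw [hβ]; linarith
  have hfl : ε⁻¹ * M * β ≤ 1 / 160 := by
    have h1 : ε⁻¹ * M * β = ε⁻¹ * M * (δ₀ + 8 / 5 * δ) + 8 / 5 * (M ^ 2 * ε ^ 2) := by
      rw [hβ]; field_simp; ring
    have h2 : ε⁻¹ * M * (δ₀ + 8 / 5 * δ) ≤ ε⁻¹ * M * (5 / 2 * (ε ^ 2 * exp (-M))) :=
      mul_le_mul_of_nonneg_left (by linarith) (by positivity)
    have h3 : ε⁻¹ * M * (5 / 2 * (ε ^ 2 * exp (-M))) = 5 / 2 * (M * ε * exp (-M)) := by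
      field_simp
    obtain ⟨hMe6, -, -, -⟩ := wide_params hK hML hMK hε hεle
    linarith
  have hmono := Thm53.monotoneOn_sub_of_le_deriv (s := Icc (0 : ℝ) (8 / 5))
    (f := clockInt ε M Y) (φ := fun _ => -(ε⁻¹ * M * β))
    (Φ := fun v => -(ε⁻¹ * M * β) * v) (convex_Icc 0 _)
    (fun v _ => hasDerivAt_clockIntA hY v)
    (fun v _ => by simpa using (hasDerivAt_id v).const_mul (-(ε⁻¹ * M * β)))
    (fun v hv => by
      have h1 : ε⁻¹ * M * (-β) ≤ ε⁻¹ * M * Y v 1 :=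
        mul_le_mul_of_nonneg_left (hbfloor v hv) (by positivity)
      linarith)
  have h := hmono (left_mem_Icc.2 (by norm_num)) hu hu.1
  simp only [clockInt_zero, mul_zero, sub_zero] at h
  have h5 : ε⁻¹ * M * β * u ≤ 1 / 160 * (8 / 5) := mul_le_mul hfl hu.2 hu.1 (by norm_num)
  linarith

/-- If `|c| ≤ ε²` on the window, the clock is still running on `[1, 8/5]`: `b ≥ (49/50)ε`.
[cite: Tao2016AveragedNS, §5.5 (5.5)] -/
theorem b_ge_late_of_small_w (hB : WideBudget M ε δ δ₀) (hc : ∀ t ∈ Icc (0 : ℝ) (8 / 5), |Y t 2| ≤ ε ^ 2) {t : ℝ}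
    (ht : t ∈ Icc (1 : ℝ) (8 / 5)) : 49 / 50 * ε ≤ Y t 1 := by
  obtain ⟨hM6000, hε1, hε2, hexpM, hMe, hMe2, hMse, h77, hsM⟩ := ignition_params hK hML hMK hε hεle
  obtain ⟨hδ₀, hδ, hη8, hδ₀1, h732, hs1⟩ := budget_facts_w hV hT hK hML hMK hε hεle h0 hB
  have h1 := b_ge_unit_w hY hV hR hT hK hML hMK hε hεle h0 hB (t := 1) ⟨zero_le_one, le_rfl⟩
  have h2 := b_sub_ge_of_small hY hV hT hK hML hMK hε hεle hc zero_le_one ht.1 ht.2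
  have hε300 : ε ≤ 1 / 300 :=
    le_of_pow_le_pow_left₀ two_ne_zero (by norm_num) (hε2.trans (by norm_num))
  have h3 : M * ε ^ 3 = M * ε * ε ^ 2 := by ring
  have h4 : M * ε * ε ^ 2 ≤ 1 / 40 * ε ^ 2 := mul_le_mul_of_nonneg_right hMe (sq_nonneg ε)
  have h5 : ε ^ 2 ≤ ε * (1 / 300) := by rw [sq]; exact mul_le_mul_of_nonneg_left hε300 hε.le
  have h6 : ε ^ 2 * exp (-M) ≤ ε ^ 2 := mul_le_of_le_one_right (sq_nonneg ε) (by linarith)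
  have h7 : (M * ε ^ 3 + δ) * (t - 1) ≤ (M * ε ^ 3 + δ) * (3 / 5) :=
    mul_le_mul_of_nonneg_left (by linarith [ht.2]) (by positivity)
  linarith

/-- If `|c| ≤ ε²` on the window, the clock integral at the end of the window is large:
`G(8/5) ≥ G(1) + (49/50)(3/5)M ≥ (1083/1000)M - 1/320`. [cite: Tao2016AveragedNS, §5.5] -/
theorem clockInt_late_of_small_w (hB : WideBudget M ε δ δ₀) (hc : ∀ t ∈ Icc (0 : ℝ) (8 / 5), |Y t 2| ≤ ε ^ 2) :
    1083 / 1000 * M - 1 / 320 ≤ clockInt ε M Y (8 / 5) := by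
  obtain ⟨hM6000, -, -, -, -, -, -, -, -⟩ := ignition_params hK hML hMK hε hεle
  have hG1 := clockInt_ge_unit_w hY hV hR hT hK hML hMK hε hεle h0 hB (u := 1) ⟨zero_le_one, le_rfl⟩
  have hmono := Thm53.monotoneOn_sub_of_le_deriv (s := Icc (1 : ℝ) (8 / 5))
    (f := clockInt ε M Y) (φ := fun _ => 49 / 50 * M) (Φ := fun u => 49 / 50 * M * u)
    (convex_Icc 1 _) (fun u _ => hasDerivAt_clockIntA hY u)
    (fun u _ => by simpa using (hasDerivAt_id u).const_mul (49 / 50 * M))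
    (fun u hu => by
      have h1 : ε⁻¹ * M * (49 / 50 * ε) ≤ ε⁻¹ * M * Y u 1 :=
        mul_le_mul_of_nonneg_left (b_ge_late_of_small_w hY hV hR hT hK hML hMK hε hεle h0 hB hc hu)
          (by have : (0 : ℝ) ≤ M := by linarith
              positivity)
      have h2 : ε⁻¹ * M * (49 / 50 * ε) = 49 / 50 * M := by field_simp
      linarith)
  have h := hmono (left_mem_Icc.2 (by norm_num)) (right_mem_Icc.2 (by norm_num)) (by norm_num)
  simp only at h
  linarith


omit hR in
/-- If `|c| ≤ ε²` on `[0, τ]` (`τ ≤ 8/5`), the clock integral stays `≥ -1/100` on `[0, τ]`.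
[cite: Tao2016AveragedNS, §5.5] -/
theorem clockInt_ge_of_smallH_w (hB : WideBudget M ε δ δ₀) {τ : ℝ} (hτ : τ ≤ 8 / 5)
    (hc : ∀ t ∈ Icc (0 : ℝ) τ, |Y t 2| ≤ ε ^ 2) {u : ℝ} (hu : u ∈ Icc (0 : ℝ) τ) :
    -(1 / 100) ≤ clockInt ε M Y u := by
  obtain ⟨hM6000, hε1, hε2, hexpM, hMe, hMe2, hMse, h77, hsM⟩ := ignition_params hK hML hMK hε hεle
  obtain ⟨hδ₀, hδ, hη8, hδ₀1, h732, hs1⟩ := budget_facts_w hV hT hK hML hMK hε hεle h0 hB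
  have hM0 : 0 < M := by linarith
  have hb0 := (abs_le.1 (abs_init_coord_le h0).1).1
  obtain ⟨β, hβ⟩ : ∃ β : ℝ, β = δ₀ + 8 / 5 * (M * ε ^ 3 + δ) := ⟨_, rfl⟩
  have hβ0 : 0 ≤ β := by rw [hβ]; positivity
  have hbfloor : ∀ v ∈ Icc (0 : ℝ) τ, -β ≤ Y v 1 := by
    intro v hv
    have h := b_sub_ge_of_smallH hY hV hT hK hML hMK hε hεle hτ hc le_rfl hv.1 hv.2
    have h1 : (M * ε ^ 3 + δ) * (v - 0) ≤ (M * ε ^ 3 + δ) * (8 / 5) :=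
      mul_le_mul_of_nonneg_left (by linarith [hv.2]) (by positivity)
    rw [hβ]; linarith
  have hfl : ε⁻¹ * M * β ≤ 1 / 160 := by
    have h1 : ε⁻¹ * M * β = ε⁻¹ * M * (δ₀ + 8 / 5 * δ) + 8 / 5 * (M ^ 2 * ε ^ 2) := by
      rw [hβ]; field_simp; ring
    have h2 : ε⁻¹ * M * (δ₀ + 8 / 5 * δ) ≤ ε⁻¹ * M * (5 / 2 * (ε ^ 2 * exp (-M))) :=
      mul_le_mul_of_nonneg_left (by linarith) (by positivity)
    have h3 : ε⁻¹ * M * (5 / 2 * (ε ^ 2 * exp (-M))) = 5 / 2 * (M * ε * exp (-M)) := by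
      field_simp
    obtain ⟨hMe6, -, -, -⟩ := wide_params hK hML hMK hε hεle
    linarith
  have hmono := Thm53.monotoneOn_sub_of_le_deriv (s := Icc (0 : ℝ) τ)
    (f := clockInt ε M Y) (φ := fun _ => -(ε⁻¹ * M * β))
    (Φ := fun v => -(ε⁻¹ * M * β) * v) (convex_Icc 0 _)
    (fun v _ => hasDerivAt_clockIntA hY v)
    (fun v _ => by simpa using (hasDerivAt_id v).const_mul (-(ε⁻¹ * M * β)))
    (fun v hv => by
      have h1 : ε⁻¹ * M * (-β) ≤ ε⁻¹ * M * Y v 1 :=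
        mul_le_mul_of_nonneg_left (hbfloor v hv) (by positivity)
      linarith)
  have h := hmono (left_mem_Icc.2 (hu.1.trans hu.2)) hu hu.1
  simp only [clockInt_zero, mul_zero, sub_zero] at h
  have h5 : ε⁻¹ * M * β * u ≤ 1 / 160 * (8 / 5) := mul_le_mul hfl (hu.2.trans hτ) hu.1 (by norm_num)
  linarith

/-- If `|c| ≤ ε²` on `[0, τ]` (`τ ≤ 8/5`), the clock is still running on `[1, τ]`: `b ≥ (49/50)ε`.
[cite: Tao2016AveragedNS, §5.5 (5.5)] -/
theorem b_ge_late_of_smallH_w (hB : WideBudget M ε δ δ₀) {τ : ℝ} (hτ : τ ≤ 8 / 5)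
    (hc : ∀ t ∈ Icc (0 : ℝ) τ, |Y t 2| ≤ ε ^ 2) {t : ℝ} (ht : t ∈ Icc (1 : ℝ) τ) :
    49 / 50 * ε ≤ Y t 1 := by
  obtain ⟨hM6000, hε1, hε2, hexpM, hMe, hMe2, hMse, h77, hsM⟩ := ignition_params hK hML hMK hε hεle
  obtain ⟨hδ₀, hδ, hη8, hδ₀1, h732, hs1⟩ := budget_facts_w hV hT hK hML hMK hε hεle h0 hB
  have h1 := b_ge_unit_w hY hV hR hT hK hML hMK hε hεle h0 hB (t := 1) ⟨zero_le_one, le_rfl⟩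
  have h2 := b_sub_ge_of_smallH hY hV hT hK hML hMK hε hεle hτ hc zero_le_one ht.1 ht.2
  have hε300 : ε ≤ 1 / 300 :=
    le_of_pow_le_pow_left₀ two_ne_zero (by norm_num) (hε2.trans (by norm_num))
  have h3 : M * ε ^ 3 = M * ε * ε ^ 2 := by ring
  have h4 : M * ε * ε ^ 2 ≤ 1 / 40 * ε ^ 2 := mul_le_mul_of_nonneg_right hMe (sq_nonneg ε)
  have h5 : ε ^ 2 ≤ ε * (1 / 300) := by rw [sq]; exact mul_le_mul_of_nonneg_left hε300 hε.le
  have h6 : ε ^ 2 * exp (-M) ≤ ε ^ 2 := mul_le_of_le_one_right (sq_nonneg ε) (by linarith)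
  have h7 : (M * ε ^ 3 + δ) * (t - 1) ≤ (M * ε ^ 3 + δ) * (3 / 5) :=
    mul_le_mul_of_nonneg_left (by linarith [ht.2]) (by positivity)
  linarith

/-- If `|c| ≤ ε²` on `[0, τ]` (`τ ≤ 8/5`), the clock mode stays in `[-2ε, 2ε]` on `[0, τ]`.
[cite: Tao2016AveragedNS, §5.5 (5.5)] -/
theorem abs_b_le_of_smallH_w (hB : WideBudget M ε δ δ₀) {τ : ℝ} (hτ : τ ≤ 8 / 5)
    (hc : ∀ t ∈ Icc (0 : ℝ) τ, |Y t 2| ≤ ε ^ 2) {t : ℝ} (ht : t ∈ Icc (0 : ℝ) τ) :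
    |Y t 1| ≤ 2 * ε := by
  obtain ⟨hM6000, hε1, hε2, hexpM, hMe, hMe2, hMse, h77, hsM⟩ := ignition_params hK hML hMK hε hεle
  obtain ⟨hδ₀, hδ, hη8, hδ₀1, h732, hs1⟩ := budget_facts_w hV hT hK hML hMK hε hεle h0 hB
  have ht' : t ∈ Icc (0 : ℝ) (8 / 5) := ⟨ht.1, ht.2.trans hτ⟩
  have hM : (0 : ℝ) ≤ M := by linarith
  have hup := b_le hY hV hR hT h0 hδ₀1 hε hM ht'
  have hb0 := (abs_le.1 (abs_init_coord_le h0).1).1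
  have hlow := b_sub_ge_of_smallH hY hV hT hK hML hMK hε hεle hτ hc le_rfl ht.1 ht.2
  have hε300 : ε ≤ 1 / 300 :=
    le_of_pow_le_pow_left₀ two_ne_zero (by norm_num) (hε2.trans (by norm_num))
  have h3 : M * ε ^ 3 = M * ε * ε ^ 2 := by ring
  have h4 : M * ε * ε ^ 2 ≤ 1 / 40 * ε ^ 2 := mul_le_mul_of_nonneg_right hMe (sq_nonneg ε)
  have h5 : ε ^ 2 ≤ ε * (1 / 300) := by rw [sq]; exact mul_le_mul_of_nonneg_left hε300 hε.le
  have h6 : ε ^ 2 * exp (-M) ≤ ε ^ 2 := mul_le_of_le_one_right (sq_nonneg ε) (by linarith)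
  have h7 : (M * ε ^ 3 + δ) * (t - 0) ≤ (M * ε ^ 3 + δ) * (8 / 5) :=
    mul_le_mul_of_nonneg_left (by linarith [ht'.2]) (by positivity)
  have h8 : (ε * (1 + 7 * δ₀ + 32 * δ) + δ) * t ≤ (ε * (1 + 7 * δ₀ + 32 * δ) + δ) * (8 / 5) :=
    mul_le_mul_of_nonneg_left ht'.2 (by positivity)
  have h732' : 7 * δ₀ + 32 * δ ≤ 36 * (ε ^ 2 * exp (-M)) := by
    have : 0 ≤ ε ^ 2 * exp (-M) := by positivity
    linarith
  have h9 : ε * (7 * δ₀ + 32 * δ) ≤ 1 / 300 * (36 * (ε ^ 2 * exp (-M))) :=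
    mul_le_mul hε300 h732' (by positivity) (by norm_num)
  rw [abs_le]; constructor <;> linarith

end Wide

/-! ## §2. Transition, equipartition and firing after the entry time, wide budget -/

section Late

variable {T' : ℝ} (hT'T : T' < T) (hT'2 : T' ≤ 2)
include hT'T hT'2

section WideLate

variable (hK : 2 * 20 ^ 42 * (Nat.factorial 42 : ℝ) + 16 ≤ K) (hML : 3000 * Real.log K ≤ M)
  (hMK : M ≤ K ^ 10) (hε : 0 < ε) (hεle : ε ≤ exp (-(10 * M)) / K ^ 100)
  (h0 : ‖Y 0 - delayInit‖ ≤ δ₀)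
include hK hML hMK hε hεle h0

omit hY hR hT'T hT'2 in
/-- Budget arithmetic of the transition phase (wide budget): `ε²e^{-M} ≤ ε/10⁶`,
`3ε²e^{-M} ≤ ε²/K¹⁰`, `δ ≤ ε²e^{-M}`, `7δ₀ + 40δ ≤ 44ε²e^{-M}` (compare `late_facts'`:
`δ ≤ ε²e^{-M}/16`, `7δ₀ + 40δ ≤ (5/2)ε²e^{-M}`). [cite: Tao2016AveragedNS, §5.5] -/
theorem late_facts_w (hB : WideBudget M ε δ δ₀) :
    ε ^ 2 * exp (-M) ≤ ε / 1000000 ∧ 3 * (ε ^ 2 * exp (-M)) ≤ ε ^ 2 / K ^ 10 ∧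
      δ ≤ ε ^ 2 * exp (-M) ∧ 7 * δ₀ + 40 * δ ≤ 44 * (ε ^ 2 * exp (-M)) := by
  obtain ⟨hM6000, hε1, hε2, hexpM, -, -, -, h77, -⟩ := ignition_params hK hML hMK hε hεle
  obtain ⟨hδ₀, hδ, hη8, -, h732, -⟩ := budget_facts_w hV hT hK hML hMK hε hεle h0 hB
  obtain ⟨-, -, -, hsK, -⟩ := level_facts hK hML hMK hε hεle
  obtain ⟨hK16, -, -, -, -, -⟩ := negKick_params hK hML hMK hε hεle
  have hK0 : 0 < K := by linarith
  have hs0 : 0 ≤ ε ^ 2 * exp (-M) := by positivity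
  refine ⟨?_, ?_, by linarith, by linarith⟩
  · have h1 : ε * exp (-M) ≤ 1 * (1 / 1000000) := mul_le_mul hε1 hexpM (exp_pos _).le zero_le_one
    have h2 : ε ^ 2 * exp (-M) = ε * (ε * exp (-M)) := by ring
    rw [h2]
    have h3 : ε * (ε * exp (-M)) ≤ ε * (1 * (1 / 1000000)) := mul_le_mul_of_nonneg_left h1 hε.le
    linarith
  · rw [le_div_iff₀ (by positivity)]
    have h1 : exp (-M) * (3 * K ^ 10) ≤ 1 := (le_div_iff₀ (by positivity)).1 hsK
    have h2 : 3 * (ε ^ 2 * exp (-M)) * K ^ 10 = ε ^ 2 * (exp (-M) * (3 * K ^ 10)) := by ring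
    rw [h2]
    have h3 := mul_le_mul_of_nonneg_left h1 (sq_nonneg ε)
    linarith

/-- **The clock on the late window**: `b ≤ (201/100)ε` on `[0, T']`. [cite: Tao2016AveragedNS, §5.5 (5.5)] -/
theorem b_le_two_late_w (hB : WideBudget M ε δ δ₀) {t : ℝ} (ht : t ∈ Icc (0 : ℝ) T') : Y t 1 ≤ 201 / 100 * ε := by
  obtain ⟨hM6000, hε1, -, -, -, -, -, -, -⟩ := ignition_params hK hML hMK hε hεle
  obtain ⟨hδ₀, hδ, hη8, hδ₀1, -, -⟩ := budget_facts_w hV hT hK hML hMK hε hεle h0 hB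
  obtain ⟨hsε, -, -, hA⟩ := late_facts_w hV hT hK hML hMK hε hεle h0 hB
  have hb := b_le_late hY hV hR hT hT'T hT'2 h0 hδ₀1 hε (by linarith) ht
  have hA0 : 0 ≤ 7 * δ₀ + 40 * δ := by positivity
  have h1 : (ε * (1 + 7 * δ₀ + 40 * δ) + δ) * t ≤ (ε * (1 + 7 * δ₀ + 40 * δ) + δ) * 2 :=
    mul_le_mul_of_nonneg_left (ht.2.trans hT'2) (by positivity)
  have h2 : ε * (7 * δ₀ + 40 * δ) ≤ 1 * (7 * δ₀ + 40 * δ) := mul_le_mul_of_nonneg_right hε1 hA0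
  linarith

/-- **Clock increments on the late window**: `G(t) - G(u) ≤ (201/100)M(t - u)` for
`0 ≤ u ≤ t ≤ T'` (`G' = ε⁻¹Mb ≤ (201/100)M`). [cite: Tao2016AveragedNS, §5.5] -/
theorem clockInt_sub_le_late_w (hB : WideBudget M ε δ δ₀) {u t : ℝ} (hu : 0 ≤ u) (hut : u ≤ t) (ht : t ≤ T') :
    clockInt ε M Y t - clockInt ε M Y u ≤ 201 / 100 * M * (t - u) := by
  obtain ⟨hM6000, -, -, -, -, -, -, -, -⟩ := ignition_params hK hML hMK hε hεle
  have hM0 : 0 ≤ M := by linarith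
  obtain ⟨m, hm⟩ : ∃ m : ℝ, m = 201 / 100 * M := ⟨_, rfl⟩
  have hanti := Thm53.antitoneOn_sub_of_deriv_le (s := Icc (0 : ℝ) T') (f := clockInt ε M Y)
    (φ := fun _ => m) (Φ := fun v => m * v) (convex_Icc 0 T')
    (fun v _ => hasDerivAt_clockIntA hY v)
    (fun v _ => by simpa using (hasDerivAt_id v).const_mul m)
    (fun v hv => by
      have hb := b_le_two_late_w hY hV hR hT hT'T hT'2 hK hML hMK hε hεle h0 hB hv
      have h1 : ε⁻¹ * M * Y v 1 ≤ ε⁻¹ * M * (201 / 100 * ε) :=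
        mul_le_mul_of_nonneg_left hb (by positivity)
      have e : ε⁻¹ * M * (201 / 100 * ε) = m := by
        rw [show ε⁻¹ * M * (201 / 100 * ε) = 201 / 100 * M * (ε⁻¹ * ε) by ring,
          inv_mul_cancel₀ hε.ne', mul_one, hm]
      show ε⁻¹ * M * Y v 1 ≤ m
      linarith)
  have h := hanti ⟨hu, hut.trans ht⟩ ⟨hu.trans hut, ht⟩ hut
  simp only at h
  rw [hm] at h
  linarith

section Entry

variable {τ : ℝ} (hτ1 : 1 < τ) (hcτ : Y τ 2 = ε ^ 2 / K ^ 10) (hbτ : 49 / 50 * ε ≤ Y τ 1)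
include hτ1 hcτ hbτ

/-! ## §2. The a-priori size of the trigger after `τ` -/

omit hbτ in
/-- **A-priori bound after the trigger level.** On `[τ, T']`:
`|c(t)| ≤ 2(ε²/K¹⁰)·e^{(201/100)M(t-τ)}`. Both signs come from the discounted trigger
`D = c·e^{-G}`: `|D'| ≤ (ε²e^{-M}·(1+7δ₀+40δ) + δ)·e^{-G(u)}` and
`e^{-G(u)} ≤ e^{-G(t)}·e^{(201/100)M(t-u)}` (clock increments), integrated in closed form.
[cite: Tao2016AveragedNS, §5.5 (code)] -/
theorem abs_c_le_after_w (hB : WideBudget M ε δ δ₀) {t : ℝ} (ht : t ∈ Icc τ T') :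
    |Y t 2| ≤ 2 * (ε ^ 2 / K ^ 10) * exp (201 / 100 * M * (t - τ)) := by
  obtain ⟨hM6000, hε1, -, -, -, -, -, -, -⟩ := ignition_params hK hML hMK hε hεle
  obtain ⟨hδ₀, hδ, hη8, hδ₀1, -, hs1⟩ := budget_facts_w hV hT hK hML hMK hε hεle h0 hB
  obtain ⟨hℓ0, hℓε, -, -, -⟩ := level_facts hK hML hMK hε hεle
  obtain ⟨hsε, h3s, hδs, hA⟩ := late_facts_w hV hT hK hML hMK hε hεle h0 hB
  have hM0 : 0 < M := by linarith
  have hτ0 : (0 : ℝ) ≤ τ := by linarith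
  have hτt : τ ≤ t := ht.1
  obtain ⟨ℓ, hℓ⟩ : ∃ ℓ : ℝ, ℓ = ε ^ 2 / K ^ 10 := ⟨_, rfl⟩
  rw [← hℓ] at hℓ0 hℓε h3s hcτ ⊢
  obtain ⟨m, hm⟩ : ∃ m : ℝ, m = 201 / 100 * M := ⟨_, rfl⟩
  have hm0 : 0 < m := by rw [hm]; positivity
  have hm1 : 1 ≤ m := by rw [hm]; linarith
  obtain ⟨k, hk⟩ : ∃ k : ℝ, k = ε ^ 2 * exp (-M) * (1 + 7 * δ₀ + 40 * δ) + δ := ⟨_, rfl⟩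
  have hk0 : 0 ≤ k := by rw [hk]; positivity
  have hk2 : k ≤ 3 * (ε ^ 2 * exp (-M)) := by
    have h2 : ε ^ 2 * exp (-M) * (1 + 7 * δ₀ + 40 * δ) ≤
        ε ^ 2 * exp (-M) * (1 + 44 * (1 / 1000000)) :=
      mul_le_mul_of_nonneg_left (by linarith) (by positivity)
    rw [hk]; linarith
  have hkℓ : k / m ≤ ℓ := by
    have h1 : k / m ≤ k := div_le_self hk0 hm1
    linarith
  have hδm : δ / m ≤ ℓ := by
    have h1 : δ / m ≤ δ := div_le_self hδ hm1
    linarith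
  obtain ⟨E, hE⟩ : ∃ E : ℝ, E = exp (m * (t - τ)) := ⟨_, rfl⟩
  have hE0 : 0 < E := by rw [hE]; exact exp_pos _
  have hEgoal : exp (201 / 100 * M * (t - τ)) = E := by rw [hE, hm]
  -- clock increments
  have hGinc : ∀ u, 0 ≤ u → u ≤ t → clockInt ε M Y t - clockInt ε M Y u ≤ m * (t - u) := by
    intro u hu hut
    rw [hm]
    exact clockInt_sub_le_late_w hY hV hR hT hT'T hT'2 hK hML hMK hε hεle h0 hB hu hut ht.2
  have hexpG : ∀ u ∈ Icc τ t,
      exp (-clockInt ε M Y u) ≤ exp (-clockInt ε M Y t) * exp (m * (t - u)) := by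
    intro u hu
    rw [← exp_add]
    exact exp_le_exp.2 (by linarith [hGinc u (hτ0.trans hu.1) hu.2])
  -- the comparison functions `x ↦ ∓(r/m)·e^{m(t-x)}`
  have hcmp : ∀ r : ℝ, ∀ u : ℝ,
      HasDerivAt (fun x => -(r / m) * exp (m * (t - x))) (r * exp (m * (t - u))) u := by
    intro r u
    have h1 : HasDerivAt (fun x => m * (t - x)) (m * -1) u :=
      ((hasDerivAt_id' u).const_sub t).const_mul m
    refine ((h1.exp).const_mul (-(r / m))).congr_deriv ?_
    calc -(r / m) * (exp (m * (t - u)) * (m * -1)) = r * exp (m * (t - u)) * (m / m) := by ring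
      _ = r * exp (m * (t - u)) := by rw [div_self hm0.ne', mul_one]
  -- upper comparison
  obtain ⟨q, hq⟩ : ∃ q : ℝ, q = k * exp (-clockInt ε M Y t) := ⟨_, rfl⟩
  have hq0 : 0 ≤ q := by rw [hq]; positivity
  have hanti := Thm53.antitoneOn_sub_of_deriv_le (s := Icc τ t)
    (f := fun s => Y s 2 * exp (-clockInt ε M Y s))
    (φ := fun u => q * exp (m * (t - u))) (Φ := fun x => -(q / m) * exp (m * (t - x)))
    (convex_Icc τ t) (fun u _ => hasDerivAt_discA hY u) (fun u _ => hcmp q u)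
    (fun u hu => by
      have hu' : u ∈ Icc (0 : ℝ) T' := ⟨hτ0.trans hu.1, hu.2.trans ht.2⟩
      have h1 := disc_deriv_le_late hY hV hR hT hT'T hT'2 h0 hδ₀1 hu'
      rw [← hk] at h1
      have h2 : k * exp (-clockInt ε M Y u) ≤
          k * (exp (-clockInt ε M Y t) * exp (m * (t - u))) :=
        mul_le_mul_of_nonneg_left (hexpG u hu) hk0
      have h3 : k * (exp (-clockInt ε M Y t) * exp (m * (t - u))) = q * exp (m * (t - u)) := by
        rw [hq]; ring
      show (V u 2 - ε⁻¹ * M * Y u 1 * Y u 2) * exp (-clockInt ε M Y u) ≤ q * exp (m * (t - u))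
      linarith)
  have hup := hanti (left_mem_Icc.2 hτt) (right_mem_Icc.2 hτt) hτt
  simp only [sub_self, mul_zero, exp_zero, mul_one] at hup
  rw [← hE, hcτ] at hup
  have hqm : 0 ≤ q / m := div_nonneg hq0 hm0.le
  have key : Y t 2 * exp (-clockInt ε M Y t) ≤ ℓ * exp (-clockInt ε M Y τ) + q / m * E := by
    linarith [hup, hqm]
  -- lower comparison
  obtain ⟨p, hp⟩ : ∃ p : ℝ, p = δ * exp (-clockInt ε M Y t) := ⟨_, rfl⟩
  have hp0 : 0 ≤ p := by rw [hp]; positivity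
  have hmono := Thm53.monotoneOn_sub_of_le_deriv (s := Icc τ t)
    (f := fun s => Y s 2 * exp (-clockInt ε M Y s))
    (φ := fun u => -p * exp (m * (t - u))) (Φ := fun x => -(-p / m) * exp (m * (t - x)))
    (convex_Icc τ t) (fun u _ => hasDerivAt_discA hY u) (fun u _ => hcmp (-p) u)
    (fun u hu => by
      have hu' : u ∈ Icc (0 : ℝ) T' := ⟨hτ0.trans hu.1, hu.2.trans ht.2⟩
      have h1 := disc_deriv_ge_late hV hT'T hu' (K := K)
      have h2 : 0 ≤ ε ^ 2 * exp (-M) * Y u 0 ^ 2 * exp (-clockInt ε M Y u) := by positivity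
      have h3 : δ * exp (-clockInt ε M Y u) ≤
          δ * (exp (-clockInt ε M Y t) * exp (m * (t - u))) :=
        mul_le_mul_of_nonneg_left (hexpG u hu) hδ
      have h4 : δ * (exp (-clockInt ε M Y t) * exp (m * (t - u))) = p * exp (m * (t - u)) := by
        rw [hp]; ring
      show -p * exp (m * (t - u)) ≤ (V u 2 - ε⁻¹ * M * Y u 1 * Y u 2) * exp (-clockInt ε M Y u)
      linarith [h1, h2, h3, h4])
  have hlo := hmono (left_mem_Icc.2 hτt) (right_mem_Icc.2 hτt) hτt
  simp only [sub_self, mul_zero, exp_zero, mul_one] at hlo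
  rw [← hE, hcτ] at hlo
  have hpm : 0 ≤ p / m := div_nonneg hp0 hm0.le
  have key2 : ℓ * exp (-clockInt ε M Y τ) - p / m * E ≤ Y t 2 * exp (-clockInt ε M Y t) := by
    have e : -(-p / m) = p / m := by ring
    rw [e] at hlo
    linarith [hlo, hpm]
  -- undo the discount
  have hP : 0 < exp (clockInt ε M Y t) := exp_pos _
  have hinv : exp (-clockInt ε M Y t) * exp (clockInt ε M Y t) = 1 := by
    rw [← exp_add, neg_add_cancel, exp_zero]
  have hshift : exp (-clockInt ε M Y τ) * exp (clockInt ε M Y t) ≤ E := by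
    rw [← exp_add, hE]
    exact exp_le_exp.2 (by linarith [hGinc τ hτ0 hτt])
  have e1 : Y t 2 * exp (-clockInt ε M Y t) * exp (clockInt ε M Y t) = Y t 2 := by
    rw [mul_assoc, hinv, mul_one]
  have hu1 := mul_le_mul_of_nonneg_right key hP.le
  have hu2 : (ℓ * exp (-clockInt ε M Y τ) + q / m * E) * exp (clockInt ε M Y t) =
      ℓ * (exp (-clockInt ε M Y τ) * exp (clockInt ε M Y t)) +
        k / m * E * (exp (-clockInt ε M Y t) * exp (clockInt ε M Y t)) := by
    rw [hq]; ring
  rw [e1, hu2, hinv, mul_one] at hu1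
  have hu3 : ℓ * (exp (-clockInt ε M Y τ) * exp (clockInt ε M Y t)) ≤ ℓ * E :=
    mul_le_mul_of_nonneg_left hshift hℓ0.le
  have hu4 : k / m * E ≤ ℓ * E := mul_le_mul_of_nonneg_right hkℓ hE0.le
  have hl1 := mul_le_mul_of_nonneg_right key2 hP.le
  have hl2 : (ℓ * exp (-clockInt ε M Y τ) - p / m * E) * exp (clockInt ε M Y t) =
      ℓ * (exp (-clockInt ε M Y τ) * exp (clockInt ε M Y t)) -
        δ / m * E * (exp (-clockInt ε M Y t) * exp (clockInt ε M Y t)) := by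
    rw [hp]; ring
  rw [e1, hl2, hinv, mul_one] at hl1
  have hl3 : 0 ≤ ℓ * (exp (-clockInt ε M Y τ) * exp (clockInt ε M Y t)) := by positivity
  have hl4 : δ / m * E ≤ ℓ * E := mul_le_mul_of_nonneg_right hδm hE0.le
  have hℓE : 0 ≤ ℓ * E := by positivity
  rw [hEgoal, abs_le]
  constructor <;> linarith

/-! ## §3. The clock keeps running after `τ` -/

/-- **`b ≳ ε` after the trigger level**: `b ≥ (9/10)ε` on `[τ, T']` (`b(τ) ≥ (49/50)ε`,
`ḃ ≥ -ε⁻¹Mc² - δ ≥ -ε/16 - δ` by the a-priori bound and `Mε²e^{5M} ≤ 1/64`, `t - τ ≤ 1`).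
[cite: Tao2016AveragedNS, §5.5 "b(t) ≳ ε for t ∈ [t_c, 2]"] -/
theorem b_ge_after_w (hB : WideBudget M ε δ δ₀) {t : ℝ} (ht : t ∈ Icc τ T') : 9 / 10 * ε ≤ Y t 1 := by
  obtain ⟨hM6000, hε1, -, -, -, -, -, -, -⟩ := ignition_params hK hML hMK hε hεle
  obtain ⟨hδ₀, hδ, -, -, -, hs1⟩ := budget_facts_w hV hT hK hML hMK hε hεle h0 hB
  obtain ⟨hℓ0, hℓε, -, -, -⟩ := level_facts hK hML hMK hε hεle
  obtain ⟨hsε, h3s, hδs, -⟩ := late_facts_w hV hT hK hML hMK hε hεle h0 hB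
  obtain ⟨hx64, -, -, -⟩ := transition_params hK hML hMK hε hεle
  have hM0 : 0 < M := by linarith
  have hτ0 : (0 : ℝ) ≤ τ := by linarith
  obtain ⟨ℓ, hℓ⟩ : ∃ ℓ : ℝ, ℓ = ε ^ 2 / K ^ 10 := ⟨_, rfl⟩
  rw [← hℓ] at hℓ0 hℓε h3s
  -- the clock drain `Mc² ≤ ε²/16` on `[τ, T']`
  have hC : ∀ u ∈ Icc τ T', M * Y u 2 ^ 2 ≤ ε ^ 2 / 16 := by
    intro u hu
    have h1 := abs_c_le_after_w hY hV hR hT hT'T hT'2 hK hML hMK hε hεle h0 hτ1 hcτ hB hu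
    rw [← hℓ] at h1
    have huτ : u - τ ≤ 1 := by linarith [hu.2]
    have h2a : 201 / 100 * M * (u - τ) ≤ 201 / 100 * M * 1 :=
      mul_le_mul_of_nonneg_left huτ (by positivity)
    have h2 : exp (201 / 100 * M * (u - τ)) ≤ exp (5 / 2 * M) := exp_le_exp.2 (by linarith)
    have h3 : |Y u 2| ≤ 2 * ℓ * exp (5 / 2 * M) :=
      h1.trans (mul_le_mul_of_nonneg_left h2 (by positivity))
    have h4 : Y u 2 ^ 2 ≤ (2 * ℓ * exp (5 / 2 * M)) ^ 2 := by
      rw [← sq_abs]; exact pow_le_pow_left₀ (abs_nonneg _) h3 2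
    have h5 : (2 * ℓ * exp (5 / 2 * M)) ^ 2 = 4 * ℓ ^ 2 * exp (5 * M) := by
      rw [mul_pow, mul_pow, sq (exp _), ← exp_add]; ring_nf
    have hℓ2 : ℓ ^ 2 ≤ (ε ^ 2) ^ 2 := pow_le_pow_left₀ hℓ0.le hℓε 2
    have h6 : M * Y u 2 ^ 2 ≤ M * (4 * (ε ^ 2) ^ 2 * exp (5 * M)) := by
      refine mul_le_mul_of_nonneg_left (h4.trans ?_) hM0.le
      rw [h5]
      exact mul_le_mul_of_nonneg_right (mul_le_mul_of_nonneg_left hℓ2 (by norm_num)) (exp_pos _).le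
    have h7 : M * (4 * (ε ^ 2) ^ 2 * exp (5 * M)) = 4 * ε ^ 2 * (M * ε ^ 2 * exp (5 * M)) := by
      ring
    have h8 : 4 * ε ^ 2 * (M * ε ^ 2 * exp (5 * M)) ≤ 4 * ε ^ 2 * (1 / 64) :=
      mul_le_mul_of_nonneg_left hx64 (by positivity)
    linarith
  obtain ⟨r, hr⟩ : ∃ r : ℝ, r = ε / 16 + δ := ⟨_, rfl⟩
  have hr0 : 0 ≤ r := by rw [hr]; positivity
  have hmono := Thm53.monotoneOn_sub_of_le_deriv (s := Icc τ T') (f := fun s => Y s 1)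
    (φ := fun _ => -r) (Φ := fun u => -r * u) (convex_Icc τ T')
    (fun u _ => hasDerivAt_coord (hY u) 1)
    (fun u _ => by simpa using (hasDerivAt_id u).const_mul (-r))
    (fun u hu => by
      have hu' : u ∈ Icc (0 : ℝ) T' := ⟨hτ0.trans hu.1, hu.2⟩
      have hθ := (abs_le.1 (abs_coord_defect_le (hV u (mem_Ico_of_mem_late hT'T hu')) 1)).1
      rw [field_one] at hθ
      have h1 : 0 ≤ ε * Y u 0 ^ 2 := by positivity
      have h2 : ε⁻¹ * M * Y u 2 ^ 2 ≤ ε / 16 := by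
        rw [show ε⁻¹ * M * Y u 2 ^ 2 = M * Y u 2 ^ 2 / ε by ring, div_le_iff₀ hε]
        have e : ε / 16 * ε = ε ^ 2 / 16 := by ring
        linarith [hC u hu]
      show -r ≤ V u 1
      rw [hr]; linarith)
  have h := hmono (left_mem_Icc.2 (ht.1.trans ht.2)) ht ht.1
  simp only at h
  have htτ : t - τ ≤ 1 := by linarith [ht.2]
  have h2 : r * (t - τ) ≤ r * 1 := mul_le_mul_of_nonneg_left htτ hr0
  have hδε : δ ≤ ε / 100 := by
    have : ε ^ 2 * exp (-M) / 16 ≤ ε / 1000000 / 16 := by linarith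
    linarith
  linarith

/-! ## §4. Exponential growth of the trigger and (c-large) -/

/-- **Growth after the trigger level.** On `[τ, T']`: `c(t) ≥ ½(ε²/K¹⁰)·e^{(9/10)M(t-τ)}`
(the clock integral grows at rate `ε⁻¹Mb ≥ (9/10)M`, the discounted trigger loses at most
`δ(t-τ)e^{-G(τ)} ≤ ½ℓe^{-G(τ)}`). [cite: Tao2016AveragedNS, §5.5 (c-large)] -/
theorem c_ge_after_w (hB : WideBudget M ε δ δ₀) {t : ℝ} (ht : t ∈ Icc τ T') :
    ε ^ 2 / K ^ 10 / 2 * exp (9 / 10 * M * (t - τ)) ≤ Y t 2 := by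
  obtain ⟨hM6000, hε1, -, -, -, -, -, -, -⟩ := ignition_params hK hML hMK hε hεle
  obtain ⟨hδ₀, hδ, -, -, -, hs1⟩ := budget_facts_w hV hT hK hML hMK hε hεle h0 hB
  obtain ⟨hℓ0, hℓε, -, -, -⟩ := level_facts hK hML hMK hε hεle
  obtain ⟨hsε, h3s, hδs, -⟩ := late_facts_w hV hT hK hML hMK hε hεle h0 hB
  have hM0 : 0 < M := by linarith
  have hτ0 : (0 : ℝ) ≤ τ := by linarith
  have hτt : τ ≤ t := ht.1
  have hbge : ∀ u ∈ Icc τ T', 9 / 10 * ε ≤ Y u 1 := fun u hu =>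
    b_ge_after_w hY hV hR hT hT'T hT'2 hK hML hMK hε hεle h0 hτ1 hcτ hbτ hB hu
  obtain ⟨ℓ, hℓ⟩ : ∃ ℓ : ℝ, ℓ = ε ^ 2 / K ^ 10 := ⟨_, rfl⟩
  rw [← hℓ] at hℓ0 hℓε h3s hcτ ⊢
  -- the clock integral grows at rate ≥ (9/10)M on [τ, T']
  obtain ⟨n, hn⟩ : ∃ n : ℝ, n = 9 / 10 * M := ⟨_, rfl⟩
  have hn0 : 0 ≤ n := by rw [hn]; positivity
  have hGmono := Thm53.monotoneOn_sub_of_le_deriv (s := Icc τ T') (f := clockInt ε M Y)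
    (φ := fun _ => n) (Φ := fun u => n * u) (convex_Icc τ T')
    (fun u _ => hasDerivAt_clockIntA hY u)
    (fun u _ => by simpa using (hasDerivAt_id u).const_mul n)
    (fun u hu => by
      have h1 : ε⁻¹ * M * (9 / 10 * ε) ≤ ε⁻¹ * M * Y u 1 :=
        mul_le_mul_of_nonneg_left (hbge u hu) (by positivity)
      have e : ε⁻¹ * M * (9 / 10 * ε) = n := by
        rw [show ε⁻¹ * M * (9 / 10 * ε) = 9 / 10 * M * (ε⁻¹ * ε) by ring,
          inv_mul_cancel₀ hε.ne', mul_one, hn]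
      show n ≤ ε⁻¹ * M * Y u 1
      linarith)
  have hGτ : ∀ u ∈ Icc τ t, clockInt ε M Y τ ≤ clockInt ε M Y u := by
    intro u hu
    have h := hGmono (left_mem_Icc.2 (ht.1.trans ht.2)) ⟨hu.1, hu.2.trans ht.2⟩ hu.1
    simp only at h
    have : n * τ ≤ n * u := mul_le_mul_of_nonneg_left hu.1 hn0
    linarith
  have hGt : n * (t - τ) ≤ clockInt ε M Y t - clockInt ε M Y τ := by
    have h := hGmono (left_mem_Icc.2 (ht.1.trans ht.2)) ht ht.1
    simp only at h
    linarith
  -- the discounted trigger loses at most `p = δe^{-G(τ)}` per unit time on [τ, t]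
  obtain ⟨p, hp⟩ : ∃ p : ℝ, p = δ * exp (-clockInt ε M Y τ) := ⟨_, rfl⟩
  have hp0 : 0 ≤ p := by rw [hp]; positivity
  have hmono := Thm53.monotoneOn_sub_of_le_deriv (s := Icc τ t)
    (f := fun s => Y s 2 * exp (-clockInt ε M Y s)) (φ := fun _ => -p) (Φ := fun u => -p * u)
    (convex_Icc τ t) (fun u _ => hasDerivAt_discA hY u)
    (fun u _ => by simpa using (hasDerivAt_id u).const_mul (-p))
    (fun u hu => by
      have hu' : u ∈ Icc (0 : ℝ) T' := ⟨hτ0.trans hu.1, hu.2.trans ht.2⟩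
      have h1 := disc_deriv_ge_late hV hT'T hu' (K := K)
      have h2 : 0 ≤ ε ^ 2 * exp (-M) * Y u 0 ^ 2 * exp (-clockInt ε M Y u) := by positivity
      have h3 : exp (-clockInt ε M Y u) ≤ exp (-clockInt ε M Y τ) :=
        exp_le_exp.2 (by linarith [hGτ u hu])
      have h4 : δ * exp (-clockInt ε M Y u) ≤ p := by
        rw [hp]; exact mul_le_mul_of_nonneg_left h3 hδ
      show -p ≤ (V u 2 - ε⁻¹ * M * Y u 1 * Y u 2) * exp (-clockInt ε M Y u)
      linarith [h1, h2, h4])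
  have h := hmono (left_mem_Icc.2 hτt) (right_mem_Icc.2 hτt) hτt
  simp only at h
  rw [hcτ] at h
  have htτ : t - τ ≤ 1 := by linarith [ht.2]
  have hpt : p * (t - τ) ≤ p * 1 := mul_le_mul_of_nonneg_left htτ hp0
  have hδℓ : δ ≤ ℓ / 2 := by linarith
  have h5 : δ * exp (-clockInt ε M Y τ) ≤ ℓ / 2 * exp (-clockInt ε M Y τ) :=
    mul_le_mul_of_nonneg_right hδℓ (exp_pos _).le
  rw [← hp] at h5
  have key : ℓ / 2 * exp (-clockInt ε M Y τ) ≤ Y t 2 * exp (-clockInt ε M Y t) := by linarith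
  -- undo the discount
  have hP : 0 < exp (clockInt ε M Y t) := exp_pos _
  have h6 := mul_le_mul_of_nonneg_right key hP.le
  have e1 : Y t 2 * exp (-clockInt ε M Y t) * exp (clockInt ε M Y t) = Y t 2 := by
    rw [mul_assoc, ← exp_add, neg_add_cancel, exp_zero, mul_one]
  have e2 : ℓ / 2 * exp (-clockInt ε M Y τ) * exp (clockInt ε M Y t) =
      ℓ / 2 * exp (clockInt ε M Y t - clockInt ε M Y τ) := by
    rw [mul_assoc, ← exp_add,
      show -clockInt ε M Y τ + clockInt ε M Y t = clockInt ε M Y t - clockInt ε M Y τ by ring]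
  rw [e1, e2] at h6
  have h7 : exp (9 / 10 * M * (t - τ)) ≤ exp (clockInt ε M Y t - clockInt ε M Y τ) := by
    rw [← hn]; exact exp_le_exp.2 hGt
  calc ℓ / 2 * exp (9 / 10 * M * (t - τ))
      ≤ ℓ / 2 * exp (clockInt ε M Y t - clockInt ε M Y τ) :=
        mul_le_mul_of_nonneg_left h7 (by positivity)
    _ ≤ Y t 2 := h6

/-- **(c-large) for approximate trajectories.** For any onset delay `d ≥ 0` with
`e^{(9/10)Md} ≥ 2K¹¹⁰`: `c ≥ K¹⁰⁰ε²` on `[τ + d, T']` — "the rotor gate will be continuously and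
strongly activated from time `t_c + d` onwards". [cite: Tao2016AveragedNS, §5.5 (c-large)] -/
theorem c_large_after_w (hB : WideBudget M ε δ δ₀) {d : ℝ} (hd : 0 ≤ d) (hon : 2 * K ^ 110 ≤ exp (9 / 10 * M * d)) {t : ℝ}
    (ht : t ∈ Icc (τ + d) T') : K ^ 100 * ε ^ 2 ≤ Y t 2 := by
  obtain ⟨hM6000, -, -, -, -, -, -, -, -⟩ := ignition_params hK hML hMK hε hεle
  obtain ⟨hK16, -, -, -, -, -⟩ := negKick_params hK hML hMK hε hεle
  have hK0 : 0 < K := by linarith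
  have hM0 : 0 < M := by linarith
  have ht' : t ∈ Icc τ T' := ⟨by linarith [ht.1], ht.2⟩
  have hg := c_ge_after_w hY hV hR hT hT'T hT'2 hK hML hMK hε hεle h0 hτ1 hcτ hbτ hB ht'
  have hexp : exp (9 / 10 * M * d) ≤ exp (9 / 10 * M * (t - τ)) :=
    exp_le_exp.2 (mul_le_mul_of_nonneg_left (by linarith [ht.1]) (by positivity))
  have e : K ^ 100 * ε ^ 2 = ε ^ 2 / K ^ 10 / 2 * (2 * K ^ 110) := by
    rw [div_div, div_mul_eq_mul_div, eq_div_iff (by positivity)]; ring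
  calc K ^ 100 * ε ^ 2 = ε ^ 2 / K ^ 10 / 2 * (2 * K ^ 110) := e
    _ ≤ ε ^ 2 / K ^ 10 / 2 * exp (9 / 10 * M * d) := mul_le_mul_of_nonneg_left hon (by positivity)
    _ ≤ ε ^ 2 / K ^ 10 / 2 * exp (9 / 10 * M * (t - τ)) :=
        mul_le_mul_of_nonneg_left hexp (by positivity)
    _ ≤ Y t 2 := hg

end Entry


/-- **(bc-small) for approximate trajectories**: `b² + c² ≤ 9ε` on `[0, T']`. The clock–trigger
exchange `∓ε⁻¹Mbc²` cancels in `d/dt(b² + c²) = 2εa²b + 2ε²e^{-M}a²c + 2bθ₁ + 2cθ₂ ≤ (4 + o(1))ε`.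
[cite: Tao2016AveragedNS, §5.5 (5.11)] -/
theorem bc_sq_late_w (hB : WideBudget M ε δ δ₀) {t : ℝ} (ht : t ∈ Icc (0 : ℝ) T') : Y t 1 ^ 2 + Y t 2 ^ 2 ≤ 9 * ε := by
  obtain ⟨hM6000, hε1, -, -, -, -, -, -, -⟩ := ignition_params hK hML hMK hε hεle
  obtain ⟨hδ₀, hδ, hη8, hδ₀1, -, hs1⟩ := budget_facts_w hV hT hK hML hMK hε hεle h0 hB
  obtain ⟨hsε, -, hδs, hA⟩ := late_facts_w hV hT hK hML hMK hε hεle h0 hB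
  have hA0 : 0 ≤ 7 * δ₀ + 40 * δ := by positivity
  obtain ⟨k, hk⟩ : ∃ k : ℝ, k = 4 * ε * (1 + 7 * δ₀ + 40 * δ) +
      4 * (ε ^ 2 * exp (-M)) * (1 + 7 * δ₀ + 40 * δ) + 8 * δ := ⟨_, rfl⟩
  have hk0 : 0 ≤ k := by rw [hk]; positivity
  have hanti := Thm53.antitoneOn_sub_of_deriv_le (s := Icc (0 : ℝ) T')
    (f := fun s => Y s 1 * Y s 1 + Y s 2 * Y s 2) (φ := fun _ => k) (Φ := fun u => k * u)
    (convex_Icc 0 T')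
    (fun u _ => ((hasDerivAt_coord (hY u) 1).fun_mul (hasDerivAt_coord (hY u) 1)).add
      ((hasDerivAt_coord (hY u) 2).fun_mul (hasDerivAt_coord (hY u) 2)))
    (fun u _ => by simpa using (hasDerivAt_id u).const_mul k)
    (fun u hu => by
      have hW := hV u (mem_Ico_of_mem_late hT'T hu)
      have hθ1 := abs_coord_defect_le hW 1
      have hθ2 := abs_coord_defect_le hW 2
      rw [field_one] at hθ1
      rw [field_two] at hθ2
      have hb2 := abs_coord_le_two hR hT'T hu 1
      have hc2 := abs_coord_le_two hR hT'T hu 2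
      have hA' := sq_coord_late hY hV hR hT hT'T hT'2 h0 hδ₀1 hu 0
      have p1 : |Y u 1 * (V u 1 - (ε * Y u 0 ^ 2 - ε⁻¹ * M * Y u 2 ^ 2))| ≤ 2 * δ := by
        rw [abs_mul]; exact mul_le_mul hb2 hθ1 (abs_nonneg _) (by norm_num)
      have p2 : |Y u 2 * (V u 2 - (ε ^ 2 * exp (-M) * Y u 0 ^ 2 + ε⁻¹ * M * Y u 1 * Y u 2))| ≤
          2 * δ := by
        rw [abs_mul]; exact mul_le_mul hc2 hθ2 (abs_nonneg _) (by norm_num)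
      have p3 : |ε * Y u 0 ^ 2 * Y u 1| ≤ ε * (1 + 7 * δ₀ + 40 * δ) * 2 := by
        rw [abs_mul, abs_of_nonneg (by positivity : 0 ≤ ε * Y u 0 ^ 2)]
        exact mul_le_mul (mul_le_mul_of_nonneg_left hA' hε.le) hb2 (abs_nonneg _) (by positivity)
      have p4 : |ε ^ 2 * exp (-M) * Y u 0 ^ 2 * Y u 2| ≤
          ε ^ 2 * exp (-M) * (1 + 7 * δ₀ + 40 * δ) * 2 := by
        rw [abs_mul, abs_of_nonneg (by positivity : 0 ≤ ε ^ 2 * exp (-M) * Y u 0 ^ 2)]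
        exact mul_le_mul (mul_le_mul_of_nonneg_left hA' (by positivity)) hc2 (abs_nonneg _)
          (by positivity)
      have e : V u 1 * Y u 1 + Y u 1 * V u 1 + (V u 2 * Y u 2 + Y u 2 * V u 2) =
          2 * (ε * Y u 0 ^ 2 * Y u 1) + 2 * (ε ^ 2 * exp (-M) * Y u 0 ^ 2 * Y u 2) +
          2 * (Y u 1 * (V u 1 - (ε * Y u 0 ^ 2 - ε⁻¹ * M * Y u 2 ^ 2))) +
          2 * (Y u 2 * (V u 2 - (ε ^ 2 * exp (-M) * Y u 0 ^ 2 + ε⁻¹ * M * Y u 1 * Y u 2))) := by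
        ring
      show V u 1 * Y u 1 + Y u 1 * V u 1 + (V u 2 * Y u 2 + Y u 2 * V u 2) ≤ k
      rw [e, hk]
      linarith [(abs_le.1 p1).2, (abs_le.1 p2).2, (abs_le.1 p3).2, (abs_le.1 p4).2])
  have h := hanti (left_mem_Icc.2 (ht.1.trans ht.2)) ht ht.1
  simp only [mul_zero, sub_zero] at h
  obtain ⟨hb0, hc0, -, -⟩ := abs_init_coord_le h0
  have q1 : Y 0 1 * Y 0 1 ≤ δ₀ * δ₀ := by
    rw [← abs_mul_abs_self]; exact mul_le_mul hb0 hb0 (abs_nonneg _) hδ₀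
  have q2 : Y 0 2 * Y 0 2 ≤ δ₀ * δ₀ := by
    rw [← abs_mul_abs_self]; exact mul_le_mul hc0 hc0 (abs_nonneg _) hδ₀
  have q3 : δ₀ * δ₀ ≤ 1 * δ₀ := mul_le_mul_of_nonneg_right hδ₀1 hδ₀
  have hkt : k * t ≤ k * 2 := mul_le_mul_of_nonneg_left (ht.2.trans hT'2) hk0
  have m1 : ε * (7 * δ₀ + 40 * δ) ≤ 1 * (7 * δ₀ + 40 * δ) := mul_le_mul_of_nonneg_right hε1 hA0
  have m2 : ε ^ 2 * exp (-M) * (7 * δ₀ + 40 * δ) ≤ 1 * (7 * δ₀ + 40 * δ) :=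
    mul_le_mul_of_nonneg_right (by linarith) hA0
  have hk9 : k ≤ 4 * ε + ε / 2 := by rw [hk]; linarith
  rw [sq, sq]
  linarith

section Entry

variable {τ : ℝ} (hτ1 : 1 < τ) (hcτ : Y τ 2 = ε ^ 2 / K ^ 10) (hbτ : 49 / 50 * ε ≤ Y τ 1)
include hτ1 hcτ hbτ

section Onset

variable {d : ℝ} (hd : 0 ≤ d) (hon : 2 * K ^ 110 ≤ exp (9 / 10 * M * d))
include hd hon

/-! ## §2. (cgrow-2) and the equipartition corrector on `[τ + d, T']` -/

/-- **(cgrow-2) for approximate trajectories**: on `[τ + d, T']` the design drive of the trigger,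
`ε²e^{-M}a² + ε⁻¹Mbc`, lies in `[0, 4K¹⁰c]` (`b ∈ [(9/10)ε, (201/100)ε]`, `c ≥ K¹⁰⁰ε²`, `M ≤ K¹⁰`).
[cite: Tao2016AveragedNS, §5.5 (cgrow-2)] -/
theorem c_drive_bounds_after_w (hB : WideBudget M ε δ δ₀) {t : ℝ} (ht : t ∈ Icc (τ + d) T') :
    0 ≤ ε ^ 2 * exp (-M) * Y t 0 ^ 2 + ε⁻¹ * M * Y t 1 * Y t 2 ∧
      ε ^ 2 * exp (-M) * Y t 0 ^ 2 + ε⁻¹ * M * Y t 1 * Y t 2 ≤ 4 * K ^ 10 * Y t 2 := by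
  obtain ⟨hM6000, hε1, -, hexpM, -, -, -, -, -⟩ := ignition_params hK hML hMK hε hεle
  obtain ⟨hK16, -, -, -, -, -⟩ := negKick_params hK hML hMK hε hεle
  have hK0 : 0 < K := by linarith
  have hM0 : 0 < M := by linarith
  have hτ0 : (0 : ℝ) ≤ τ := by linarith
  have ht' : t ∈ Icc τ T' := ⟨by linarith [ht.1], ht.2⟩
  have ht0 : t ∈ Icc (0 : ℝ) T' := ⟨hτ0.trans ht'.1, ht.2⟩
  have hcl := c_large_after_w hY hV hR hT hT'T hT'2 hK hML hMK hε hεle h0 hτ1 hcτ hbτ hB hd hon ht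
  have hcpos : 0 < Y t 2 := lt_of_lt_of_le (by positivity) hcl
  have hb9 := b_ge_after_w hY hV hR hT hT'T hT'2 hK hML hMK hε hεle h0 hτ1 hcτ hbτ hB ht'
  have hb2 := b_le_two_late_w hY hV hR hT hT'T hT'2 hK hML hMK hε hεle h0 hB ht0
  have hb0 : 0 ≤ Y t 1 := by linarith [hε.le]
  have ha2 : |Y t 0| ≤ 2 := abs_coord_le_two hR hT'T ht0 0
  refine ⟨by positivity, ?_⟩
  have ha4 : Y t 0 ^ 2 ≤ 2 ^ 2 := by
    rw [← sq_abs]; exact pow_le_pow_left₀ (abs_nonneg _) ha2 2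
  have h1 : ε ^ 2 * exp (-M) * Y t 0 ^ 2 ≤ ε ^ 2 * 1 * 2 ^ 2 :=
    mul_le_mul (mul_le_mul_of_nonneg_left (by linarith) (by positivity)) ha4 (by positivity)
      (by positivity)
  have h4 : (4 : ℝ) ≤ K ^ 100 := by
    have := pow_le_pow_left₀ (by norm_num : (0 : ℝ) ≤ 16) hK16 100
    linarith [show (4 : ℝ) ≤ 16 ^ 100 by norm_num]
  have h2 : 4 * ε ^ 2 ≤ K ^ 100 * ε ^ 2 := mul_le_mul_of_nonneg_right h4 (sq_nonneg ε)
  have hK10 : (1 : ℝ) ≤ K ^ 10 := one_le_pow₀ (by linarith)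
  have h3 : 1 * Y t 2 ≤ K ^ 10 * Y t 2 := mul_le_mul_of_nonneg_right hK10 hcpos.le
  have h5 : ε⁻¹ * M * Y t 1 * Y t 2 ≤ ε⁻¹ * M * (201 / 100 * ε) * Y t 2 :=
    mul_le_mul_of_nonneg_right (mul_le_mul_of_nonneg_left hb2 (by positivity)) hcpos.le
  rw [show ε⁻¹ * M * (201 / 100 * ε) * Y t 2 = 201 / 100 * (M * Y t 2) * (ε⁻¹ * ε) by ring,
    inv_mul_cancel₀ hε.ne', mul_one] at h5
  have h6 : M * Y t 2 ≤ K ^ 10 * Y t 2 := mul_le_mul_of_nonneg_right hMK hcpos.le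
  linarith

/-- **The remainder of the corrector's derivative**: on `[τ + d, T']`,
`|∂ₜV - (a² - d²)| ≤ 40K⁻⁹⁰` for `V = adε²/c` — the rotor terms of the design field give exactly
`ε⁻²c(a² - d²)·ε²/c = a² - d²`; what is left is `-(εabd + ε²e^{-M}acd + Kadã)ε²/c`, the defect
terms `(θ₀d + aθ₃)ε²/c`, and `-ad(ε²/c)(ċ/c)` with `|ċ| ≤ 4K¹⁰c + δ`; all modes `≤ 2`,
`ε²/c ≤ K⁻¹⁰⁰`, `δ/c ≤ 1`. [cite: Tao2016AveragedNS, §5.5 (douse)] -/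
theorem corrector_remainder_le_w (hB : WideBudget M ε δ δ₀) {t : ℝ} (ht : t ∈ Icc (τ + d) T') :
    |((V t 0 * Y t 3 + Y t 0 * V t 3) * (ε ^ 2 * (Y t 2)⁻¹)
        - Y t 0 * Y t 3 * (ε ^ 2 * (Y t 2)⁻¹) * (V t 2 * (Y t 2)⁻¹))
      - (Y t 0 ^ 2 - Y t 3 ^ 2)| ≤ 40 / K ^ 90 := by
  obtain ⟨hM6000, hε1, -, hexpM, -, -, -, -, -⟩ := ignition_params hK hML hMK hε hεle
  obtain ⟨hK16, -, -, -, -, -⟩ := negKick_params hK hML hMK hε hεle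
  obtain ⟨hδ₀, hδ, -, -, -, hs1⟩ := budget_facts_w hV hT hK hML hMK hε hεle h0 hB
  obtain ⟨-, -, hδs, -⟩ := late_facts_w hV hT hK hML hMK hε hεle h0 hB
  have hK0 : 0 < K := by linarith
  have hK1 : (1 : ℝ) ≤ K := by linarith
  have hM0 : 0 < M := by linarith
  have hτ0 : (0 : ℝ) ≤ τ := by linarith
  have ht0 : t ∈ Icc (0 : ℝ) T' := ⟨by linarith [ht.1], ht.2⟩
  have hcl := c_large_after_w hY hV hR hT hT'T hT'2 hK hML hMK hε hεle h0 hτ1 hcτ hbτ hB hd hon ht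
  have hcpos : 0 < Y t 2 := lt_of_lt_of_le (by positivity) hcl
  obtain ⟨hF0, hF4⟩ := c_drive_bounds_after_w hY hV hR hT hT'T hT'2 hK hML hMK hε hεle h0 hτ1 hcτ hbτ hd hon hB ht
  -- sizes of the modes and of the defects
  have ha := abs_coord_le_two hR hT'T ht0 0
  have hb := abs_coord_le_two hR hT'T ht0 1
  have hc := abs_coord_le_two hR hT'T ht0 2
  have hd' := abs_coord_le_two hR hT'T ht0 3
  have he := abs_coord_le_two hR hT'T ht0 4
  have hW := hV t (mem_Ico_of_mem_late hT'T ht0)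
  have hθ0 := abs_coord_defect_le hW 0
  have hθ2 := abs_coord_defect_le hW 2
  have hθ3 := abs_coord_defect_le hW 3
  rw [field_zero] at hθ0
  rw [field_two] at hθ2
  rw [field_three] at hθ3
  -- the small parameter q = ε²/c and the log-derivative w = ċ/c
  obtain ⟨q, hq⟩ : ∃ q : ℝ, q = ε ^ 2 * (Y t 2)⁻¹ := ⟨_, rfl⟩
  have hq0 : 0 ≤ q := by rw [hq]; positivity
  have hq1 : q ≤ 1 / K ^ 100 := by
    rw [hq, ← div_eq_mul_inv, div_le_div_iff₀ hcpos (by positivity), one_mul]; linarith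
  obtain ⟨w, hw⟩ : ∃ w : ℝ, w = V t 2 * (Y t 2)⁻¹ := ⟨_, rfl⟩
  have hδc : δ * (Y t 2)⁻¹ ≤ 1 := by
    rw [← div_eq_mul_inv, div_le_one hcpos]
    have h1 : ε ^ 2 * exp (-M) ≤ ε ^ 2 * 1 := mul_le_mul_of_nonneg_left (by linarith) (sq_nonneg ε)
    have h2 : 1 * ε ^ 2 ≤ K ^ 100 * ε ^ 2 :=
      mul_le_mul_of_nonneg_right (one_le_pow₀ hK1) (sq_nonneg ε)
    linarith
  have hwabs : |w| ≤ 4 * K ^ 10 + 1 := by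
    have hV2 : |V t 2| ≤ 4 * K ^ 10 * Y t 2 + δ := by
      have h1 := abs_le.1 hθ2
      rw [abs_le]; constructor <;> linarith
    rw [hw, abs_mul, abs_of_pos (inv_pos.2 hcpos)]
    calc |V t 2| * (Y t 2)⁻¹ ≤ (4 * K ^ 10 * Y t 2 + δ) * (Y t 2)⁻¹ :=
          mul_le_mul_of_nonneg_right hV2 (inv_pos.2 hcpos).le
      _ = 4 * K ^ 10 * (Y t 2 * (Y t 2)⁻¹) + δ * (Y t 2)⁻¹ := by ring
      _ = 4 * K ^ 10 + δ * (Y t 2)⁻¹ := by rw [mul_inv_cancel₀ hcpos.ne', mul_one]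
      _ ≤ 4 * K ^ 10 + 1 := by linarith
  -- the identity
  have hcc : (ε ^ 2)⁻¹ * Y t 2 * (ε ^ 2 * (Y t 2)⁻¹) = 1 := by
    rw [show (ε ^ 2)⁻¹ * Y t 2 * (ε ^ 2 * (Y t 2)⁻¹) =
        (ε ^ 2)⁻¹ * ε ^ 2 * (Y t 2 * (Y t 2)⁻¹) by ring,
      inv_mul_cancel₀ (pow_ne_zero 2 hε.ne'), mul_inv_cancel₀ hcpos.ne', one_mul]
  have hid : ((V t 0 * Y t 3 + Y t 0 * V t 3) * (ε ^ 2 * (Y t 2)⁻¹)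
        - Y t 0 * Y t 3 * (ε ^ 2 * (Y t 2)⁻¹) * (V t 2 * (Y t 2)⁻¹)) - (Y t 0 ^ 2 - Y t 3 ^ 2) =
      (-(ε * Y t 0 * Y t 1 * Y t 3) - ε ^ 2 * exp (-M) * Y t 0 * Y t 2 * Y t 3
          - K * Y t 0 * Y t 3 * Y t 4) * q +
        ((V t 0 - (-((ε ^ 2)⁻¹ * Y t 2 * Y t 3) - ε * Y t 0 * Y t 1
            - ε ^ 2 * exp (-M) * Y t 0 * Y t 2)) * Y t 3 +
          Y t 0 * (V t 3 - ((ε ^ 2)⁻¹ * Y t 2 * Y t 0 - K * Y t 3 * Y t 4))) * q -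
        Y t 0 * Y t 3 * q * w := by
    rw [hq, hw]
    linear_combination (Y t 0 ^ 2 - Y t 3 ^ 2) * hcc
  rw [hid]
  -- term sizes
  have abs3 : ∀ x y z : ℝ, |x| ≤ 2 → |y| ≤ 2 → |z| ≤ 2 → |x * y * z| ≤ 8 := by
    intro x y z hx hy hz
    rw [abs_mul, abs_mul]
    calc |x| * |y| * |z| ≤ 2 * 2 * 2 :=
          mul_le_mul (mul_le_mul hx hy (abs_nonneg _) (by norm_num)) hz (abs_nonneg _)
            (by norm_num)
      _ = 8 := by norm_num
  have hT1 : |(-(ε * Y t 0 * Y t 1 * Y t 3) - ε ^ 2 * exp (-M) * Y t 0 * Y t 2 * Y t 3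
      - K * Y t 0 * Y t 3 * Y t 4) * q| ≤ (8 * ε + 8 * (ε ^ 2 * exp (-M)) + 8 * K) * q := by
    rw [abs_mul, abs_of_nonneg hq0]
    refine mul_le_mul_of_nonneg_right ?_ hq0
    have e1 : |ε * Y t 0 * Y t 1 * Y t 3| ≤ 8 * ε := by
      rw [show ε * Y t 0 * Y t 1 * Y t 3 = ε * (Y t 0 * Y t 1 * Y t 3) by ring, abs_mul,
        abs_of_pos hε]
      have := abs3 _ _ _ ha hb hd'
      calc ε * |Y t 0 * Y t 1 * Y t 3| ≤ ε * 8 := mul_le_mul_of_nonneg_left this hε.le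
        _ = 8 * ε := by ring
    have e2 : |ε ^ 2 * exp (-M) * Y t 0 * Y t 2 * Y t 3| ≤ 8 * (ε ^ 2 * exp (-M)) := by
      rw [show ε ^ 2 * exp (-M) * Y t 0 * Y t 2 * Y t 3 =
          ε ^ 2 * exp (-M) * (Y t 0 * Y t 2 * Y t 3) by ring, abs_mul,
        abs_of_pos (by positivity : 0 < ε ^ 2 * exp (-M))]
      have := abs3 _ _ _ ha hc hd'
      have hs0 : 0 ≤ ε ^ 2 * exp (-M) := by positivity
      calc ε ^ 2 * exp (-M) * |Y t 0 * Y t 2 * Y t 3| ≤ ε ^ 2 * exp (-M) * 8 :=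
            mul_le_mul_of_nonneg_left this hs0
        _ = 8 * (ε ^ 2 * exp (-M)) := by ring
    have e3 : |K * Y t 0 * Y t 3 * Y t 4| ≤ 8 * K := by
      rw [show K * Y t 0 * Y t 3 * Y t 4 = K * (Y t 0 * Y t 3 * Y t 4) by ring, abs_mul,
        abs_of_pos hK0]
      have := abs3 _ _ _ ha hd' he
      calc K * |Y t 0 * Y t 3 * Y t 4| ≤ K * 8 := mul_le_mul_of_nonneg_left this hK0.le
        _ = 8 * K := by ring
    have t12 := abs_sub (-(ε * Y t 0 * Y t 1 * Y t 3))
      (ε ^ 2 * exp (-M) * Y t 0 * Y t 2 * Y t 3)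
    have t123 := abs_sub (-(ε * Y t 0 * Y t 1 * Y t 3) - ε ^ 2 * exp (-M) * Y t 0 * Y t 2 * Y t 3)
      (K * Y t 0 * Y t 3 * Y t 4)
    rw [abs_neg] at t12
    linarith
  have hT2 : |((V t 0 - (-((ε ^ 2)⁻¹ * Y t 2 * Y t 3) - ε * Y t 0 * Y t 1
            - ε ^ 2 * exp (-M) * Y t 0 * Y t 2)) * Y t 3 +
          Y t 0 * (V t 3 - ((ε ^ 2)⁻¹ * Y t 2 * Y t 0 - K * Y t 3 * Y t 4))) * q| ≤
      4 * δ * q := by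
    rw [abs_mul, abs_of_nonneg hq0]
    refine mul_le_mul_of_nonneg_right ?_ hq0
    have e1 : |(V t 0 - (-((ε ^ 2)⁻¹ * Y t 2 * Y t 3) - ε * Y t 0 * Y t 1
        - ε ^ 2 * exp (-M) * Y t 0 * Y t 2)) * Y t 3| ≤ δ * 2 := by
      rw [abs_mul]; exact mul_le_mul hθ0 hd' (abs_nonneg _) hδ
    have e2 : |Y t 0 * (V t 3 - ((ε ^ 2)⁻¹ * Y t 2 * Y t 0 - K * Y t 3 * Y t 4))| ≤ 2 * δ := by
      rw [abs_mul]; exact mul_le_mul ha hθ3 (abs_nonneg _) (by norm_num)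
    have := abs_add_le ((V t 0 - (-((ε ^ 2)⁻¹ * Y t 2 * Y t 3) - ε * Y t 0 * Y t 1
        - ε ^ 2 * exp (-M) * Y t 0 * Y t 2)) * Y t 3)
      (Y t 0 * (V t 3 - ((ε ^ 2)⁻¹ * Y t 2 * Y t 0 - K * Y t 3 * Y t 4)))
    linarith
  have hT3 : |Y t 0 * Y t 3 * q * w| ≤ 4 * q * (4 * K ^ 10 + 1) := by
    rw [abs_mul, abs_mul, abs_mul, abs_of_nonneg hq0]
    calc |Y t 0| * |Y t 3| * q * |w| ≤ 2 * 2 * q * (4 * K ^ 10 + 1) :=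
          mul_le_mul (mul_le_mul_of_nonneg_right (mul_le_mul ha hd' (abs_nonneg _) (by norm_num))
            hq0) hwabs (abs_nonneg _) (by positivity)
      _ = 4 * q * (4 * K ^ 10 + 1) := by ring
  -- numerics: everything is ≤ 40K¹⁰/K¹⁰⁰
  obtain ⟨v, hv⟩ : ∃ v : ℝ, v = 1 / K ^ 100 := ⟨_, rfl⟩
  rw [← hv] at hq1
  have hv0 : 0 ≤ v := by rw [hv]; positivity
  have hKK : K ≤ K ^ 10 := le_self_pow₀ hK1 (by norm_num)
  have hK10 : (24 : ℝ) ≤ K ^ 10 :=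
    le_trans (by norm_num) (pow_le_pow_left₀ (by norm_num) hK16 10)
  have n1 : (8 * ε + 8 * (ε ^ 2 * exp (-M)) + 8 * K) * q ≤
      (8 * ε + 8 * (ε ^ 2 * exp (-M)) + 8 * K) * v :=
    mul_le_mul_of_nonneg_left hq1 (by positivity)
  have n2 : 4 * δ * q ≤ 4 * δ * v := mul_le_mul_of_nonneg_left hq1 (by positivity)
  have n3 : 4 * q * (4 * K ^ 10 + 1) ≤ 4 * v * (4 * K ^ 10 + 1) :=
    mul_le_mul_of_nonneg_right (mul_le_mul_of_nonneg_left hq1 (by norm_num)) (by positivity)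
  have m1 : ε * v ≤ 1 * v := mul_le_mul_of_nonneg_right hε1 hv0
  have m2 : ε ^ 2 * exp (-M) * v ≤ 1 * v := mul_le_mul_of_nonneg_right (by linarith) hv0
  have m3 : δ * v ≤ 1 * v := mul_le_mul_of_nonneg_right (by linarith) hv0
  have m4 : K * v ≤ K ^ 10 * v := mul_le_mul_of_nonneg_right hKK hv0
  have m5 : 24 * v ≤ K ^ 10 * v := mul_le_mul_of_nonneg_right hK10 hv0
  have hfin : 40 / K ^ 90 = 40 * (K ^ 10 * v) := by
    rw [hv, div_eq_iff (by positivity : K ^ 90 ≠ 0), one_div,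
      show 40 * (K ^ 10 * (K ^ 100)⁻¹) * K ^ 90 = 40 * ((K ^ 100)⁻¹ * K ^ 100) by ring,
      inv_mul_cancel₀ (by positivity : K ^ 100 ≠ 0), mul_one]
  have s12 := abs_add_le ((-(ε * Y t 0 * Y t 1 * Y t 3) - ε ^ 2 * exp (-M) * Y t 0 * Y t 2 * Y t 3
      - K * Y t 0 * Y t 3 * Y t 4) * q)
    (((V t 0 - (-((ε ^ 2)⁻¹ * Y t 2 * Y t 3) - ε * Y t 0 * Y t 1
            - ε ^ 2 * exp (-M) * Y t 0 * Y t 2)) * Y t 3 +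
          Y t 0 * (V t 3 - ((ε ^ 2)⁻¹ * Y t 2 * Y t 0 - K * Y t 3 * Y t 4))) * q)
  have s123 := abs_sub ((-(ε * Y t 0 * Y t 1 * Y t 3) - ε ^ 2 * exp (-M) * Y t 0 * Y t 2 * Y t 3
      - K * Y t 0 * Y t 3 * Y t 4) * q +
    ((V t 0 - (-((ε ^ 2)⁻¹ * Y t 2 * Y t 3) - ε * Y t 0 * Y t 1
            - ε ^ 2 * exp (-M) * Y t 0 * Y t 2)) * Y t 3 +
          Y t 0 * (V t 3 - ((ε ^ 2)⁻¹ * Y t 2 * Y t 0 - K * Y t 3 * Y t 4))) * q)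
    (Y t 0 * Y t 3 * q * w)
  rw [hfin]
  linarith

/-! ## §3. (atc): the pump ignites -/

/-- **(atc) for approximate trajectories**: `ã(τ + d + 1/K) ≥ 1/10` (whenever that time is
`≤ T'`). If not, on `J = [τ + d, τ + d + 1/K]` the output is `≤ 1/10 + δ` (almost-monotone) and
`≥ -(δ₀ + 2δ)`, so `a² + d² ≥ 0.98`; the function `Ψ = adε²/c + (2/K)ã` has
`∂ₜΨ = a² + d² + R + 2θ₄/K ≥ 0.97` and `|adε²/c| ≤ 4K⁻¹⁰⁰`, whence
`0.97/K ≤ 8K⁻¹⁰⁰ + (2/K)(1/10 + δ₀ + 2δ)`, absurd. [cite: Tao2016AveragedNS, §5.5 (atc)] -/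
theorem e_tenth_after_w (hB : WideBudget M ε δ δ₀) (hfit : τ + d + K⁻¹ ≤ T') : 1 / 10 ≤ Y (τ + d + K⁻¹) 4 := by
  obtain ⟨hM6000, hε1, hε2, hexpM, hMε, -, -, -, -⟩ := ignition_params hK hML hMK hε hεle
  have hεs : ε ≤ 1 / 1000 := by nlinarith [mul_nonneg hε.le (sub_nonneg.2 hM6000), hMε]
  obtain ⟨hδ₀, hδ, hη8, hδ₀1, -, hs1⟩ := budget_facts_w hV hT hK hML hMK hε hεle h0 hB
  obtain ⟨hsε, -, hδs, hA⟩ := late_facts_w hV hT hK hML hMK hε hεle h0 hB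
  obtain ⟨hK16, -, -, -, -, -⟩ := negKick_params hK hML hMK hε hεle
  have hK0 : 0 < K := by linarith
  have hK1 : (1 : ℝ) ≤ K := by linarith
  have hτ0 : (0 : ℝ) ≤ τ := by linarith
  obtain ⟨u, hu⟩ : ∃ u : ℝ, u = K⁻¹ := ⟨_, rfl⟩
  have hu0 : 0 < u := by rw [hu]; positivity
  have hu16 : u ≤ 1 / 16 := by
    rw [hu, inv_le_comm₀ hK0 (by norm_num)]; linarith
  obtain ⟨t₀, ht₀⟩ : ∃ t₀ : ℝ, t₀ = τ + d := ⟨_, rfl⟩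
  obtain ⟨t₁, ht₁⟩ : ∃ t₁ : ℝ, t₁ = τ + d + K⁻¹ := ⟨_, rfl⟩
  rw [← ht₁]
  have hlen : t₁ - t₀ = u := by rw [ht₀, ht₁, hu]; ring
  have h01 : t₀ ≤ t₁ := by linarith
  have ht1T : t₁ ≤ T' := by rw [ht₁]; exact hfit
  have ht00 : 0 ≤ t₀ := by rw [ht₀]; linarith
  have hJ : ∀ s ∈ Icc t₀ t₁, s ∈ Icc (τ + d) T' := fun s hs =>
    ⟨by rw [← ht₀]; exact hs.1, hs.2.trans ht1T⟩
  have hJ0 : ∀ s ∈ Icc t₀ t₁, s ∈ Icc (0 : ℝ) T' := fun s hs =>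
    ⟨ht00.trans hs.1, hs.2.trans ht1T⟩
  by_contra hlt'
  have hlt := not_le.1 hlt'
  -- the output on J
  have heJ : ∀ s ∈ Icc t₀ t₁, Y s 4 ≤ 1 / 10 + δ := by
    intro s hs
    have h := e_sub_ge_late hY hV hT'T hK0.le (ht00.trans hs.1) hs.2 ht1T
    have : δ * (t₁ - s) ≤ δ * 1 := mul_le_mul_of_nonneg_left (by linarith [hs.1]) hδ
    linarith
  -- the trigger and the corrector on J
  have hcJ : ∀ s ∈ Icc t₀ t₁, K ^ 100 * ε ^ 2 ≤ Y s 2 := fun s hs =>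
    c_large_after_w hY hV hR hT hT'T hT'2 hK hML hMK hε hεle h0 hτ1 hcτ hbτ hB hd hon (hJ s hs)
  have hVJ : ∀ s ∈ Icc t₀ t₁, |Y s 0 * Y s 3 * (ε ^ 2 * (Y s 2)⁻¹)| ≤ 4 / K ^ 100 := by
    intro s hs
    have hcl := hcJ s hs
    have hcpos : 0 < Y s 2 := lt_of_lt_of_le (by positivity) hcl
    have hq0 : 0 ≤ ε ^ 2 * (Y s 2)⁻¹ := by positivity
    have hq : ε ^ 2 * (Y s 2)⁻¹ ≤ 1 / K ^ 100 := by
      rw [← div_eq_mul_inv, div_le_div_iff₀ hcpos (by positivity), one_mul]; linarith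
    rw [abs_mul, abs_mul, abs_of_nonneg hq0]
    calc |Y s 0| * |Y s 3| * (ε ^ 2 * (Y s 2)⁻¹) ≤ 2 * 2 * (1 / K ^ 100) :=
          mul_le_mul (mul_le_mul (abs_coord_le_two hR hT'T (hJ0 s hs) 0)
            (abs_coord_le_two hR hT'T (hJ0 s hs) 3) (abs_nonneg _) (by norm_num)) hq hq0
            (by norm_num)
      _ = 4 / K ^ 100 := by ring
  -- Ψ = corrector + (2/K)·ã increases at rate ≥ 97/100 on J
  have hmono := Thm53.monotoneOn_sub_of_le_deriv (s := Icc t₀ t₁)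
    (f := fun s => Y s 0 * Y s 3 * (ε ^ 2 * (Y s 2)⁻¹) + 2 / K * Y s 4)
    (φ := fun _ => (97 : ℝ) / 100) (Φ := fun s => 97 / 100 * s) (convex_Icc t₀ t₁)
    (fun s hs => by
      have hcne : Y s 2 ≠ 0 := (lt_of_lt_of_le (by positivity) (hcJ s hs)).ne'
      exact (hasDerivAt_corrector hY hcne).add ((hasDerivAt_coord (hY s) 4).const_mul (2 / K)))
    (fun s _ => by simpa using (hasDerivAt_id s).const_mul ((97 : ℝ) / 100))
    (fun s hs => by
      have hs0 := hJ0 s hs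
      have hRem := (abs_le.1 (corrector_remainder_le_w hY hV hR hT hT'T hT'2 hK hML hMK hε hεle h0 hτ1 hcτ hbτ hd hon hB (hJ s hs))).1
      have hθ4 := (abs_le.1 (abs_coord_defect_le (hV s (mem_Ico_of_mem_late hT'T hs0)) 4)).1
      rw [field_four] at hθ4
      have hEn := (abs_le.1 (abs_energy_sub_one_late hY hV hR hT hT'T hT'2 h0 hδ₀1 hs0)).1
      rw [energy_five] at hEn
      have hbc := bc_sq_late_w hY hV hR hT hT'T hT'2 hK hML hMK hε hεle h0 hB hs0
      have hes := heJ s hs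
      have hen : -(δ₀ + 2 * δ) ≤ Y s 4 := e_ge_neg_late hY hV hT hT'T hT'2 hK0.le h0 hs0
      have he2 : Y s 4 ^ 2 ≤ (1 / 10 + δ) ^ 2 := sq_le_sq' (by linarith) hes
      have hsq : (1 / 10 + δ) ^ 2 = 1 / 100 + δ / 5 + δ * δ := by ring
      have hδδ : δ * δ ≤ 1 * δ := mul_le_mul_of_nonneg_right (by linarith) hδ
      have hK90 : (2 : ℝ) ^ 90 ≤ K ^ 90 := pow_le_pow_left₀ (by norm_num) (by linarith) 90
      have h40 : 40 / K ^ 90 ≤ 1 / 1000 := by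
        rw [div_le_div_iff₀ (by positivity) (by norm_num)]; linarith
      have hKd : 2 / K * (K * Y s 3 ^ 2) = 2 * Y s 3 ^ 2 := by field_simp
      have h2K : 2 / K * (K * Y s 3 ^ 2 - δ) ≤ 2 / K * V s 4 :=
        mul_le_mul_of_nonneg_left (by linarith) (by positivity)
      have e1 : 2 / K * (K * Y s 3 ^ 2 - δ) = 2 / K * (K * Y s 3 ^ 2) - 2 / K * δ := by ring
      have h2Kδ : 2 / K * δ ≤ 1 * δ := by
        refine mul_le_mul_of_nonneg_right ?_ hδ
        rw [div_le_one hK0]; linarith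
      rw [e1, hKd] at h2K
      show (97 : ℝ) / 100 ≤ ((V s 0 * Y s 3 + Y s 0 * V s 3) * (ε ^ 2 * (Y s 2)⁻¹)
        - Y s 0 * Y s 3 * (ε ^ 2 * (Y s 2)⁻¹) * (V s 2 * (Y s 2)⁻¹)) + 2 / K * V s 4
      linarith)
  have hmem0 : t₀ ∈ Icc t₀ t₁ := left_mem_Icc.2 h01
  have hmem1 : t₁ ∈ Icc t₀ t₁ := right_mem_Icc.2 h01
  have h := hmono hmem0 hmem1 h01
  simp only at h
  have hV0 := (abs_le.1 (hVJ t₀ hmem0)).1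
  have hV1 := (abs_le.1 (hVJ t₁ hmem1)).2
  have he0 : -(δ₀ + 2 * δ) ≤ Y t₀ 4 := e_ge_neg_late hY hV hT hT'T hT'2 hK0.le h0 (hJ0 t₀ hmem0)
  have hKu : 2 / K * Y t₁ 4 - 2 / K * Y t₀ 4 ≤ 2 * u * (1 / 10 + 1 / 100) := by
    have e : 2 / K * Y t₁ 4 - 2 / K * Y t₀ 4 = 2 * u * (Y t₁ 4 - Y t₀ 4) := by rw [hu]; ring
    rw [e]; exact mul_le_mul_of_nonneg_left (by linarith) (by positivity)
  have hK99 : (2 : ℝ) ^ 8 ≤ K ^ 99 :=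
    (pow_le_pow_left₀ (by norm_num) (show (2 : ℝ) ≤ K by linarith) 8).trans
      (pow_le_pow_right₀ hK1 (by norm_num))
  have hi99 : (K ^ 99)⁻¹ ≤ 1 / 256 := by
    rw [one_div, inv_le_inv₀ (by positivity) (by norm_num)]; linarith
  have h100 : 4 / K ^ 100 ≤ 4 * (u * (1 / 256)) := by
    have e : 4 / K ^ 100 = 4 * (u * (K ^ 99)⁻¹) := by
      rw [hu, ← mul_inv, ← pow_succ', div_eq_mul_inv]
    rw [e]; exact mul_le_mul_of_nonneg_left (mul_le_mul_of_nonneg_left hi99 hu0.le) (by norm_num)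
  linarith

end Onset

end Entry


omit hY hR hT'T hT'2 in
/-- Numerics of the firing phase: `ε ≤ K⁻¹⁰⁰`, `δ ≤ ε`, `7δ₀ + 40δ ≤ ε`, `20 ≤ √K`,
`(√K)⁻¹ ≤ 1/20`, `K⁻¹ ≤ 1/32`, `K·(√K)⁻¹ = √K`, and the numeric input `2e^{(1-√K)/10} ≤ K⁻²⁰`.
[cite: Tao2016AveragedNS, §5.5 ("for `K` sufficiently large")] -/
theorem firing_params_w (hB : WideBudget M ε δ δ₀) : ε ≤ 1 / K ^ 100 ∧ δ ≤ ε ∧ 7 * δ₀ + 40 * δ ≤ ε ∧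
    20 ≤ Real.sqrt K ∧ (Real.sqrt K)⁻¹ ≤ 1 / 20 ∧ K⁻¹ ≤ 1 / 32 ∧
    K * (Real.sqrt K)⁻¹ = Real.sqrt K ∧ 2 * exp ((1 - Real.sqrt K) / 10) ≤ 1 / K ^ 20 := by
  obtain ⟨hM6000, hε1, -, -, -, -, -, -, -⟩ := ignition_params hK hML hMK hε hεle
  obtain ⟨hK16, -, -, -, -, -⟩ := negKick_params hK hML hMK hε hεle
  obtain ⟨hsε, -, hδs, hA⟩ := late_facts_w hV hT hK hML hMK hε hεle h0 hB
  obtain ⟨-, -, -, -, hN4, -, -, -, -⟩ := Thm53With.family_params hK hML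
  obtain ⟨-, -, hKs, -, -⟩ := Thm53.invSqrt_facts hK16
  have hK0 : 0 < K := by linarith
  have hf1 : (1 : ℝ) ≤ (Nat.factorial 42 : ℝ) := by
    exact_mod_cast Nat.succ_le_of_lt (Nat.factorial_pos 42)
  have hf2 : (400 : ℝ) ≤ 2 * 20 ^ 42 * (Nat.factorial 42 : ℝ) :=
    le_trans (by norm_num) (le_mul_of_one_le_right (by positivity) hf1)
  have hK400 : (20 : ℝ) ^ 2 ≤ K := by linarith
  have h20 : (20 : ℝ) ≤ Real.sqrt K := by
    rw [show (20 : ℝ) = Real.sqrt (20 ^ 2) by rw [Real.sqrt_sq (by norm_num)]]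
    exact Real.sqrt_le_sqrt hK400
  have hs20 : (Real.sqrt K)⁻¹ ≤ 1 / 20 := by
    rw [inv_le_comm₀ (by positivity) (by norm_num)]; simpa using h20
  have hKinv : K⁻¹ ≤ 1 / 32 := by rw [inv_le_comm₀ hK0 (by norm_num)]; linarith
  have hε100 : ε ≤ 1 / K ^ 100 :=
    hεle.trans (div_le_div_of_nonneg_right (exp_le_one_iff.2 (by linarith)) (by positivity))
  have hs0 : 0 ≤ ε ^ 2 * exp (-M) := by positivity
  exact ⟨hε100, by linarith, by linarith, h20, hs20, hKinv, hKs, hN4⟩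

section Entry

variable {τ : ℝ} (hτ1 : 1 < τ) (hcτ : Y τ 2 = ε ^ 2 / K ^ 10) (hbτ : 49 / 50 * ε ≤ Y τ 1)
include hτ1 hcτ hbτ

section Onset

variable {d : ℝ} (hd : 0 ≤ d) (hon : 2 * K ^ 110 ≤ exp (9 / 10 * M * d))
include hd hon

/-! ## §2. (toke): the modified energy decays -/

/-- `|V| = |adε²/c| ≤ 4K⁻¹⁰⁰` on `[τ + d, T']`. [cite: Tao2016AveragedNS, §5.5 (c-large)] -/
theorem abs_corrector_le_w (hB : WideBudget M ε δ δ₀) {t : ℝ} (ht : t ∈ Icc (τ + d) T') :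
    |Y t 0 * Y t 3 * (ε ^ 2 * (Y t 2)⁻¹)| ≤ 4 / K ^ 100 := by
  obtain ⟨hK16, -, -, -, -, -⟩ := negKick_params hK hML hMK hε hεle
  have hK0 : 0 < K := by linarith
  have ht0 : t ∈ Icc (0 : ℝ) T' := ⟨by linarith [ht.1], ht.2⟩
  have hcl := c_large_after_w hY hV hR hT hT'T hT'2 hK hML hMK hε hεle h0 hτ1 hcτ hbτ hB hd hon ht
  have hcpos : 0 < Y t 2 := lt_of_lt_of_le (by positivity) hcl
  have hq0 : 0 ≤ ε ^ 2 * (Y t 2)⁻¹ := by positivity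
  have hq : ε ^ 2 * (Y t 2)⁻¹ ≤ 1 / K ^ 100 := by
    rw [← div_eq_mul_inv, div_le_div_iff₀ hcpos (by positivity), one_mul]; linarith
  rw [abs_mul, abs_mul, abs_of_nonneg hq0]
  calc |Y t 0| * |Y t 3| * (ε ^ 2 * (Y t 2)⁻¹) ≤ 2 * 2 * (1 / K ^ 100) :=
        mul_le_mul (mul_le_mul (abs_coord_le_two hR hT'T ht0 0) (abs_coord_le_two hR hT'T ht0 3)
          (abs_nonneg _) (by norm_num)) hq hq0 (by norm_num)
    _ = 4 / K ^ 100 := by ring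

/-- `|½K·V·ã| ≤ 4K⁻⁹⁹` on `[τ + d, T']`. [cite: Tao2016AveragedNS, §5.5 (proof of (beable))] -/
theorem abs_KVe_le_w (hB : WideBudget M ε δ δ₀) {t : ℝ} (ht : t ∈ Icc (τ + d) T') :
    |K / 2 * (Y t 0 * Y t 3 * (ε ^ 2 * (Y t 2)⁻¹) * Y t 4)| ≤ 4 / K ^ 99 := by
  obtain ⟨hK16, -, -, -, -, -⟩ := negKick_params hK hML hMK hε hεle
  have hK0 : 0 < K := by linarith
  have ht0 : t ∈ Icc (0 : ℝ) T' := ⟨by linarith [ht.1], ht.2⟩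
  have hVt := abs_corrector_le_w hY hV hR hT hT'T hT'2 hK hML hMK hε hεle h0 hτ1 hcτ hbτ hd hon hB ht
  have he := abs_coord_le_two hR hT'T ht0 4
  rw [abs_mul, abs_of_pos (by positivity : 0 < K / 2), abs_mul]
  calc K / 2 * (|Y t 0 * Y t 3 * (ε ^ 2 * (Y t 2)⁻¹)| * |Y t 4|) ≤ K / 2 * (4 / K ^ 100 * 2) :=
        mul_le_mul_of_nonneg_left (mul_le_mul hVt he (abs_nonneg _) (by positivity))
          (by positivity)
    _ = 4 / K ^ 99 := by
        rw [show K / 2 * (4 / K ^ 100 * 2) = 4 * K / K ^ 100 by ring,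
          div_eq_div_iff (by positivity) (by positivity)]
        ring

/-- **Dissipation of `E_*` for approximate trajectories**: on `[t', T']`, `t' = τ + d + 1/K`,
`∂ₜE_* + Kã(t')E_* ≤ 80K⁻⁸⁹`. [cite: Tao2016AveragedNS, §5.5 (proof of (beable))] -/
theorem Es_dissipation_after_w (hB : WideBudget M ε δ δ₀) (hfit : τ + d + K⁻¹ ≤ T') {s : ℝ}
    (hs : s ∈ Icc (τ + d + K⁻¹) T') :
    (-(Y s 4 * V s 4) - K / 2 *
        (((V s 0 * Y s 3 + Y s 0 * V s 3) * (ε ^ 2 * (Y s 2)⁻¹)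
            - Y s 0 * Y s 3 * (ε ^ 2 * (Y s 2)⁻¹) * (V s 2 * (Y s 2)⁻¹)) * Y s 4
          + Y s 0 * Y s 3 * (ε ^ 2 * (Y s 2)⁻¹) * V s 4))
      + K * Y (τ + d + K⁻¹) 4 * ((1 - Y s 4 * Y s 4) / 2
          - K / 2 * (Y s 0 * Y s 3 * (ε ^ 2 * (Y s 2)⁻¹) * Y s 4)) ≤ 80 / K ^ 89 := by
  obtain ⟨hK16, -, -, -, -, -⟩ := negKick_params hK hML hMK hε hεle
  obtain ⟨hδ₀, hδ, -, hδ₀1, -, -⟩ := budget_facts_w hV hT hK hML hMK hε hεle h0 hB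
  obtain ⟨hε100, hδε, hAε, -, -, -, -, -⟩ :=
    firing_params_w hV hT hK hML hMK hε hεle h0 hB
  have hK0 : 0 < K := by linarith
  have hτ0 : (0 : ℝ) ≤ τ := by linarith
  have hKi0 : 0 < K⁻¹ := inv_pos.2 hK0
  have hsO : s ∈ Icc (τ + d) T' := ⟨by linarith [hs.1], hs.2⟩
  have hs0 : s ∈ Icc (0 : ℝ) T' := ⟨by linarith [hs.1], hs.2⟩
  have ht'0 : τ + d + K⁻¹ ∈ Icc (0 : ℝ) T' := ⟨by linarith, hfit⟩
  have hcl := c_large_after_w hY hV hR hT hT'T hT'2 hK hML hMK hε hεle h0 hτ1 hcτ hbτ hB hd hon hsO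
  have hcpos : 0 < Y s 2 := lt_of_lt_of_le (by positivity) hcl
  have hq0 : 0 ≤ ε ^ 2 * (Y s 2)⁻¹ := by positivity
  have hq1 : ε ^ 2 * (Y s 2)⁻¹ ≤ 1 / K ^ 100 := by
    rw [← div_eq_mul_inv, div_le_div_iff₀ hcpos (by positivity), one_mul]; linarith
  have hRm := corrector_remainder_le_w hY hV hR hT hT'T hT'2 hK hML hMK hε hεle h0 hτ1 hcτ hbτ hd hon hB hsO
  have hθ' := abs_coord_defect_le (hV s (mem_Ico_of_mem_late hT'T hs0)) 4
  rw [field_four] at hθ'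
  have hθ : |V s 4 - K * Y s 3 ^ 2| ≤ ε := hθ'.trans hδε
  have hEn := abs_energy_sub_one_late hY hV hR hT hT'T hT'2 h0 hδ₀1 hs0
  have hηε : |energy (Y s) - 1| ≤ ε := hEn.trans hAε
  have hsum : Y s 0 ^ 2 + Y s 1 ^ 2 + Y s 2 ^ 2 + Y s 3 ^ 2 + Y s 4 ^ 2 =
      1 + (energy (Y s) - 1) := by
    rw [energy_five]; ring
  have ha := abs_coord_le_two hR hT'T hs0 0
  have hd' := abs_coord_le_two hR hT'T hs0 3
  have he := abs_coord_le_two hR hT'T hs0 4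
  have he₀ := e_tenth_after_w hY hV hR hT hT'T hT'2 hK hML hMK hε hεle h0 hτ1 hcτ hbτ hd hon hB hfit
  have he02 : Y (τ + d + K⁻¹) 4 ≤ 2 := (le_abs_self _).trans (abs_coord_le_two hR hT'T ht'0 4)
  have hee : Y (τ + d + K⁻¹) 4 - ε ≤ Y s 4 := by
    have h := e_sub_ge_late hY hV hT'T hK0.le ht'0.1 hs.1 hs.2
    have : δ * (s - (τ + d + K⁻¹)) ≤ δ * 1 :=
      mul_le_mul_of_nonneg_left (by linarith [hs.2]) hδ
    linarith
  have hbc := bc_sq_late_w hY hV hR hT hT'T hT'2 hK hML hMK hε hεle h0 hB hs0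
  have halg := Es_alg_approx hK16 hsum hηε hq0 hq1 hRm ha hd' he (by linarith) he02 hee hbc hθ
    hε hε100
  linarith

/-- **(toke) for approximate trajectories**: on `[t', T']`, `t' = τ + d + 1/K`,
`E_*(t) ≤ e^{(K/10)(t' - t)} + 800K⁻⁹⁰` (Grönwall from `t'`, `ã(t') ≥ 1/10`, `E_*(t') ≤ 1`).
[cite: Tao2016AveragedNS, §5.5 (toke)] -/
theorem Es_decay_after_w (hB : WideBudget M ε δ δ₀) (hfit : τ + d + K⁻¹ ≤ T') {t : ℝ} (ht : t ∈ Icc (τ + d + K⁻¹) T') :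
    (1 - Y t 4 * Y t 4) / 2 - K / 2 * (Y t 0 * Y t 3 * (ε ^ 2 * (Y t 2)⁻¹) * Y t 4)
      ≤ exp (K / 10 * ((τ + d + K⁻¹) - t)) + 800 / K ^ 90 := by
  obtain ⟨hK16, -, -, -, -, -⟩ := negKick_params hK hML hMK hε hεle
  have hK0 : 0 < K := by linarith
  have hK1 : 1 ≤ K := by linarith
  have hτ0 : (0 : ℝ) ≤ τ := by linarith
  have hKi0 : 0 < K⁻¹ := inv_pos.2 hK0
  have he₀ : 1 / 10 ≤ Y (τ + d + K⁻¹) 4 :=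
    e_tenth_after_w hY hV hR hT hT'T hT'2 hK hML hMK hε hεle h0 hτ1 hcτ hbτ hd hon hB hfit
  have he₀pos : 0 < Y (τ + d + K⁻¹) 4 := lt_of_lt_of_le (by norm_num) he₀
  have hKe : 0 < K * Y (τ + d + K⁻¹) 4 := mul_pos hK0 he₀pos
  have hI : ∀ s ∈ Icc (τ + d + K⁻¹) T', s ∈ Icc (τ + d) T' := fun s hs =>
    ⟨by linarith [hs.1], hs.2⟩
  have hC0 : 0 ≤ 80 / K ^ 89 / (K * Y (τ + d + K⁻¹) 4) := by positivity
  -- Grönwall in integrating-factor form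
  have hanti := Thm53.antitoneOn_intFactor (s := Icc (τ + d + K⁻¹) T')
    (f := fun s => (1 - Y s 4 * Y s 4) / 2 - K / 2 * (Y s 0 * Y s 3 * (ε ^ 2 * (Y s 2)⁻¹) * Y s 4))
    (g := fun _ => -(K * Y (τ + d + K⁻¹) 4)) (G := fun s => -(K * Y (τ + d + K⁻¹) 4 * s))
    (φ := fun s => 80 / K ^ 89 * exp (K * Y (τ + d + K⁻¹) 4 * s))
    (Φ := fun s => 80 / K ^ 89 / (K * Y (τ + d + K⁻¹) 4) * exp (K * Y (τ + d + K⁻¹) 4 * s))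
    (convex_Icc _ _)
    (fun s hs => by
      have hcl : K ^ 100 * ε ^ 2 ≤ Y s 2 := c_large_after_w hY hV hR hT hT'T hT'2 hK hML hMK hε hεle
        h0 hτ1 hcτ hbτ hB hd hon (hI s hs)
      have hcne : Y s 2 ≠ 0 := (lt_of_lt_of_le (by positivity) hcl).ne'
      exact hasDerivAt_Es hY hcne)
    (fun s _ => ((hasDerivAt_id s).const_mul (K * Y (τ + d + K⁻¹) 4)).neg.congr_deriv (by simp))
    (fun s _ => by
      have hne : K * Y (τ + d + K⁻¹) 4 ≠ 0 := hKe.ne'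
      have := (((hasDerivAt_id s).const_mul (K * Y (τ + d + K⁻¹) 4)).exp).const_mul
        (80 / K ^ 89 / (K * Y (τ + d + K⁻¹) 4))
      refine this.congr_deriv ?_
      simp only [mul_one, id_eq]
      generalize Y (τ + d + K⁻¹) 4 = e₀ at hne ⊢
      have hne' : e₀ ≠ 0 := right_ne_zero_of_mul hne
      field_simp)
    (fun s hs => by
      have hdis := Es_dissipation_after_w hY hV hR hT hT'T hT'2 hK hML hMK hε hεle h0 hτ1 hcτ hbτ hd hon hB hfit hs
      have hE : exp (-(-(K * Y (τ + d + K⁻¹) 4 * s))) = exp (K * Y (τ + d + K⁻¹) 4 * s) := by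
        rw [neg_neg]
      rw [hE]
      have h2 := mul_le_mul_of_nonneg_right hdis (exp_pos (K * Y (τ + d + K⁻¹) 4 * s)).le
      linarith)
  have ht'mem : τ + d + K⁻¹ ∈ Icc (τ + d + K⁻¹) T' := ⟨le_rfl, hfit⟩
  have hA := hanti ht'mem ht ht.1
  simp only [neg_neg] at hA
  have hsplit : exp (K * Y (τ + d + K⁻¹) 4 * (τ + d + K⁻¹))
      = exp (K * Y (τ + d + K⁻¹) 4 * t) *
        exp (K * Y (τ + d + K⁻¹) 4 * ((τ + d + K⁻¹) - t)) := by
    rw [← exp_add]; congr 1; ring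
  rw [hsplit] at hA
  -- `E_*(t') ≤ 1`
  have hEs1 : (1 - Y (τ + d + K⁻¹) 4 * Y (τ + d + K⁻¹) 4) / 2
      - K / 2 * (Y (τ + d + K⁻¹) 0 * Y (τ + d + K⁻¹) 3 * (ε ^ 2 * (Y (τ + d + K⁻¹) 2)⁻¹)
        * Y (τ + d + K⁻¹) 4) ≤ 1 := by
    have h1 : (1 - Y (τ + d + K⁻¹) 4 * Y (τ + d + K⁻¹) 4) / 2 ≤ 1 / 2 := by
      linarith [mul_self_nonneg (Y (τ + d + K⁻¹) 4)]
    have h2 := (abs_le.1 (abs_KVe_le_w hY hV hR hT hT'T hT'2 hK hML hMK hε hεle h0 hτ1 hcτ hbτ hd hon hB (hI _ ht'mem))).1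
    have h3 : 4 / K ^ 99 ≤ 1 / 2 := by
      rw [div_le_div_iff₀ (by positivity) (by norm_num)]
      have : (16 : ℝ) ≤ K ^ 99 := le_trans hK16 (le_self_pow₀ hK1 (by norm_num))
      linarith
    linarith
  have hρ0 : 0 < exp (K * Y (τ + d + K⁻¹) 4 * ((τ + d + K⁻¹) - t)) := exp_pos _
  have hEst := Thm53.decay_alg (exp_pos _) hρ0 hC0 hEs1 hA
  -- `ρ ≤ exp((K/10)(t' - t))`
  have hρle : exp (K * Y (τ + d + K⁻¹) 4 * ((τ + d + K⁻¹) - t)) ≤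
      exp (K / 10 * ((τ + d + K⁻¹) - t)) := by
    rw [exp_le_exp]
    have hn : (τ + d + K⁻¹) - t ≤ 0 := by linarith [ht.1]
    have := mul_le_mul_of_nonpos_right (mul_le_mul_of_nonneg_left he₀ hK0.le) hn
    have e1 : K * (1 / 10) * ((τ + d + K⁻¹) - t) = K / 10 * ((τ + d + K⁻¹) - t) := by ring
    linarith
  have hCle : 80 / K ^ 89 / (K * Y (τ + d + K⁻¹) 4) ≤ 800 / K ^ 90 := by
    rw [div_le_div_iff₀ hKe (by positivity)]
    have e1 : 80 / K ^ 89 * K ^ 90 = 80 * K := by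
      rw [div_mul_eq_mul_div, div_eq_iff (by positivity)]; ring
    rw [e1]
    have := mul_le_mul_of_nonneg_left he₀ hK0.le
    linarith
  linarith

/-! ## §3. (able): equipartition has eaten the carrier and the rotor -/

/-- **(toke) ⇒ a² + d² small**: on `[t' + 1/√K, T']`, `a² + d² ≤ 2K⁻²⁰`
(`a² + d² = η + 2E_* + KVã - b² - c²`, `2e^{-√K/10} ≤ K⁻²⁰`).
[cite: Tao2016AveragedNS, §5.5 (beable)] -/
theorem ad_sq_le_after_w (hB : WideBudget M ε δ δ₀) (hfit : τ + d + K⁻¹ ≤ T') {t : ℝ}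
    (ht : t ∈ Icc (τ + d + K⁻¹ + (Real.sqrt K)⁻¹) T') :
    Y t 0 ^ 2 + Y t 3 ^ 2 ≤ 2 / K ^ 20 := by
  obtain ⟨hK16, -, -, -, -, -⟩ := negKick_params hK hML hMK hε hεle
  obtain ⟨hδ₀, hδ, -, hδ₀1, -, -⟩ := budget_facts_w hV hT hK hML hMK hε hεle h0 hB
  obtain ⟨hε100, hδε, hAε, h20, hs20, -, hKs, hN4⟩ :=
    firing_params_w hV hT hK hML hMK hε hεle h0 hB
  obtain ⟨hsq0, -, -, -, -⟩ := Thm53.invSqrt_facts hK16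
  have hK0 : 0 < K := by linarith
  have hK1 : 1 ≤ K := by linarith
  have hτ0 : (0 : ℝ) ≤ τ := by linarith
  have hKi0 : 0 < K⁻¹ := inv_pos.2 hK0
  have htI : t ∈ Icc (τ + d + K⁻¹) T' := ⟨by linarith [ht.1, hsq0.le], ht.2⟩
  have htO : t ∈ Icc (τ + d) T' := ⟨by linarith [htI.1], ht.2⟩
  have ht0 : t ∈ Icc (0 : ℝ) T' := ⟨by linarith [htO.1], ht.2⟩
  have hEs := Es_decay_after_w hY hV hR hT hT'T hT'2 hK hML hMK hε hεle h0 hτ1 hcτ hbτ hd hon hB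
    hfit htI
  have hKV := (abs_le.1 (abs_KVe_le_w hY hV hR hT hT'T hT'2 hK hML hMK hε hεle h0 hτ1 hcτ hbτ hd hon hB htO)).2
  have hEn := (abs_le.1 ((abs_energy_sub_one_late hY hV hR hT hT'T hT'2 h0 hδ₀1 ht0).trans hAε)).2
  rw [energy_five] at hEn
  have hbc0 : 0 ≤ Y t 1 ^ 2 + Y t 2 ^ 2 := by positivity
  have hρ : exp (K / 10 * ((τ + d + K⁻¹) - t)) ≤ exp ((1 - Real.sqrt K) / 10) := by
    rw [exp_le_exp]
    have h1 : (τ + d + K⁻¹) - t ≤ -(Real.sqrt K)⁻¹ := by linarith [ht.1]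
    have h2 : K / 10 * ((τ + d + K⁻¹) - t) ≤ K / 10 * (-(Real.sqrt K)⁻¹) :=
      mul_le_mul_of_nonneg_left h1 (by positivity)
    have h3 : K / 10 * (-(Real.sqrt K)⁻¹) = -(K * (Real.sqrt K)⁻¹) / 10 := by ring
    rw [h3, hKs] at h2
    have h4 : -Real.sqrt K / 10 ≤ (1 - Real.sqrt K) / 10 := by linarith
    exact h2.trans h4
  -- numerics in the atom `w = 1/K^20`
  have h90 : (1 : ℝ) / K ^ 90 = 1 / K ^ 70 * (1 / K ^ 20) := by
    rw [one_div_mul_one_div, ← pow_add]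
  have h70 : (1 : ℝ) / K ^ 70 ≤ 1 / 10000 := by
    have := one_div_le_one_div_of_le (by norm_num) (pow_le_pow_left₀ (by norm_num) hK16 70)
    exact this.trans (by norm_num)
  have hP : (1 : ℝ) / K ^ 90 ≤ 1 / 10000 * (1 / K ^ 20) := by
    rw [h90]; exact mul_le_mul_of_nonneg_right h70 (by positivity)
  have h99 : (1 : ℝ) / K ^ 99 ≤ 1 / K ^ 90 :=
    div_le_div_of_nonneg_left (by norm_num) (by positivity) (pow_le_pow_right₀ hK1 (by norm_num))
  have h100 : (1 : ℝ) / K ^ 100 ≤ 1 / K ^ 90 :=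
    div_le_div_of_nonneg_left (by norm_num) (by positivity) (pow_le_pow_right₀ hK1 (by norm_num))
  have r1 : (800 : ℝ) / K ^ 90 = 800 * (1 / K ^ 90) := by ring
  have r2 : (4 : ℝ) / K ^ 99 = 4 * (1 / K ^ 99) := by ring
  have r3 : (2 : ℝ) / K ^ 20 = 2 * (1 / K ^ 20) := by ring
  rw [r1] at hEs
  rw [r2] at hKV
  rw [r3]
  have hee : Y t 4 * Y t 4 = Y t 4 ^ 2 := by ring
  linarith

/-- **(able) for approximate trajectories**: on `[t' + 1/√K, T']` (`t' = τ + d + 1/K`),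
`|ã - 1| ≤ 4K⁻²⁰` and `|a|, |b|, |c|, |d| ≤ 2K⁻¹⁰`. [cite: Tao2016AveragedNS, §5.5 (able)] -/
theorem fired_after_w (hB : WideBudget M ε δ δ₀) (hfit : τ + d + K⁻¹ ≤ T') {t : ℝ}
    (ht : t ∈ Icc (τ + d + K⁻¹ + (Real.sqrt K)⁻¹) T') :
    |Y t 4 - 1| ≤ 4 / K ^ 20 ∧ ∀ i : Fin 5, i ≠ 4 → |Y t i| ≤ 2 / K ^ 10 := by
  obtain ⟨hK16, -, -, -, -, -⟩ := negKick_params hK hML hMK hε hεle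
  obtain ⟨hδ₀, hδ, -, hδ₀1, -, -⟩ := budget_facts_w hV hT hK hML hMK hε hεle h0 hB
  obtain ⟨hε100, hδε, hAε, -, -, -, -, -⟩ :=
    firing_params_w hV hT hK hML hMK hε hεle h0 hB
  obtain ⟨hsq0, -, -, -, -⟩ := Thm53.invSqrt_facts hK16
  have hK0 : 0 < K := by linarith
  have hK1 : 1 ≤ K := by linarith
  have hτ0 : (0 : ℝ) ≤ τ := by linarith
  have hKi0 : 0 < K⁻¹ := inv_pos.2 hK0
  have htI : t ∈ Icc (τ + d + K⁻¹) T' := ⟨by linarith [ht.1, hsq0.le], ht.2⟩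
  have ht0 : t ∈ Icc (0 : ℝ) T' := ⟨by linarith [htI.1], ht.2⟩
  have ht'0 : τ + d + K⁻¹ ∈ Icc (0 : ℝ) T' := ⟨by linarith, hfit⟩
  have had := ad_sq_le_after_w hY hV hR hT hT'T hT'2 hK hML hMK hε hεle h0 hτ1 hcτ hbτ hd hon hB
    hfit ht
  have hbc := bc_sq_late_w hY hV hR hT hT'T hT'2 hK hML hMK hε hεle h0 hB ht0
  have hEn := abs_le.1 ((abs_energy_sub_one_late hY hV hR hT hT'T hT'2 h0 hδ₀1 ht0).trans hAε)
  rw [energy_five] at hEn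
  obtain ⟨hEn1, hEn2⟩ := hEn
  -- numerics in the atom `w = 1/K^20`: `9ε ≤ w ≤ 1/16`
  have h9 : 9 * (1 / K ^ 100) ≤ 1 / K ^ 20 := by
    rw [mul_one_div, div_le_div_iff₀ (by positivity) (by positivity)]
    have h80 : (9 : ℝ) ≤ K ^ 80 := le_trans (by norm_num) (pow_le_pow_left₀ (by norm_num) hK16 80)
    calc (9 : ℝ) * K ^ 20 ≤ K ^ 80 * K ^ 20 := mul_le_mul_of_nonneg_right h80 (by positivity)
      _ = 1 * K ^ 100 := by ring
  have hε9 : 9 * ε ≤ 1 / K ^ 20 := by linarith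
  have hw16 : 1 / K ^ 20 ≤ 1 / 16 := by
    have h1 : 1 / K ^ 20 ≤ 1 / K :=
      one_div_le_one_div_of_le hK0 (le_self_pow₀ hK1 (by norm_num))
    have h2 : 1 / K ≤ 1 / 16 := one_div_le_one_div_of_le (by norm_num) hK16
    exact h1.trans h2
  have hw0 : (0 : ℝ) < 1 / K ^ 20 := by positivity
  have r2 : (2 : ℝ) / K ^ 20 = 2 * (1 / K ^ 20) := by ring
  have r4 : (4 : ℝ) / K ^ 20 = 4 * (1 / K ^ 20) := by ring
  rw [r2] at had
  -- the output is positive: `ã ≥ ã(t') - δ ≥ 1/10 - δ`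
  have he₀ := e_tenth_after_w hY hV hR hT hT'T hT'2 hK hML hMK hε hεle h0 hτ1 hcτ hbτ hd hon hB hfit
  have hepos : 0 < Y t 4 := by
    have h := e_sub_ge_late hY hV hT'T hK0.le ht'0.1 htI.1 ht.2
    have : δ * (t - (τ + d + K⁻¹)) ≤ δ * 1 := mul_le_mul_of_nonneg_left (by linarith [ht.2]) hδ
    linarith
  have hs0 := sq_nonneg (Y t 0)
  have hs1 := sq_nonneg (Y t 1)
  have hs2 := sq_nonneg (Y t 2)
  have hs3 := sq_nonneg (Y t 3)
  refine ⟨?_, ?_⟩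
  · rw [r4, abs_sub_le_iff]
    constructor
    · rcases le_or_gt (Y t 4) 1 with h1 | h1
      · linarith
      · have hm : (Y t 4 - 1) * 1 ≤ (Y t 4 - 1) * (Y t 4 + 1) :=
          mul_le_mul_of_nonneg_left (by linarith) (by linarith)
        have hid : (Y t 4 - 1) * (Y t 4 + 1) = Y t 4 ^ 2 - 1 := by ring
        linarith
    · rcases le_or_gt 1 (Y t 4) with h1 | h1
      · linarith
      · have hm : (1 - Y t 4) * 1 ≤ (1 - Y t 4) * (1 + Y t 4) :=
          mul_le_mul_of_nonneg_left (by linarith) (by linarith)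
        have hid : (1 - Y t 4) * (1 + Y t 4) = 1 - Y t 4 ^ 2 := by ring
        linarith
  · have hsq : ∀ x : ℝ, x ^ 2 ≤ 4 * (1 / K ^ 20) → |x| ≤ 2 / K ^ 10 := by
      intro x hx
      have hx' : x ^ 2 ≤ (2 / K ^ 10) ^ 2 := by
        rw [div_pow, show (K ^ 10) ^ 2 = K ^ 20 by ring]
        have : (4 : ℝ) * (1 / K ^ 20) = 2 ^ 2 / K ^ 20 := by ring
        linarith
      calc |x| ≤ Real.sqrt ((2 / K ^ 10) ^ 2) := Real.abs_le_sqrt hx'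
        _ = 2 / K ^ 10 := Real.sqrt_sq (by positivity)
    have hx0 : Y t 0 ^ 2 ≤ 4 * (1 / K ^ 20) := by linarith
    have hx3 : Y t 3 ^ 2 ≤ 4 * (1 / K ^ 20) := by linarith
    have hx1 : Y t 1 ^ 2 ≤ 4 * (1 / K ^ 20) := by linarith
    have hx2 : Y t 2 ^ 2 ≤ 4 * (1 / K ^ 20) := by linarith
    intro i hi
    fin_cases i
    · exact hsq _ hx0
    · exact hsq _ hx1
    · exact hsq _ hx2
    · exact hsq _ hx3
    · exact (hi (by decide)).elim

end Onset

end Entry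


end WideLate

end Late

end Approx

end Ignition

namespace IgnitionSharp

open Ignition

section Approx

variable {K M ε δ δ₀ T : ℝ} {Y V : ℝ → Fin 5 → ℝ}
  (hY : ∀ t, HasDerivAt Y (V t) t)
  (hV : ∀ t ∈ Ico 0 T, ‖V t - delayCircuitWith K M ε (Y t)‖ ≤ δ)
  (hR : ∀ t ∈ Ico 0 T, ‖Y t‖ ≤ 2) (hT : 2 ≤ T)
include hY hV hR hT

section Wide

variable (hK : 2 * 20 ^ 42 * (Nat.factorial 42 : ℝ) + 16 ≤ K) (hML : 3000 * Real.log K ≤ M)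
  (hMK : M ≤ K ^ 10) (hε : 0 < ε) (hεle : ε ≤ exp (-(10 * M)) / K ^ 100)
  (h0 : ‖Y 0 - delayInit‖ ≤ δ₀)
include hK hML hMK hε hεle h0


/-- **The carrier on the first unit of time, fine form**: `a(t)² ≥ 1 - 1/50000` for `t ∈ [0,1]`
(`ε² ≤ e^{-M} ≤ 4/M² ≤ 1/(9·10⁶)`: `b² ≤ 4ε²`, `c² ≤ 9ε⁴e^{-M}`, `d² + ã² ≤ 98e^{-M}`, energy
`≥ 1 - 2ε²e^{-M}`). [cite: Tao2016AveragedNS, §5.5 (energy-con)] -/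
theorem a_sq_ge_unit_fine_w (hB : WideBudget M ε δ δ₀) {t : ℝ} (ht : t ∈ Icc (0 : ℝ) 1) : 1 - 1 / 50000 ≤ Y t 0 ^ 2 := by
  obtain ⟨hM6000, hε1, hε2, hexpM, hMe, -, hMse, -, -⟩ := ignition_params hK hML hMK hε hεle
  obtain ⟨hε2e, heM, hM9, -⟩ := NegKick.negKick_params_fine hK hML hMK hε hεle
  obtain ⟨hδ₀, hδ, hη8, hδ₀1, h732, hs1⟩ := budget_facts_w hV hT hK hML hMK hε hεle h0 hB
  have ht' : t ∈ Icc (0 : ℝ) (8 / 5) := ⟨ht.1, by linarith [ht.2]⟩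
  have hE := (abs_le.1 (abs_energy_sub_one_le hY hV hR hT h0 hδ₀1 ht')).1
  rw [energy_five] at hE
  obtain ⟨hb1, hb2⟩ := b_bounds_unit_w hY hV hR hT hK hML hMK hε hεle h0 hB ht
  have hc := abs_c_le_unit_w hY hV hR hT hK hML hMK hε hεle h0 hB ht
  obtain ⟨hd, he⟩ := de_le_unit_w hY hV hR hT hK hML hMK hε hεle h0 hB ht
  have hb : Y t 1 ^ 2 ≤ 4 * ε ^ 2 := by nlinarith
  have hsq : ∀ x C : ℝ, |x| ≤ C → x ^ 2 ≤ C ^ 2 := fun x C h => by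
    rw [← sq_abs]; exact pow_le_pow_left₀ (abs_nonneg x) h 2
  have hc2 := hsq _ _ hc
  have hd2 := hsq _ _ hd
  have he2 := hsq _ _ he
  have hex : exp (-(M / 2)) ^ 2 = exp (-M) := by rw [← exp_nat_mul]; ring_nf
  have heM' : exp (-M) ≤ 1 / 9000000 := heM.trans hM9
  have h1 : (3 * ε ^ 2 * exp (-(M / 2))) ^ 2 ≤ 1 / 9000000 := by
    have e1 : (3 * ε ^ 2 * exp (-(M / 2))) ^ 2 = 9 * (ε ^ 2) ^ 2 * exp (-M) := by
      rw [mul_pow, mul_pow, hex]; ring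
    have e2 : (ε ^ 2) ^ 2 ≤ ε ^ 2 * (1 / 100000) := by
      rw [sq]; exact mul_le_mul_of_nonneg_left hε2 (sq_nonneg ε)
    have e3 : 9 * (ε ^ 2) ^ 2 * exp (-M) ≤ 9 * (ε ^ 2) ^ 2 * 1 :=
      mul_le_mul_of_nonneg_left (by linarith) (by positivity)
    rw [e1]; linarith
  have h2 : (7 * exp (-(M / 2))) ^ 2 ≤ 49 / 9000000 := by
    have e7 : (7 : ℝ) ^ 2 = 49 := by norm_num
    rw [mul_pow, hex, e7]; linarith
  have h3 : 4 * ε ^ 2 ≤ 4 / 9000000 := by linarith [hε2e.trans heM']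
  have hs11 : ε ^ 2 * exp (-M) ≤ 1 / 100000 * (1 / 1000000) :=
    mul_le_mul hε2 hexpM (exp_pos _).le (by norm_num)
  linarith

omit hY hR in
/-- **The Gaussian exponent and offset of the clock majorant**: with `ν = 7δ₀ + 32δ`,
`λ⁺ = ε⁻¹M(ε(1+ν)+δ)/2` satisfies `M/2 ≤ λ⁺ ≤ (M/2)(1 + 1/400000)` and `τ₀ = ε⁻¹Mδ₀ ≤ 10⁻⁷`
(`ν ≤ 2ε²e^{-M}`, `δ/ε ≤ εe^{-M}/16`, `Mε e^{-M} ≤ 4ε/M`, `ε ≤ 1/3000`). [cite: Tao2016AveragedNS, §5.5] -/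
theorem gauss_consts_w (hB : WideBudget M ε δ δ₀) :
    M / 2 ≤ ε⁻¹ * M * (ε * (1 + 7 * δ₀ + 32 * δ) + δ) / 2 ∧
      ε⁻¹ * M * (ε * (1 + 7 * δ₀ + 32 * δ) + δ) / 2 ≤ M / 2 * (1 + 1 / 400000) ∧
      ε⁻¹ * M * δ₀ ≤ 1 / 10000000 := by
  obtain ⟨hM6000, hε1, hε2, hexpM, hMe, -, hMse, -, -⟩ := ignition_params hK hML hMK hε hεle
  obtain ⟨hε2e, heM, hM9, -⟩ := NegKick.negKick_params_fine hK hML hMK hε hεle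
  obtain ⟨hδ₀, hδ, hη8, hδ₀1, h732, hs1⟩ := budget_facts_w hV hT hK hML hMK hε hεle h0 hB
  have hM0 : 0 < M := by linarith
  have hε3000 : ε ≤ 1 / 3000 :=
    le_of_pow_le_pow_left₀ two_ne_zero (by norm_num) ((hε2e.trans (heM.trans hM9)).trans (by norm_num))
  have hsplit : ε⁻¹ * M * (ε * (1 + 7 * δ₀ + 32 * δ) + δ) / 2 =
      M / 2 + M / 2 * (7 * δ₀ + 32 * δ) + ε⁻¹ * M * δ / 2 := by
    field_simp; ring
  refine ⟨?_, ?_, ?_⟩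
  · rw [hsplit]
    have h1 : 0 ≤ M / 2 * (7 * δ₀ + 32 * δ) := by positivity
    have h2 : 0 ≤ ε⁻¹ * M * δ / 2 := by positivity
    linarith
  · rw [hsplit]
    have hs11 : ε ^ 2 * exp (-M) ≤ 1 / 100000 * (1 / 1000000) :=
      mul_le_mul hε2 hexpM (exp_pos _).le (by norm_num)
    have h1 : M / 2 * (7 * δ₀ + 32 * δ) ≤ M / 2 * (1 / 1000000) :=
      mul_le_mul_of_nonneg_left (by linarith) (by positivity)
    -- ε⁻¹Mδ ≤ ε⁻¹M·ε²e^{-M} = (M/2)·(2εe^{-M})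
    have h2 : ε⁻¹ * M * δ ≤ ε⁻¹ * M * (ε ^ 2 * exp (-M)) :=
      mul_le_mul_of_nonneg_left (by linarith) (by positivity)
    have h3 : ε⁻¹ * M * (ε ^ 2 * exp (-M)) = M / 2 * (2 * (ε * exp (-M))) := by
      field_simp
    have h4 : 2 * (ε * exp (-M)) ≤ 1 / 1000000 := by
      have : ε * exp (-M) ≤ 1 / 3000 * (1 / 9000000) :=
        mul_le_mul hε3000 (heM.trans hM9) (exp_pos _).le (by norm_num)
      linarith
    have h5 : M / 2 * (2 * (ε * exp (-M))) ≤ M / 2 * (1 / 1000000) :=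
      mul_le_mul_of_nonneg_left h4 (by positivity)
    linarith [h1, h2, h3, h5]
  · -- ε⁻¹Mδ₀ ≤ ε⁻¹M·ε²e^{-M}/8 = Mεe^{-M}/8 ≤ M ε (4/M²)/8 = ε/(2M) ≤ 10⁻⁷
    have h1 : ε⁻¹ * M * δ₀ ≤ ε⁻¹ * M * (ε ^ 2 * exp (-M) / 2) :=
      mul_le_mul_of_nonneg_left (by linarith) (by positivity)
    have h2 : ε⁻¹ * M * (ε ^ 2 * exp (-M) / 2) = M * ε * exp (-M) / 2 := by field_simp
    obtain ⟨hMe6, -, -, -⟩ := wide_params hK hML hMK hε hεle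
    linarith

/-- **The clock on the first unit of time, Gaussian form**: `G(u) ≤ λ⁺u² + τ₀` on `[0,1]`
(`G ≤ G⁺` and `δ₀u ≤ δ₀`). [cite: Tao2016AveragedNS, §5.5] -/
theorem clockInt_le_gauss_w (hB : WideBudget M ε δ δ₀) {u : ℝ} (hu : u ∈ Icc (0 : ℝ) 1) :
    clockInt ε M Y u ≤
      ε⁻¹ * M * (ε * (1 + 7 * δ₀ + 32 * δ) + δ) / 2 * u ^ 2 + ε⁻¹ * M * δ₀ := by
  obtain ⟨hM6000, -, -, -, -, -, -, -, -⟩ := ignition_params hK hML hMK hε hεle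
  obtain ⟨hδ₀, hδ, -, hδ₀1, -, -⟩ := budget_facts_w hV hT hK hML hMK hε hεle h0 hB
  have hM : 0 ≤ M := by linarith
  have hu' : u ∈ Icc (0 : ℝ) (8 / 5) := ⟨hu.1, by linarith [hu.2]⟩
  have h1 := clockInt_le_clockSup hY hV hR hT h0 hδ₀1 hε hM hu'
  have h2 : ε⁻¹ * M * (δ₀ * u) ≤ ε⁻¹ * M * δ₀ := by
    have : δ₀ * u ≤ δ₀ := by nlinarith [hu.2]
    exact mul_le_mul_of_nonneg_left this (by positivity)
  have h3 : clockSup M ε δ δ₀ u = ε⁻¹ * M * (δ₀ * u) +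
      ε⁻¹ * M * (ε * (1 + 7 * δ₀ + 32 * δ) + δ) / 2 * u ^ 2 := by
    unfold clockSup; ring
  linarith

/-- **The trigger equation on `[0,1]`, doubly Gaussian form**: with `s = ε²e^{-M}`, `λ⁺`, `τ₀` as in
SeedScaleSharpIgnition's `gauss_consts_w`,
`D' ≥ s(1 - 2·10⁻⁵)e^{-τ₀}e^{-λ⁺u²} - 1.0032·δ·e^{-0.495Mu²}`: the forcing is discounted by the clock
MINORANT `G ≥ 0.495Mu² - 1/320` (`clockInt_ge_unit_w`), not merely by `G ≥ -1/100`.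
[cite: Tao2016AveragedNS, §5.5 proof of Theorem 5.3] -/
theorem disc_deriv_ge_gaussW_w (hB : WideBudget M ε δ δ₀) {u : ℝ} (hu : u ∈ Icc (0 : ℝ) 1) :
    ε ^ 2 * exp (-M) * (1 - 1 / 50000) * exp (-(ε⁻¹ * M * δ₀)) *
          exp (-(ε⁻¹ * M * (ε * (1 + 7 * δ₀ + 32 * δ) + δ) / 2) * u ^ 2) -
        10032 / 10000 * δ * exp (-(99 / 200 * M) * u ^ 2) ≤
      (V u 2 - ε⁻¹ * M * Y u 1 * Y u 2) * exp (-clockInt ε M Y u) := by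
  obtain ⟨hM6000, -, -, -, -, -, -, -, -⟩ := ignition_params hK hML hMK hε hεle
  obtain ⟨hδ₀, hδ, -, -, -, -⟩ := budget_facts_w hV hT hK hML hMK hε hεle h0 hB
  have hu' : u ∈ Icc (0 : ℝ) (8 / 5) := ⟨hu.1, by linarith [hu.2]⟩
  have h1 := disc_deriv_geA hV hT hu' (K := K)
  have ha := a_sq_ge_unit_fine_w hY hV hR hT hK hML hMK hε hεle h0 hB hu
  have hGle := clockInt_le_gauss_w hY hV hR hT hK hML hMK hε hεle h0 hB hu
  have hGge := clockInt_ge_unit_w hY hV hR hT hK hML hMK hε hεle h0 hB hu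
  have he := DefectWeight.exp_inv_le
  obtain ⟨l, hl⟩ : ∃ l : ℝ, l = ε⁻¹ * M * (ε * (1 + 7 * δ₀ + 32 * δ) + δ) / 2 := ⟨_, rfl⟩
  obtain ⟨τ₀, hτ₀⟩ : ∃ τ₀ : ℝ, τ₀ = ε⁻¹ * M * δ₀ := ⟨_, rfl⟩
  obtain ⟨s, hs⟩ : ∃ s : ℝ, s = ε ^ 2 * exp (-M) := ⟨_, rfl⟩
  rw [← hl, ← hτ₀] at hGle ⊢
  rw [← hs] at h1 ⊢
  have hs0 : 0 < s := by rw [hs]; positivity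
  have h2 : exp (-τ₀) * exp (-l * u ^ 2) ≤ exp (-clockInt ε M Y u) := by
    rw [← exp_add]; exact exp_le_exp.2 (by linarith)
  have h3 : s * (1 - 1 / 50000) * exp (-τ₀) * exp (-l * u ^ 2) ≤
      s * Y u 0 ^ 2 * exp (-clockInt ε M Y u) :=
    calc s * (1 - 1 / 50000) * exp (-τ₀) * exp (-l * u ^ 2)
        = s * (1 - 1 / 50000) * (exp (-τ₀) * exp (-l * u ^ 2)) := by ring
      _ ≤ s * Y u 0 ^ 2 * exp (-clockInt ε M Y u) :=
          mul_le_mul (mul_le_mul_of_nonneg_left ha hs0.le) h2 (by positivity) (by positivity)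
  have h4 : δ * exp (-clockInt ε M Y u) ≤ 10032 / 10000 * δ * exp (-(99 / 200 * M) * u ^ 2) := by
    have h5 : exp (-clockInt ε M Y u) ≤ exp (1 / 320) * exp (-(99 / 200 * M) * u ^ 2) := by
      rw [← exp_add]; exact exp_le_exp.2 (by linarith)
    have h6 : exp (1 / 320) * exp (-(99 / 200 * M) * u ^ 2) ≤
        10032 / 10000 * exp (-(99 / 200 * M) * u ^ 2) :=
      mul_le_mul_of_nonneg_right he (exp_pos _).le
    have h7 := mul_le_mul_of_nonneg_left (h5.trans h6) hδ
    linarith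
  have h5 : (s * Y u 0 ^ 2 - δ) * exp (-clockInt ε M Y u) =
      s * Y u 0 ^ 2 * exp (-clockInt ε M Y u) - δ * exp (-clockInt ε M Y u) := by ring
  linarith

/-- **The weighted Gaussian-window deposit, integral form**:
`D(1) ≥ -δ₀ - 1.0032·δ·∫₀¹e^{-0.495Mr²}dr + s(1 - 2·10⁻⁵)e^{-τ₀}∫₀¹e^{-λ⁺r²}dr`.
[cite: Tao2016AveragedNS, §5.5 proof of Theorem 5.3] -/
theorem disc_one_ge_integralW_w (hB : WideBudget M ε δ δ₀) :
    -δ₀ - 10032 / 10000 * δ * (∫ r in (0 : ℝ)..1, exp (-(99 / 200 * M) * r ^ 2)) +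
        ε ^ 2 * exp (-M) * (1 - 1 / 50000) * exp (-(ε⁻¹ * M * δ₀)) *
          ∫ r in (0 : ℝ)..1, exp (-(ε⁻¹ * M * (ε * (1 + 7 * δ₀ + 32 * δ) + δ) / 2) * r ^ 2) ≤
      Y 1 2 * exp (-clockInt ε M Y 1) := by
  obtain ⟨l, hl⟩ : ∃ l : ℝ, l = ε⁻¹ * M * (ε * (1 + 7 * δ₀ + 32 * δ) + δ) / 2 := ⟨_, rfl⟩
  obtain ⟨A, hA⟩ : ∃ A : ℝ, A = ε ^ 2 * exp (-M) * (1 - 1 / 50000) * exp (-(ε⁻¹ * M * δ₀)) :=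
    ⟨_, rfl⟩
  obtain ⟨k, hk⟩ : ∃ k : ℝ, k = 10032 / 10000 * δ := ⟨_, rfl⟩
  rw [← hl, ← hA, ← hk]
  have hcont : Continuous fun r : ℝ => exp (-l * r ^ 2) := by fun_prop
  have hcont2 : Continuous fun r : ℝ => exp (-(99 / 200 * M) * r ^ 2) := by fun_prop
  have hmono := Thm53.monotoneOn_sub_of_le_deriv (s := Icc (0 : ℝ) 1)
    (f := fun u => Y u 2 * exp (-clockInt ε M Y u))
    (φ := fun u => A * exp (-l * u ^ 2) - k * exp (-(99 / 200 * M) * u ^ 2))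
    (Φ := fun u => A * (∫ r in (0 : ℝ)..u, exp (-l * r ^ 2)) -
      k * (∫ r in (0 : ℝ)..u, exp (-(99 / 200 * M) * r ^ 2)))
    (convex_Icc 0 1) (fun u _ => hasDerivAt_discA hY u)
    (fun u _ => ((((hcont.integral_hasStrictDerivAt 0 u).hasDerivAt).const_mul A).sub
      (((hcont2.integral_hasStrictDerivAt 0 u).hasDerivAt).const_mul k)).congr_deriv (by ring))
    (fun u hu => by
      show A * exp (-l * u ^ 2) - k * exp (-(99 / 200 * M) * u ^ 2) ≤ _
      have h := disc_deriv_ge_gaussW_w hY hV hR hT hK hML hMK hε hεle h0 hB hu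
      rw [← hl, ← hA, ← hk] at h
      exact h)
  have h := hmono (left_mem_Icc.2 zero_le_one) (right_mem_Icc.2 zero_le_one) zero_le_one
  simp only [clockInt_zero, neg_zero, exp_zero, mul_one, intervalIntegral.integral_same,
    mul_zero, sub_zero] at h
  have hc0 := (abs_le.1 (abs_init_coord_le h0).2.1).1
  linarith

/-- **The weighted Gaussian-window deposit.** `D(1) ≥ -δ₀ - 1.265·δ/√M + 1.253274·ε²e^{-M}/√M`
(`∫₀¹e^{-λ⁺r²} ≥ 1.2533/√M` as in `disc_one_ge`; `1.0032·∫₀¹e^{-0.495Mr²} ≤ 1.0032·1.26/√M`).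
[cite: Tao2016AveragedNS, §5.5 proof of Theorem 5.3] -/
theorem disc_one_geW_w (hB : WideBudget M ε δ δ₀) :
    -δ₀ - 1265 / 1000 * δ / Real.sqrt M + 1253274 / 1000000 * (ε ^ 2 * exp (-M)) / Real.sqrt M ≤
      Y 1 2 * exp (-clockInt ε M Y 1) := by
  obtain ⟨hM6000, -, -, -, -, -, -, h77, -⟩ := ignition_params hK hML hMK hε hεle
  obtain ⟨hδ₀, hδ, -, -, -, -⟩ := budget_facts_w hV hT hK hML hMK hε hεle h0 hB
  obtain ⟨hl1, hl2, hτ⟩ := gauss_consts_w hV hT hK hML hMK hε hεle h0 hB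
  have hraw := disc_one_ge_integralW_w hY hV hR hT hK hML hMK hε hεle h0 hB
  obtain ⟨l, hl⟩ : ∃ l : ℝ, l = ε⁻¹ * M * (ε * (1 + 7 * δ₀ + 32 * δ) + δ) / 2 := ⟨_, rfl⟩
  obtain ⟨τ₀, hτ₀⟩ : ∃ τ₀ : ℝ, τ₀ = ε⁻¹ * M * δ₀ := ⟨_, rfl⟩
  obtain ⟨s, hs⟩ : ∃ s : ℝ, s = ε ^ 2 * exp (-M) := ⟨_, rfl⟩
  rw [← hl] at hl1 hl2 hraw
  rw [← hτ₀] at hτ hraw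
  rw [← hs] at hraw ⊢
  have hs0 : 0 < s := by rw [hs]; positivity
  have hM0 : 0 < M := by linarith
  have hsq0 : 0 < Real.sqrt M := by linarith
  have hW := window_mass_ge_of hM6000 hl1 hl2
  have heτ : 1 - 1 / 10000000 ≤ exp (-τ₀) := by
    have h := add_one_le_exp (-τ₀)
    linarith
  have hAW : 1253274 / 1000000 * s / Real.sqrt M ≤
      s * (1 - 1 / 50000) * exp (-τ₀) * ∫ r in (0 : ℝ)..1, exp (-l * r ^ 2) := by
    have h1 : s * (1 - 1 / 50000) * (1 - 1 / 10000000) ≤ s * (1 - 1 / 50000) * exp (-τ₀) :=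
      mul_le_mul_of_nonneg_left heτ (by positivity)
    have h2 : s * (1 - 1 / 50000) * (1 - 1 / 10000000) * (12533 / 10000 / Real.sqrt M) ≤
        s * (1 - 1 / 50000) * exp (-τ₀) * ∫ r in (0 : ℝ)..1, exp (-l * r ^ 2) :=
      mul_le_mul h1 hW (by positivity) (by positivity)
    have h3 : 1253274 / 1000000 * s / Real.sqrt M ≤
        s * (1 - 1 / 50000) * (1 - 1 / 10000000) * (12533 / 10000 / Real.sqrt M) := by
      rw [show s * (1 - 1 / 50000) * (1 - 1 / 10000000) * (12533 / 10000 / Real.sqrt M) =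
        (1 - 1 / 50000) * (1 - 1 / 10000000) * (12533 / 10000) * s / Real.sqrt M by ring]
      have hnum : (1253274 / 1000000 : ℝ) ≤
          (1 - 1 / 50000) * (1 - 1 / 10000000) * (12533 / 10000) := by norm_num
      exact div_le_div_of_nonneg_right (mul_le_mul_of_nonneg_right hnum hs0.le) hsq0.le
    exact h3.trans h2
  -- the forcing weight
  have hU := DefectWeight.window_le hM0
  have hkU : 10032 / 10000 * δ * (∫ r in (0 : ℝ)..1, exp (-(99 / 200 * M) * r ^ 2)) ≤
      10032 / 10000 * δ * (126 / 100 / Real.sqrt M) :=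
    mul_le_mul_of_nonneg_left hU (by positivity)
  have hkU' : 10032 / 10000 * δ * (126 / 100 / Real.sqrt M) ≤ 1265 / 1000 * δ / Real.sqrt M := by
    rw [show 10032 / 10000 * δ * (126 / 100 / Real.sqrt M) =
      10032 / 10000 * (126 / 100) * δ / Real.sqrt M by ring]
    exact div_le_div_of_nonneg_right (mul_le_mul_of_nonneg_right (by norm_num) hδ) hsq0.le
  linarith

omit hR in
/-- **Weighted persistence of the discounted trigger after time `1`**: if `G ≥ 0.495M - 1/320` on
`[1, τ]` (`τ ≤ 8/5`), then `D(t) ≥ D(1) - δe^{-(0.495M - 1/320)}(t - 1)` for `t ∈ [1, τ]`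
(`D' ≥ -δe^{-G}`). [cite: Tao2016AveragedNS, §5.5] -/
theorem disc_persistW_w (hB : WideBudget M ε δ δ₀) {τ : ℝ} (hτ : τ ≤ 8 / 5)
    (hG : ∀ u ∈ Icc (1 : ℝ) τ, 99 / 200 * M - 1 / 320 ≤ clockInt ε M Y u) {t : ℝ}
    (ht : t ∈ Icc (1 : ℝ) τ) :
    Y 1 2 * exp (-clockInt ε M Y 1) - δ * exp (-(99 / 200 * M - 1 / 320)) * (t - 1) ≤
      Y t 2 * exp (-clockInt ε M Y t) := by
  obtain ⟨hδ₀, hδ, -, -, -, -⟩ := budget_facts_w hV hT hK hML hMK hε hεle h0 hB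
  obtain ⟨k, hk⟩ : ∃ k : ℝ, k = δ * exp (-(99 / 200 * M - 1 / 320)) := ⟨_, rfl⟩
  rw [← hk]
  have hmono := Thm53.monotoneOn_sub_of_le_deriv (s := Icc (1 : ℝ) τ)
    (f := fun s => Y s 2 * exp (-clockInt ε M Y s)) (φ := fun _ => -k)
    (Φ := fun u => -k * u) (convex_Icc 1 τ) (fun u _ => hasDerivAt_discA hY u)
    (fun u _ => by simpa using (hasDerivAt_id u).const_mul (-k))
    (fun u hu => by
      have hu' : u ∈ Icc (0 : ℝ) (8 / 5) := ⟨by linarith [hu.1], hu.2.trans hτ⟩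
      have h1 := disc_deriv_geA hV hT hu' (K := K)
      have h2 : exp (-clockInt ε M Y u) ≤ exp (-(99 / 200 * M - 1 / 320)) :=
        exp_le_exp.2 (by linarith [hG u hu])
      have h3 : 0 ≤ ε ^ 2 * exp (-M) * Y u 0 ^ 2 * exp (-clockInt ε M Y u) := by positivity
      have h4 : δ * exp (-clockInt ε M Y u) ≤ k := by
        rw [hk]; exact mul_le_mul_of_nonneg_left h2 hδ
      have h5 : (ε ^ 2 * exp (-M) * Y u 0 ^ 2 - δ) * exp (-clockInt ε M Y u) =
          ε ^ 2 * exp (-M) * Y u 0 ^ 2 * exp (-clockInt ε M Y u) -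
            δ * exp (-clockInt ε M Y u) := by ring
      show -k ≤ _
      linarith)
  have h := hmono ⟨le_rfl, ht.1.trans ht.2⟩ ht ht.1
  simp only at h
  linarith

/-- After time `1` the clock integral does not decrease while `|c| ≤ ε²` (`b ≥ (49/50)ε > 0` there,
`b_ge_late_of_smallH_w`), so `G ≥ G(1) ≥ 0.495M - 1/320` on `[1, τ]`.
[cite: Tao2016AveragedNS, §5.5] -/
theorem clockInt_ge_late_of_smallH_w (hB : WideBudget M ε δ δ₀) {τ : ℝ} (hτ : τ ≤ 8 / 5)
    (hc : ∀ t ∈ Icc (0 : ℝ) τ, |Y t 2| ≤ ε ^ 2) {u : ℝ} (hu : u ∈ Icc (1 : ℝ) τ) :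
    99 / 200 * M - 1 / 320 ≤ clockInt ε M Y u := by
  obtain ⟨hM6000, -, -, -, -, -, -, -, -⟩ := ignition_params hK hML hMK hε hεle
  have hM : 0 ≤ M := by linarith
  have hG1 := clockInt_ge_unit_w hY hV hR hT hK hML hMK hε hεle h0 hB (u := 1)
    ⟨zero_le_one, le_rfl⟩
  have hmono := Thm53.monotoneOn_sub_of_le_deriv (s := Icc (1 : ℝ) τ) (f := clockInt ε M Y)
    (φ := fun _ => (0 : ℝ)) (Φ := fun _ => (0 : ℝ)) (convex_Icc 1 τ)
    (fun t _ => hasDerivAt_clockIntA hY t) (fun t _ => hasDerivAt_const t (0 : ℝ))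
    (fun t ht => by
      have hb := b_ge_late_of_smallH_w hY hV hR hT hK hML hMK hε hεle h0 hB hτ hc ht
      have hb0 : 0 ≤ Y t 1 := by nlinarith
      show (0 : ℝ) ≤ ε⁻¹ * M * Y t 1
      exact mul_nonneg (mul_nonneg (inv_nonneg.2 hε.le) hM) hb0)
  have h := hmono ⟨le_rfl, hu.1.trans hu.2⟩ hu hu.1
  simp only [sub_zero] at h
  norm_num at hG1
  linarith


end Wide

section Weighted

variable (hK : 2 * 20 ^ 42 * (Nat.factorial 42 : ℝ) + 16 ≤ K) (hML : 3000 * Real.log K ≤ M)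
  (hMK : M ≤ K ^ 10) (hε : 0 < ε) (hεle : ε ≤ exp (-(10 * M)) / K ^ 100)
  (h0 : ‖Y 0 - delayInit‖ ≤ δ₀)
include hK hML hMK hε hεle h0

/-- If `|c| ≤ ε²` on `[0, τ]` (`τ ≤ 8/5`), the discounted trigger keeps the residue
`D(t) ≥ ε²e^{-M}/(16000√M)` — hence `c(t) > 0` — for `t ∈ [1, τ]` under the WEIGHTED budget
ALONE (`D(1) ≥ -δ₀ - 1.265δ/√M + 1.253274u`, late loss `≤ 0.005δ/√M`, and `δ₀ + 1.27δ/√M ≤ 1.2532u`;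
the weighted budget implies the wide budget, `wideBudget_of_weighted'`). Compare
`residue_of_smallH_W` (which assumed `δ₀ + 2δ ≤ ε²e^{-M}/8` in addition).
[cite: Tao2016AveragedNS, §5.5] -/
theorem residue_of_smallH_W_w (hW : δ₀ + 127 / 100 * δ / Real.sqrt M ≤ 3133 / 2500 * (ε ^ 2 * exp (-M)) / Real.sqrt M)
    {τ : ℝ} (hτ : τ ≤ 8 / 5)
    (hc : ∀ t ∈ Icc (0 : ℝ) τ, |Y t 2| ≤ ε ^ 2) {t : ℝ} (ht : t ∈ Icc (1 : ℝ) τ) :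
    ε ^ 2 * exp (-M) / (16000 * Real.sqrt M) ≤ Y t 2 * exp (-clockInt ε M Y t) ∧ 0 < Y t 2 := by
  obtain ⟨hM6000, hε1, hε2, hexpM, hMe, hMe2, hMse, h77, hsM⟩ := ignition_params hK hML hMK hε hεle
  have hB : WideBudget M ε δ δ₀ :=
    wideBudget_of_weighted' h77 ((norm_nonneg _).trans h0) (defect_nonneg hV hT) hW
  obtain ⟨hδ₀, hδ, -, -, -, -⟩ := budget_facts_w hV hT hK hML hMK hε hεle h0 hB
  have hsq0 : 0 < Real.sqrt M := by linarith
  have hwin := disc_one_geW_w hY hV hR hT hK hML hMK hε hεle h0 hB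
  have hGl : ∀ u ∈ Icc (1 : ℝ) τ, 99 / 200 * M - 1 / 320 ≤ clockInt ε M Y u := fun u hu =>
    clockInt_ge_late_of_smallH_w hY hV hR hT hK hML hMK hε hεle h0 hB hτ hc hu
  have hp := disc_persistW_w hY hV hT hK hML hMK hε hεle h0 hB hτ hGl ht
  have hlate := DefectWeight.late_le hM6000 hsM
  have ht1 : t - 1 ≤ 3 / 5 := by linarith [ht.2]
  have h1 : δ * exp (-(99 / 200 * M - 1 / 320)) * (t - 1) ≤
      δ * exp (-(99 / 200 * M - 1 / 320)) * (3 / 5) :=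
    mul_le_mul_of_nonneg_left ht1 (mul_nonneg hδ (exp_pos _).le)
  have h2 : δ * exp (-(99 / 200 * M - 1 / 320)) * (3 / 5) ≤ δ * (5 / 1000 / Real.sqrt M) := by
    rw [show δ * exp (-(99 / 200 * M - 1 / 320)) * (3 / 5) =
      δ * (3 / 5 * exp (-(99 / 200 * M - 1 / 320))) by ring]
    exact mul_le_mul_of_nonneg_left hlate hδ
  have h3 : δ * (5 / 1000 / Real.sqrt M) = 5 / 1000 * δ / Real.sqrt M := by ring
  have h4 : 1265 / 1000 * δ / Real.sqrt M + 5 / 1000 * δ / Real.sqrt M =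
      127 / 100 * δ / Real.sqrt M := by ring
  have h5 : ε ^ 2 * exp (-M) / (16000 * Real.sqrt M) =
      1253274 / 1000000 * (ε ^ 2 * exp (-M)) / Real.sqrt M -
        12532115 / 10000000 * (ε ^ 2 * exp (-M)) / Real.sqrt M := by
    field_simp; ring
  have h6 : 3133 / 2500 * (ε ^ 2 * exp (-M)) / Real.sqrt M ≤
      12532115 / 10000000 * (ε ^ 2 * exp (-M)) / Real.sqrt M :=
    div_le_div_of_nonneg_right (by nlinarith [mul_pos (pow_pos hε 2) (exp_pos (-M))]) hsq0.le
  have hD : ε ^ 2 * exp (-M) / (16000 * Real.sqrt M) ≤ Y t 2 * exp (-clockInt ε M Y t) := by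
    rw [h5]; linarith
  refine ⟨hD, ?_⟩
  have hp0 : 0 < ε ^ 2 * exp (-M) / (16000 * Real.sqrt M) := by positivity
  by_contra hle
  have : Y t 2 * exp (-clockInt ε M Y t) ≤ 0 :=
    mul_nonpos_of_nonpos_of_nonneg (le_of_not_gt hle) (exp_pos _).le
  linarith

/-- **Weighted ignition on the whole half-plane.** Under the weighted budget
`δ₀ + 1.27δ/√M ≤ 1.2532u` ALONE the trigger exceeds `ε²` in absolute value somewhere on `[0, 8/5]`
(else `c(8/5) = D(8/5)e^{G(8/5)} ≥ u/16000·(2M/75)³ > 3ε²`). Compare `ignites_W` (which assumed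
`δ₀ + 2δ ≤ ε²e^{-M}/8` in addition). [cite: Tao2016AveragedNS, §5.5 Theorem 5.3] -/
theorem ignites_W_w (hW : δ₀ + 127 / 100 * δ / Real.sqrt M ≤ 3133 / 2500 * (ε ^ 2 * exp (-M)) / Real.sqrt M) :
    ∃ t ∈ Icc (0 : ℝ) (8 / 5), ε ^ 2 < |Y t 2| := by
  obtain ⟨hM6000, hε1, hε2, hexpM, hMe, hMe2, hMse, h77, hsM⟩ := ignition_params hK hML hMK hε hεle
  have hB : WideBudget M ε δ δ₀ :=
    wideBudget_of_weighted' h77 ((norm_nonneg _).trans h0) (defect_nonneg hV hT) hW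
  have hM0 : 0 < M := by linarith
  have hsq0 : 0 < Real.sqrt M := by linarith
  by_contra hcon
  simp only [not_exists, not_and, not_lt] at hcon
  have hc : ∀ t ∈ Icc (0 : ℝ) (8 / 5), |Y t 2| ≤ ε ^ 2 := fun t ht => hcon t ht
  have hD := (residue_of_smallH_W_w hY hV hR hT hK hML hMK hε hεle h0 hW (τ := 8 / 5) le_rfl hc
    (t := 8 / 5) ⟨by norm_num, le_rfl⟩).1
  have hG := clockInt_late_of_small_w hY hV hR hT hK hML hMK hε hεle h0 hB hc
  -- e^{G(8/5) - M} ≥ (2M/75)³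
  obtain ⟨x, hx⟩ : ∃ x : ℝ, x = clockInt ε M Y (8 / 5) - M := ⟨_, rfl⟩
  have hx1 : 2 * M / 25 ≤ x := by rw [hx]; linarith
  have hx0 : 0 ≤ x := by linarith
  have hEG : (2 * M / 75) ^ 3 ≤ exp x := by
    have h1 : exp x = exp (x / 3) ^ 3 := by rw [← exp_nat_mul]; ring_nf
    rw [h1]
    calc (2 * M / 75) ^ 3 ≤ (x / 3 + 1) ^ 3 := pow_le_pow_left₀ (by positivity) (by linarith) 3
      _ ≤ exp (x / 3) ^ 3 := pow_le_pow_left₀ (by positivity) (add_one_le_exp (x / 3)) 3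
  -- c(8/5) = D(8/5)·e^{G(8/5)}
  have hc85 : ε ^ 2 * exp (-M) / (16000 * Real.sqrt M) * exp (clockInt ε M Y (8 / 5)) ≤
      Y (8 / 5) 2 := by
    have h1 : Y (8 / 5) 2 = (Y (8 / 5) 2 * exp (-clockInt ε M Y (8 / 5))) *
        exp (clockInt ε M Y (8 / 5)) := by rw [mul_assoc, ← exp_add]; simp
    rw [h1]
    exact mul_le_mul_of_nonneg_right hD (exp_pos _).le
  have hkey : ε ^ 2 < ε ^ 2 * exp (-M) / (16000 * Real.sqrt M) * exp (clockInt ε M Y (8 / 5)) := by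
    have h1 : ε ^ 2 * exp (-M) / (16000 * Real.sqrt M) * exp (clockInt ε M Y (8 / 5)) =
        ε ^ 2 / (16000 * Real.sqrt M) * exp x := by
      rw [hx, exp_sub, exp_neg]; field_simp
    rw [h1]
    have h2 : ε ^ 2 / (16000 * Real.sqrt M) * (2 * M / 75) ^ 3 ≤
        ε ^ 2 / (16000 * Real.sqrt M) * exp x :=
      mul_le_mul_of_nonneg_left hEG (by positivity)
    have hMs : M / Real.sqrt M = Real.sqrt M := Real.div_sqrt
    have h3 : ε ^ 2 / (16000 * Real.sqrt M) * (2 * M / 75) ^ 3 =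
        8 / (16000 * 421875) * ε ^ 2 * M ^ 2 * (M / Real.sqrt M) := by
      field_simp; ring
    rw [hMs] at h3
    have h4 : (36000000 : ℝ) ≤ M ^ 2 := by nlinarith
    have h5 : (36000000 : ℝ) * 77 ≤ M ^ 2 * Real.sqrt M := mul_le_mul h4 h77 (by norm_num) (by positivity)
    have h6 : ε ^ 2 < 8 / (16000 * 421875) * ε ^ 2 * M ^ 2 * Real.sqrt M := by
      have h61 : (1 : ℝ) < 8 / (16000 * 421875) * (M ^ 2 * Real.sqrt M) := by nlinarith
      have h62 := mul_lt_mul_of_pos_left h61 (pow_pos hε 2)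
      linarith [h62]
    linarith [h2, h3]
  have hlast := hc (8 / 5) ⟨by norm_num, le_rfl⟩
  have habs : Y (8 / 5) 2 ≤ |Y (8 / 5) 2| := le_abs_self _
  linarith

/-- **First hitting time of the trigger level, weighted budget alone.** As
`exists_triggerLevel_hit_W`, without the eighth-budget hypothesis `δ₀ + 2δ ≤ ε²e^{-M}/8` (only
`δ₀ + 1.27δ/√M ≤ 1.2532u`): there is `τ ∈ (1, 8/5]` with `c(τ) = ε²/K¹⁰`,
`|c| < ε²/K¹⁰` on `[0, τ)`, residue `c·e^{-G} ≥ ε²e^{-M}/(16000√M)` and `b ≥ (49/50)ε` on `[1, τ]`,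
and `|b| ≤ 2ε`, `a² ≥ 999/1000`, `|d|, |ã| ≤ 4/K¹⁰` on `[0, τ]`.
[cite: Tao2016AveragedNS, §5.5 Theorem 5.3] -/
theorem exists_triggerLevel_hit_W_w (hW : δ₀ + 127 / 100 * δ / Real.sqrt M ≤ 3133 / 2500 * (ε ^ 2 * exp (-M)) / Real.sqrt M) :
    ∃ τ ∈ Ioc (1 : ℝ) (8 / 5), Y τ 2 = ε ^ 2 / K ^ 10 ∧
      (∀ t ∈ Ico (0 : ℝ) τ, |Y t 2| < ε ^ 2 / K ^ 10) ∧
      (∀ t ∈ Icc (1 : ℝ) τ,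
        ε ^ 2 * exp (-M) / (16000 * Real.sqrt M) ≤ Y t 2 * exp (-clockInt ε M Y t)) ∧
      (∀ t ∈ Icc (1 : ℝ) τ, 49 / 50 * ε ≤ Y t 1) ∧
      (∀ t ∈ Icc (0 : ℝ) τ, |Y t 1| ≤ 2 * ε ∧ 999 / 1000 ≤ Y t 0 ^ 2 ∧
        |Y t 3| ≤ 4 / K ^ 10 ∧ |Y t 4| ≤ 4 / K ^ 10) := by
  obtain ⟨hM6000, hε1, hε2, hexpM, hMe, hMe2, hMse, h77, hsM⟩ := ignition_params hK hML hMK hε hεle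
  have hB : WideBudget M ε δ δ₀ :=
    wideBudget_of_weighted' h77 ((norm_nonneg _).trans h0) (defect_nonneg hV hT) hW
  obtain ⟨hδ₀, hδ, hη8, hδ₀1, h732, hs1⟩ := budget_facts_w hV hT hK hML hMK hε hεle h0 hB
  obtain ⟨hℓ0, hℓε, hℓ3, hsK, hK10⟩ := level_facts hK hML hMK hε hεle
  obtain ⟨ℓ, hℓ⟩ : ∃ ℓ : ℝ, ℓ = ε ^ 2 / K ^ 10 := ⟨_, rfl⟩
  rw [← hℓ] at hℓ0 hℓε hℓ3 ⊢
  -- a window time at which `|c| > ε²`: the weighted ignition theorem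
  obtain ⟨t₀, ht₀, hgt⟩ := ignites_W_w hY hV hR hT hK hML hMK hε hεle h0 hW
  -- the closed set of window times at which `|c| ≥ ℓ`, and its infimum
  obtain ⟨S, hS⟩ : ∃ S : Set ℝ, S = Icc (0 : ℝ) (8 / 5) ∩ {t | ℓ ≤ |Y t 2|} := ⟨_, rfl⟩
  have hne : S.Nonempty := ⟨t₀, by rw [hS]; exact ⟨ht₀, hℓε.trans hgt.le⟩⟩
  have hbdd : BddBelow S := ⟨0, fun t ht => by rw [hS] at ht; exact ht.1.1⟩
  have hcl : IsClosed S := by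
    rw [hS]
    exact isClosed_Icc.inter (isClosed_le continuous_const (continuous_coord hY 2).abs)
  obtain ⟨τ, hτ⟩ : ∃ τ : ℝ, τ = sInf S := ⟨_, rfl⟩
  have hmem : τ ∈ S := by rw [hτ]; exact hcl.csInf_mem hne hbdd
  have hτS : τ ∈ Icc (0 : ℝ) (8 / 5) ∧ ℓ ≤ |Y τ 2| := by rw [hS] at hmem; exact hmem
  have hτ85 : τ ≤ 8 / 5 := hτS.1.2
  have hbefore : ∀ t ∈ Icc (0 : ℝ) (8 / 5), t < τ → |Y t 2| < ℓ := by
    intro t ht htτ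
    by_contra hge
    have htS : t ∈ S := by rw [hS]; exact ⟨ht, le_of_not_gt hge⟩
    have := csInf_le hbdd htS
    rw [← hτ] at this
    linarith
  -- `τ > 1`: on `[0,1]` the trigger is below `3ε²e^{-M/2} < ℓ`
  have hτ1 : 1 < τ := by
    by_contra hle
    have h := abs_c_le_unit_w hY hV hR hT hK hML hMK hε hεle h0 hB ⟨hτS.1.1, le_of_not_gt hle⟩
    linarith [hτS.2]
  -- `|c(τ)| = ℓ` by the intermediate value theorem and minimality
  have hc0 : |Y 0 2| < ℓ := by
    have h := (abs_init_coord_le h0).2.1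
    have : ε ^ 2 * exp (-M) ≤ ε ^ 2 * exp (-(M / 2)) :=
      mul_le_mul_of_nonneg_left (exp_le_exp.2 (by linarith)) (sq_nonneg ε)
    linarith
  have habsτ : |Y τ 2| = ℓ := by
    have hcont : ContinuousOn (fun t => |Y t 2|) (Icc 0 τ) :=
      ((continuous_coord hY 2).abs).continuousOn
    obtain ⟨t, ht, hteq⟩ := intermediate_value_Icc hτS.1.1 hcont ⟨hc0.le, hτS.2⟩
    have htS : t ∈ S := by rw [hS]; exact ⟨⟨ht.1, ht.2.trans hτ85⟩, hteq.ge⟩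
    have hτt : τ ≤ t := by rw [hτ]; exact csInf_le hbdd htS
    have hte : t = τ := le_antisymm ht.2 hτt
    rw [← hte]; exact hteq
  have hcℓ : ∀ t ∈ Icc (0 : ℝ) τ, |Y t 2| ≤ ℓ := fun t ht => by
    rcases eq_or_lt_of_le ht.2 with h | h
    · rw [h, habsτ]
    · exact (hbefore t ⟨ht.1, ht.2.trans hτ85⟩ h).le
  have hcε : ∀ t ∈ Icc (0 : ℝ) τ, |Y t 2| ≤ ε ^ 2 := fun t ht => (hcℓ t ht).trans hℓε
  have hres : ∀ t ∈ Icc (1 : ℝ) τ,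
      ε ^ 2 * exp (-M) / (16000 * Real.sqrt M) ≤ Y t 2 * exp (-clockInt ε M Y t) :=
    fun t ht => (residue_of_smallH_W_w hY hV hR hT hK hML hMK hε hεle h0 hW hτ85 hcε ht).1
  have hpos : ∀ t ∈ Icc (1 : ℝ) τ, 0 < Y t 2 :=
    fun t ht => (residue_of_smallH_W_w hY hV hR hT hK hML hMK hε hεle h0 hW hτ85 hcε ht).2
  -- sign at `τ`
  have hposτ := hpos τ ⟨hτ1.le, le_rfl⟩
  have hceq : Y τ 2 = ℓ := by rw [← habsτ, abs_of_pos hposτ]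
  refine ⟨τ, ⟨hτ1, hτ85⟩, hceq, fun t ht => hbefore t ⟨ht.1, ht.2.le.trans hτ85⟩ ht.2, hres,
    fun t ht => b_ge_late_of_smallH_w hY hV hR hT hK hML hMK hε hεle h0 hB hτ85 hcε ht,
    fun t ht => ?_⟩
  have hb := abs_b_le_of_smallH_w hY hV hR hT hK hML hMK hε hεle h0 hB hτ85 hcε ht
  have hde := de_le_of_abs_c_le hY hV hR hT h0 hε hℓ0.le hτ85 hcℓ ht
  -- `2δ₀ + (2δ + 2ℓ/ε²)t ≤ 4/K¹⁰`
  have hℓK : 2 * ℓ / ε ^ 2 = 2 / K ^ 10 := by rw [hℓ]; field_simp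
  rw [hℓK] at hde
  have hsmall : 2 * δ₀ + (2 * δ + 2 / K ^ 10) * t ≤ 4 / K ^ 10 := by
    have ht85 : t ≤ 8 / 5 := ht.2.trans hτ85
    have h1 : (2 * δ + 2 / K ^ 10) * t ≤ (2 * δ + 2 / K ^ 10) * (8 / 5) :=
      mul_le_mul_of_nonneg_left ht85 (by positivity)
    have h4 : 0 < 1 / K ^ 10 := by
      have h20 : (0 : ℝ) ≤ 2 * 20 ^ 42 * (Nat.factorial 42 : ℝ) := by positivity
      have : 0 < K := by linarith
      positivity
    -- `3ε²e^{-M} ≤ ε²/K¹⁰ ≤ 10⁻⁵/K¹⁰`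
    obtain ⟨-, h3s, -, -⟩ := Ignition.late_facts_w hV hT hK hML hMK hε hεle h0 hB
    have h2 : ε ^ 2 / K ^ 10 = ε ^ 2 * (1 / K ^ 10) := by ring
    have h3 : ε ^ 2 * (1 / K ^ 10) ≤ 1 / 100000 * (1 / K ^ 10) :=
      mul_le_mul_of_nonneg_right hε2 h4.le
    have hw4 : 4 / K ^ 10 = 4 * (1 / K ^ 10) := by ring
    have hw2 : (2 * δ + 2 / K ^ 10) * (8 / 5) = 16 / 5 * δ + 16 / 5 * (1 / K ^ 10) := by ring
    linarith
  have hd : |Y t 3| ≤ 4 / K ^ 10 := hde.1.trans hsmall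
  have he : |Y t 4| ≤ 4 / K ^ 10 := hde.2.trans hsmall
  -- the carrier: `a² = energy - b² - c² - d² - ã² ≥ 1 - 2ε²e^{-M} - 4ε² - ℓ² - 32/K²⁰`
  have ha : 999 / 1000 ≤ Y t 0 ^ 2 := by
    have hE := abs_energy_sub_one_le hY hV hR hT h0 hδ₀1 (t := t) ⟨ht.1, ht.2.trans hτ85⟩
    rw [energy_five] at hE
    have hE1 := (abs_le.1 hE).1
    have hb2 : Y t 1 ^ 2 ≤ (2 * ε) ^ 2 := by
      rw [← sq_abs]; exact pow_le_pow_left₀ (abs_nonneg _) hb 2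
    have hc2 : Y t 2 ^ 2 ≤ (ε ^ 2) ^ 2 := by
      rw [← sq_abs]; exact pow_le_pow_left₀ (abs_nonneg _) (hcε t ht) 2
    have hd2 : Y t 3 ^ 2 ≤ (4 / K ^ 10) ^ 2 := by
      rw [← sq_abs]; exact pow_le_pow_left₀ (abs_nonneg _) hd 2
    have he2 : Y t 4 ^ 2 ≤ (4 / K ^ 10) ^ 2 := by
      rw [← sq_abs]; exact pow_le_pow_left₀ (abs_nonneg _) he 2
    have hw4 : 4 / K ^ 10 = 4 * (1 / K ^ 10) := by ring
    have hK4 : 4 / K ^ 10 ≤ 4 / 1000000000000 := by rw [hw4]; linarith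
    have hK40 : 0 ≤ 4 / K ^ 10 := by
      have h20 : (0 : ℝ) ≤ 2 * 20 ^ 42 * (Nat.factorial 42 : ℝ) := by positivity
      have : 0 < K := by linarith
      positivity
    have hK2 : (4 / K ^ 10) ^ 2 ≤ 4 / K ^ 10 * (4 / 1000000000000) := by
      rw [sq]; exact mul_le_mul_of_nonneg_left hK4 hK40
    have hK3 : 4 / K ^ 10 * (4 / 1000000000000) ≤ 4 / 1000000000000 * (4 / 1000000000000) :=
      mul_le_mul_of_nonneg_right hK4 (by norm_num)
    have hε4 : (ε ^ 2) ^ 2 ≤ ε ^ 2 * (1 / 100000) := by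
      rw [sq]; exact mul_le_mul_of_nonneg_left hε2 (sq_nonneg ε)
    have hε5 : ε ^ 2 * (1 / 100000) ≤ 1 / 100000 * (1 / 100000) :=
      mul_le_mul_of_nonneg_right hε2 (by norm_num)
    have hb3 : (2 * ε) ^ 2 = 4 * ε ^ 2 := by ring
    linarith
  exact ⟨hb, ha, hd, he⟩


end Weighted

end Approx

end IgnitionSharp

/-! ## §3. Theorem 5.3 along approximate trajectories and pseudo-orbits, weighted budget alone -/

section Approx

/-- **The gate fires along every differentiable approximate trajectory under the WEIGHTED budget
ALONE.** For every member `delayCircuitWith K M ε` under the standing hypotheses and every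
differentiable approximate trajectory `Y` (velocity `V`, sup-defect `≤ δ` and sup-norm `≤ 2` on
`[0,T)`, `T ≥ 2`) issued `δ₀`-close to (5.6) with `δ₀ + 1.27·δ/√M ≤ 1.2532·ε²e^{-M}/√M` (no
hypothesis `δ₀ + 2δ ≤ ε²e^{-M}/8`): the trajectory is in the fired state `|ã - 1| ≤ 4K⁻²⁰`,
`|a|, |b|, |c|, |d| ≤ 2K⁻¹⁰` at every `t ∈ [7/4, 2]` (weighted entry state
`exists_triggerLevel_hit_W_w`, then `Ignition.fired_after_w` under the wide budget, which the
weighted budget implies). Compare `approxTrajectory_firedOn_late_W`.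
[cite: Tao2016AveragedNS, §5.5 Theorem 5.3] -/
theorem approxTrajectory_firedOn_late_W_w (K M ε δ δ₀ T : ℝ) (Y V : ℝ → Fin 5 → ℝ)
    (hK : 2 * 20 ^ 42 * (Nat.factorial 42 : ℝ) + 16 ≤ K) (hML : 3000 * Real.log K ≤ M)
    (hMK : M ≤ K ^ 10) (hε : 0 < ε) (hεle : ε ≤ exp (-(10 * M)) / K ^ 100) (hT : 2 ≤ T)
    (hY : ∀ t, HasDerivAt Y (V t) t)
    (hV : ∀ t ∈ Ico 0 T, ‖V t - delayCircuitWith K M ε (Y t)‖ ≤ δ)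
    (hR : ∀ t ∈ Ico 0 T, ‖Y t‖ ≤ 2) (h0 : ‖Y 0 - delayInit‖ ≤ δ₀)
    (hW : δ₀ + 127 / 100 * δ / Real.sqrt M ≤ 3133 / 2500 * (ε ^ 2 * exp (-M)) / Real.sqrt M) :
    FiredOn K Y (Icc (7 / 4) 2) 4 2 := by
  obtain ⟨-, -, -, -, -, -, -, h77, -⟩ := Ignition.ignition_params hK hML hMK hε hεle
  have hB : WideBudget M ε δ δ₀ :=
    wideBudget_of_weighted' h77 ((norm_nonneg _).trans h0) (Ignition.defect_nonneg hV hT) hW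
  obtain ⟨τ, hτ, hcτ, -, -, hblate, -⟩ :=
    IgnitionSharp.exists_triggerLevel_hit_W_w hY hV hR hT hK hML hMK hε hεle h0 hW
  have hbτ : 49 / 50 * ε ≤ Y τ 1 := hblate τ ⟨hτ.1.le, le_rfl⟩
  obtain ⟨-, hon, hd0, hd20⟩ := Ignition.transition_params hK hML hMK hε hεle
  obtain ⟨-, -, -, -, hs20, hKinv, -, -⟩ :=
    Ignition.firing_params_w hV hT hK hML hMK hε hεle h0 hB
  have hK16 := (negKick_params hK hML hMK hε hεle).1
  have hsq0 := (Thm53.invSqrt_facts hK16).1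
  have hfit2 : τ + 130 * Real.log K / M + K⁻¹ + (Real.sqrt K)⁻¹ < 7 / 4 := by linarith [hτ.2]
  -- the open part `[7/4, 2)`: the firing lemma on the late window `[0, t]`
  have hIco : ∀ t ∈ Ico (7 / 4 : ℝ) 2,
      |Y t 4 - 1| ≤ 4 / K ^ 20 ∧ ∀ i : Fin 5, i ≠ 4 → |Y t i| ≤ 2 / K ^ 10 := by
    intro t ht
    exact Ignition.fired_after_w hY hV hR hT (T' := t) (by linarith [ht.2]) ht.2.le hK hML hMK hε
      hεle h0 hτ.1 hcτ hbτ hd0 hon hB (by linarith [ht.1, hsq0]) ⟨by linarith [ht.1], le_rfl⟩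
  intro t ht
  rcases lt_or_eq_of_le ht.2 with h2 | h2
  · exact hIco t ⟨ht.1, h2⟩
  · subst h2
    have h74 : (7 / 4 : ℝ) < 2 := by norm_num
    refine ⟨?_, fun i hi => ?_⟩
    · exact Ignition.le_at_two_of_Ico
        (((Ignition.continuous_coord hY 4).sub continuous_const).abs) h74
        (fun s hs => (hIco s hs).1)
    · exact Ignition.le_at_two_of_Ico ((Ignition.continuous_coord hY i).abs) h74
        (fun s hs => (hIco s hs).2 i hi)
set_option maxHeartbeats 400000 in -- buildfix (bf3-g27): 160k/180k FAIL, 200k PASS at accept time; line-neutral budget line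
/-- **The fired state from the cycle time `2` onwards, WEIGHTED budget alone** (plus `δT ≤ ε²/2`
for the trivial continuation): `|ã - 1| ≤ 6K⁻²⁰` and `|a|, |b|, |c|, |d| ≤ 4K⁻¹⁰` at every
`t ∈ [2, T]` (almost-monotone output, almost-conserved energy, `δ₀ + δT ≤ ε² ≤ K⁻²⁰/40`).
Compare `approxTrajectory_firedOn_from_two_W`. [cite: Tao2016AveragedNS, §5.5 Theorem 5.3] -/
theorem approxTrajectory_firedOn_from_two_W_w (K M ε δ δ₀ T : ℝ) (Y V : ℝ → Fin 5 → ℝ)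
    (hK : 2 * 20 ^ 42 * (Nat.factorial 42 : ℝ) + 16 ≤ K) (hML : 3000 * Real.log K ≤ M)
    (hMK : M ≤ K ^ 10) (hε : 0 < ε) (hεle : ε ≤ exp (-(10 * M)) / K ^ 100) (hT : 2 ≤ T)
    (hY : ∀ t, HasDerivAt Y (V t) t)
    (hV : ∀ t ∈ Ico 0 T, ‖V t - delayCircuitWith K M ε (Y t)‖ ≤ δ)
    (hR : ∀ t ∈ Ico 0 T, ‖Y t‖ ≤ 2) (h0 : ‖Y 0 - delayInit‖ ≤ δ₀)
    (hW : δ₀ + 127 / 100 * δ / Real.sqrt M ≤ 3133 / 2500 * (ε ^ 2 * exp (-M)) / Real.sqrt M)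
    (hδT : δ * T ≤ ε ^ 2 / 2) :
    FiredOn K Y (Icc 2 T) 6 4 := by
  have hδ : 0 ≤ δ := Ignition.defect_nonneg hV hT
  have hδ₀ : 0 ≤ δ₀ := (norm_nonneg _).trans h0
  obtain ⟨hM6000, hε1, -, -, hMε, -, -, h77, -⟩ := Ignition.ignition_params hK hML hMK hε hεle
  have hB : WideBudget M ε δ δ₀ := wideBudget_of_weighted' h77 hδ₀ hδ hW
  obtain ⟨-, -, hη8, hδ₀1, -, -⟩ := Ignition.budget_facts_w hV hT hK hML hMK hε hεle h0 hB
  obtain ⟨hε100, -, -, -, -, -, -, -⟩ := Ignition.firing_params_w hV hT hK hML hMK hε hεle h0 hB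
  obtain ⟨hK16, -, -, -, -, -⟩ := negKick_params hK hML hMK hε hεle
  have hK0 : (0 : ℝ) < K := by linarith
  have hK1 : (1 : ℝ) ≤ K := by linarith
  -- the budget is below `ε²`, and `40ε² ≤ 1/K²⁰`
  have hbud : δ₀ + δ * T ≤ ε ^ 2 := by
    have hexp : exp (-M) ≤ 1 := by rw [exp_le_one_iff]; linarith
    have h1 : ε ^ 2 * exp (-M) ≤ ε ^ 2 * 1 := mul_le_mul_of_nonneg_left hexp (sq_nonneg ε)
    nlinarith [sq_nonneg ε]
  have hK20 : 1 / K ^ 100 ≤ 1 / K ^ 20 :=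
    one_div_le_one_div_of_le (by positivity) (pow_le_pow_right₀ hK1 (by norm_num))
  have h40ε : 40 * ε ^ 2 ≤ 1 / K ^ 20 := by
    have h1 : 40 * ε ≤ 1 := by nlinarith
    have h2 : 40 * ε ^ 2 ≤ ε := by nlinarith
    exact h2.trans (hε100.trans hK20)
  have hε2 : ε ^ 2 ≤ 1 / K ^ 20 := by nlinarith [sq_nonneg ε]
  have hK20s : 1 / K ^ 20 ≤ 1 / 16 :=
    one_div_le_one_div_of_le (by norm_num) (le_trans hK16 (le_self_pow₀ hK1 (by norm_num)))
  have r4 : (4 : ℝ) / K ^ 20 = 4 * (1 / K ^ 20) := by ring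
  have r6 : (6 : ℝ) / K ^ 20 = 6 * (1 / K ^ 20) := by ring
  -- the fired state at `t = 2`
  obtain ⟨he2, hi2⟩ := approxTrajectory_firedOn_late_W_w K M ε δ δ₀ T Y V hK hML hMK hε hεle hT
    hY hV hR h0 hW 2 ⟨by norm_num, le_rfl⟩
  rw [r4] at he2
  -- the bounds on `[2, T)`
  have key : ∀ t ∈ Ico 2 T,
      |Y t 4 - 1| ≤ 6 / K ^ 20 ∧ ∀ i : Fin 5, i ≠ 4 → |Y t i| ≤ 4 / K ^ 10 := by
    intro t ht
    have ht0T : t ∈ Ico 0 T := ⟨by linarith [ht.1], ht.2⟩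
    -- almost-monotone output
    have hmono : Y 2 4 - δ * (t - 2) ≤ Y t 4 :=
      Ignition.e_sub_ge_late hY hV ht.2 hK0.le (by norm_num) ht.1 le_rfl
    have hδt : δ * (t - 2) ≤ ε ^ 2 := by
      have : δ * (t - 2) ≤ δ * T := mul_le_mul_of_nonneg_left (by linarith [ht.2]) hδ
      linarith
    have he_lo : 1 - 4 * (1 / K ^ 20) - ε ^ 2 ≤ Y t 4 := by linarith [(abs_le.1 he2).1]
    -- almost-conserved energy
    have hE := Ignition.abs_energy_sub_le hY hV hR ht0T
    have hE0 := Ignition.abs_energy_init_le h0 hδ₀1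
    have h20 : 20 * δ * t ≤ 20 * (δ * T) := by nlinarith [ht.2]
    have hEt : energy (Y t) ≤ 1 + 20 * ε ^ 2 := by
      linarith [(abs_le.1 hE).2, (abs_le.1 hE0).2]
    have he_sq := Ignition.sq_le_energy (Y t) 4
    have he_hi : Y t 4 - 1 ≤ 20 * ε ^ 2 := by
      by_cases h1 : 1 ≤ Y t 4
      · have hid : (Y t 4 - 1) * (Y t 4 + 1) = Y t 4 ^ 2 - 1 := by ring
        have hprod : (Y t 4 - 1) * (Y t 4 + 1) ≤ 20 * ε ^ 2 := by rw [hid]; linarith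
        calc Y t 4 - 1 = (Y t 4 - 1) * 1 := by ring
          _ ≤ (Y t 4 - 1) * (Y t 4 + 1) := mul_le_mul_of_nonneg_left (by linarith) (by linarith)
          _ ≤ 20 * ε ^ 2 := hprod
      · linarith [sq_nonneg ε]
    refine ⟨?_, fun i hi => ?_⟩
    · rw [r6, abs_le]
      constructor <;> linarith
    · -- the other modes carry at most `energy - ã²`
      have hsum := Ignition.sq_add_sq_le_energy (Y t) hi
      have hμ0 : 0 ≤ 1 - 4 * (1 / K ^ 20) - ε ^ 2 := by linarith
      have hesq : (1 - 4 * (1 / K ^ 20) - ε ^ 2) ^ 2 ≤ Y t 4 ^ 2 := pow_le_pow_left₀ hμ0 he_lo 2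
      have hexp2 : 1 - 2 * (4 * (1 / K ^ 20) + ε ^ 2) ≤ (1 - 4 * (1 / K ^ 20) - ε ^ 2) ^ 2 := by
        nlinarith [sq_nonneg (4 * (1 / K ^ 20) + ε ^ 2)]
      have hsq : Y t i ^ 2 ≤ (4 / K ^ 10) ^ 2 := by
        have r16 : ((4 : ℝ) / K ^ 10) ^ 2 = 16 * (1 / K ^ 20) := by ring
        rw [r16]; linarith
      exact abs_le_of_sq_le_sq hsq (by positivity)
  -- the end point `t = T` by continuity
  intro t ht
  by_cases htT : t < T
  · exact key t ⟨ht.1, htT⟩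
  have htT' : t = T := le_antisymm ht.2 (not_lt.1 htT)
  rcases eq_or_lt_of_le hT with h2T | h2T
  · have ht2 : t = 2 := by rw [htT', ← h2T]
    subst ht2
    refine ⟨?_, fun i hi => (hi2 i hi).trans ?_⟩
    · have hK20pos : (0 : ℝ) ≤ 1 / K ^ 20 := by positivity
      rw [r6]; linarith
    · exact div_le_div_of_nonneg_right (by norm_num) (by positivity)
  · rw [htT']
    refine ⟨?_, fun i hi => ?_⟩
    · exact Ignition.le_at_right_of_Ico (g := fun s => |Y s 4 - 1|)
        (((Ignition.continuous_coord hY 4).sub continuous_const).abs) h2T fun s hs => (key s hs).1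
    · exact Ignition.le_at_right_of_Ico (g := fun s => |Y s i|)
        ((Ignition.continuous_coord hY i).abs) h2T fun s hs => (key s hs).2 i hi

end Approx

section Member

variable {K M ε δ δ₀ T : ℝ} {Y : ℝ → Fin 5 → ℝ}

/-- **Theorem 5.3 along every pseudo-orbit under the WEIGHTED budget alone (open form).** Let `Y`
be a `δ`-pseudo-orbit of a member `delayCircuitWith K M ε` in the sup-ball of radius `2` on `[0,T]`
(`T ≥ 2`), issued `δ₀`-close to (5.6), with `δ₀ + 1.27·δ/√M < 1.2532·ε²e^{-M}/√M` and
`δT < ε²/2` (strict). Then the gate is FIRED on all of `[2,T]`: `|ã - 1| ≤ 6K⁻²⁰` and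
`|a|, |b|, |c|, |d| ≤ 4K⁻¹⁰` (smoothing with slack as in `IsPseudoOrbit.firedOn_from_two_W`, whose
extra hypothesis `δ₀ + 2δ < ε²e^{-M}/8` is gone). For `T = 2` the sup-forcing may thus be as large
as `δ < (3133/3175)·(1 - δ₀/(1.2532u))·ε²e^{-M}` — the whole weighted half-plane, `16·3133/3175 ≈ 15.8`
times the allowance of `IsPseudoOrbit.firedOn_from_two_W` on the defect axis.
[cite: Tao2016AveragedNS, §5.5 Theorem 5.3] -/
theorem IsPseudoOrbit.firedOn_from_two_W_w (hY : IsPseudoOrbit (delayCircuitWith K M ε) δ 2 T Y)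
    (hK : 2 * 20 ^ 42 * (Nat.factorial 42 : ℝ) + 16 ≤ K) (hML : 3000 * Real.log K ≤ M)
    (hMK : M ≤ K ^ 10) (hε : 0 < ε) (hεle : ε ≤ exp (-(10 * M)) / K ^ 100) (hT : 2 ≤ T)
    (h0 : ‖Y 0 - delayInit‖ ≤ δ₀)
    (hW : δ₀ + 127 / 100 * δ / Real.sqrt M < 3133 / 2500 * (ε ^ 2 * exp (-M)) / Real.sqrt M)
    (hδT : δ * T < ε ^ 2 / 2) :
    FiredOn K Y (Icc 2 T) 6 4 := by
  -- parameter facts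
  obtain ⟨-, hε1, hε2, hexpM, -, -, -, h77, -⟩ := Ignition.ignition_params hK hML hMK hε hεle
  have hT0 : 0 < T := by linarith
  have hδ : 0 ≤ δ := by
    obtain ⟨V, -, hV⟩ := hY.defect 0 ⟨le_rfl, hT0⟩
    exact (norm_nonneg _).trans hV
  have hδ₀ : 0 ≤ δ₀ := (norm_nonneg _).trans h0
  have hs0 : 0 < ε ^ 2 * exp (-M) := by positivity
  have hsq0 : (0 : ℝ) < Real.sqrt M := by linarith
  have hWδ₀ : δ₀ ≤ ε ^ 2 * exp (-M) / 60 := (wideBudget_of_weighted h77 hδ₀ hδ hW.le).1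
  have hs8 : ε ^ 2 * exp (-M) / 8 ≤ 1 / 100 := by
    have h2 : ε ^ 2 * exp (-M) ≤ 1 / 100000 * (1 / 1000000) :=
      mul_le_mul hε2 hexpM (exp_pos _).le (by norm_num)
    linarith
  have hε21 : ε ^ 2 / 2 ≤ 1 / 100 := by linarith
  -- WLOG `Y` is globally continuous
  obtain ⟨Yc, hYcc, hYcY, hYc⟩ := hY.exists_continuous hT0.le
  have h0c : ‖Yc 0 - delayInit‖ ≤ δ₀ := by rw [hYcY ⟨le_rfl, hT0.le⟩]; exact h0
  have hR₀ : ∀ t ∈ Icc 0 T, ‖Yc t‖ ≤ 6 / 5 :=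
    hYc.norm_le_six_fifths hδ h0c (by linarith) (by linarith)
  have hF : Continuous (delayCircuitWith K M ε) := continuous_delayCircuitWith K M ε
  -- the slack: a half of the two gaps
  obtain ⟨g₂, hg₂⟩ : ∃ g : ℝ,
      g = (3133 / 2500 * (ε ^ 2 * exp (-M)) / Real.sqrt M - (δ₀ + 127 / 100 * δ / Real.sqrt M)) / 2 :=
    ⟨_, rfl⟩
  obtain ⟨g₃, hg₃⟩ : ∃ g : ℝ, g = (ε ^ 2 / 2 - δ * T) / T := ⟨_, rfl⟩
  have hg₂0 : 0 < g₂ := by rw [hg₂]; exact div_pos (by linarith) (by norm_num)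
  have hg₃0 : 0 < g₃ := by rw [hg₃]; exact div_pos (by linarith) hT0
  obtain ⟨η₀, hη₀⟩ : ∃ η₀ : ℝ, η₀ = min g₂ g₃ := ⟨_, rfl⟩
  have hη₀pos : 0 < η₀ := by rw [hη₀]; exact lt_min hg₂0 hg₃0
  have hη₀2 : η₀ ≤ g₂ := by rw [hη₀]; exact min_le_left _ _
  have hη₀3 : η₀ ≤ g₃ := by rw [hη₀]; exact min_le_right _ _
  intro t ht
  have htT : t ∈ Icc 0 T := ⟨by linarith [ht.1], ht.2⟩
  -- the bounds with an extra `η`, for every `η > 0`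
  have key : ∀ η : ℝ, 0 < η →
      |Yc t 4 - 1| ≤ 6 / K ^ 20 + η ∧ ∀ i : Fin 5, i ≠ 4 → |Yc t i| ≤ 4 / K ^ 10 + η := by
    intro η hη
    obtain ⟨η', hη'⟩ : ∃ η' : ℝ, η' = min η (min η₀ (1 / 2)) := ⟨_, rfl⟩
    have hη'0 : 0 < η' := by rw [hη']; exact lt_min hη (lt_min hη₀pos (by norm_num))
    have hη'η : η' ≤ η := by rw [hη']; exact min_le_left _ _
    have hη'η₀ : η' ≤ η₀ := by rw [hη']; exact (min_le_right _ _).trans (min_le_left _ _)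
    have hη'2 : η' ≤ 1 / 2 := by rw [hη']; exact (min_le_right _ _).trans (min_le_right _ _)
    obtain ⟨Z, W, hZd, hWd, hZn, hZY⟩ := hYc.exists_smooth_approx hF hYcc hT0 hR₀ hη'0
    have hR : ∀ s ∈ Ico 0 T, ‖Z s‖ ≤ 2 := fun s hs =>
      (hZn s ⟨hs.1, hs.2.le⟩).trans (by linarith)
    have h0' : ‖Z 0 - delayInit‖ ≤ δ₀ + η' := by
      calc ‖Z 0 - delayInit‖ = ‖(Z 0 - Yc 0) + (Yc 0 - delayInit)‖ := by rw [sub_add_sub_cancel]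
        _ ≤ ‖Z 0 - Yc 0‖ + ‖Yc 0 - delayInit‖ := norm_add_le _ _
        _ ≤ δ₀ + η' := by linarith [hZY 0 ⟨le_rfl, hT0.le⟩]
    have hW1 : (δ₀ + η') + 127 / 100 * (δ + η') / Real.sqrt M ≤
        3133 / 2500 * (ε ^ 2 * exp (-M)) / Real.sqrt M := by
      have hsplit : 127 / 100 * (δ + η') / Real.sqrt M =
          127 / 100 * δ / Real.sqrt M + 127 / 100 * η' / Real.sqrt M := by ring
      have hsmallw : 127 / 100 * η' / Real.sqrt M ≤ η' := by
        rw [div_le_iff₀ hsq0]; nlinarith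
      have h2 : 2 * g₂ = 3133 / 2500 * (ε ^ 2 * exp (-M)) / Real.sqrt M -
          (δ₀ + 127 / 100 * δ / Real.sqrt M) := by rw [hg₂]; ring
      rw [hsplit]
      linarith
    have hδT1 : (δ + η') * T ≤ ε ^ 2 / 2 := by
      have hTg : η' * T ≤ g₃ * T := mul_le_mul_of_nonneg_right (hη'η₀.trans hη₀3) hT0.le
      have h3 : g₃ * T = ε ^ 2 / 2 - δ * T := by rw [hg₃]; field_simp
      nlinarith
    obtain ⟨he, hi⟩ := approxTrajectory_firedOn_from_two_W_w K M ε (δ + η') (δ₀ + η') T Z W hK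
      hML hMK hε hεle hT hZd hWd hR h0' hW1 hδT1 t ht
    have hcoord : ∀ i, |Z t i - Yc t i| ≤ η' := fun i => by
      have h1 := norm_le_pi_norm (Z t - Yc t) i
      rw [Pi.sub_apply, Real.norm_eq_abs] at h1
      exact h1.trans (hZY t htT)
    refine ⟨?_, fun i hi4 => ?_⟩
    · have h1 := abs_le.1 (hcoord 4)
      have h2 := abs_le.1 he
      rw [abs_le]; constructor <;> linarith
    · have h1 := abs_le.1 (hcoord i)
      have h2 := abs_le.1 (hi i hi4)
      rw [abs_le]; constructor <;> linarith
  rw [← hYcY htT]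
  exact ⟨le_of_forall_pos_le_add fun η hη => (key η hη).1,
    fun i hi => le_of_forall_pos_le_add fun η hη => (key η hη).2 i hi⟩

end Member


/-! ## §4. In the reach interface: the whole weighted half-plane is certified -/

section StandingHP

variable {K M ε : ℝ} (hK : 2 * 20 ^ 42 * (Nat.factorial 42 : ℝ) + 16 ≤ K)
  (hML : 3000 * Real.log K ≤ M) (hMK : M ≤ K ^ 10) (hε : 0 < ε)
  (hεle : ε ≤ exp (-(10 * M)) / K ^ 100)
include hK hML hMK hε hεle

/-- **The open weighted half-plane fires at the cycle time**: `ρ + 1.27·εd/√M < 1.2532·ε²e^{-M}/√M`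
ALONE gives `FiresAtTwo K M ε 6 4 ρ εd` (`IsPseudoOrbit.firedOn_from_two_W_w` with `T = 2`;
`2εd ≤ (6266/3175)ε²e^{-M} < ε²/2`). Compare `firesAtTwo_W` (which needed `ρ + 2εd < ε²e^{-M}/8`
as well). [cite: Tao2016AveragedNS, §5.5 Theorem 5.3] -/
theorem firesAtTwo_halfPlane {ρ εd : ℝ}
    (hW : ρ + 127 / 100 * εd / Real.sqrt M < 3133 / 2500 * (ε ^ 2 * exp (-M)) / Real.sqrt M) :
    FiresAtTwo K M ε 6 4 ρ εd := by
  intro x hx h0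
  have hρ : 0 ≤ ρ := (norm_nonneg _).trans h0
  obtain ⟨hM6000, -, -, hexpM, -, -, -, h77, -⟩ := Ignition.ignition_params hK hML hMK hε hεle
  have hεd : 0 ≤ εd := by
    obtain ⟨V, -, hV⟩ := hx.defect 0 ⟨le_rfl, by norm_num⟩
    exact (norm_nonneg _).trans hV
  obtain ⟨-, hεds⟩ := wideBudget_of_weighted h77 hρ hεd hW.le
  have hε2 : 0 < ε ^ 2 := pow_pos hε 2
  have h1 : ε ^ 2 * exp (-M) ≤ ε ^ 2 * (1 / 1000000) := mul_le_mul_of_nonneg_left hexpM hε2.le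
  have hδT : εd * 2 < ε ^ 2 / 2 := by linarith
  exact hx.firedOn_from_two_W_w hK hML hMK hε hεle le_rfl h0 hW hδT 2 ⟨le_rfl, le_rfl⟩

/-- **Tao's gate inhabits the reach interface on the whole open weighted half-plane.** For every
member under the standing hypotheses, every input radius `ρ ≥ 0` and defect level `εd ≥ 0` with
`ρ + 1.27·εd/√M < 1.2532·ε²e^{-M}/√M` — ONE linear constraint, no a-priori side condition —
a reach certificate over the open sup-ball of radius `2`, cycle time `2`, from
`closedBall delayInit ρ` into the fired set of Theorem 5.3 (`|ã - 1| ≤ 6K⁻²⁰`,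
`|a|,|b|,|c|,|d| ≤ 4K⁻¹⁰`). Contains the region of `taoReachW` (DefectWeight.lean:
`ρ + 2εd < ε²e^{-M}/8` in addition) and the triangle of `taoReachSharp`; on the defect axis it
reaches `εd < 0.9867·ε²e^{-M}` (`taoReach_defectAxis_wide`). [cite: Tao2016AveragedNS, §5.5 Theorem 5.3] -/
def taoReachHalfPlane {ρ εd : ℝ} (hρ : 0 ≤ ρ) (hεd : 0 ≤ εd)
    (hW : ρ + 127 / 100 * εd / Real.sqrt M < 3133 / 2500 * (ε ^ 2 * exp (-M)) / Real.sqrt M) :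
    ReachCertificate (delayCircuitWith K M ε) (ball (0 : Fin 5 → ℝ) 2) εd 2
      (closedBall delayInit ρ) (firedSet K 6 4) :=
  reachCertificateOfFiresAt (firesAtTwo_halfPlane hK hML hMK hε hεle hW) hεd
    (by
      obtain ⟨-, -, hε2, hexpM, -, -, -, h77, -⟩ := Ignition.ignition_params hK hML hMK hε hεle
      have h2 : ε ^ 2 * exp (-M) ≤ 1 / 100000 * (1 / 1000000) :=
        mul_le_mul hε2 hexpM (exp_pos _).le (by norm_num)
      obtain ⟨hρs, hεds⟩ := wideBudget_of_weighted h77 hρ hεd hW.le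
      linarith)

/-- The tube of `taoReachHalfPlane` is the closed sup-ball of radius `3/2`. [folklore] -/
theorem taoReachHalfPlane_tube {ρ εd : ℝ} (hρ : 0 ≤ ρ) (hεd : 0 ≤ εd)
    (hW : ρ + 127 / 100 * εd / Real.sqrt M < 3133 / 2500 * (ε ^ 2 * exp (-M)) / Real.sqrt M)
    (p : Fin 5 → ℝ) (σ : ℝ) :
    (taoReachHalfPlane hK hML hMK hε hεle hρ hεd hW).Tube p σ = closedBall (0 : Fin 5 → ℝ) (3 / 2) :=
  rfl

/-- **On the defect axis** (`ρ = 0`): a reach certificate for EVERY defect level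
`0 ≤ εd < 0.9867·ε²e^{-M}` (`1.27·0.9867 < 1.2532`) — against NO certificate for `εd ≥ ε²e^{-M}`
(`isEmpty_taoReach_of_seed_le`): the sup-size of an adversarial forcing that a Theorem-5.3 stage
tolerates is its own seed rate `ε²e^{-M}`, up to the factor `10000/9867 < 1.0135` (compare
`taoReachW_defectAxis`: `εd < ε²e^{-M}/16`). [cite: Tao2016AveragedNS, §5.5 Theorem 5.3] -/
def taoReach_defectAxis_wide {εd : ℝ} (hεd : 0 ≤ εd)
    (h : εd < 9867 / 10000 * (ε ^ 2 * exp (-M))) :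
    ReachCertificate (delayCircuitWith K M ε) (ball (0 : Fin 5 → ℝ) 2) εd 2
      (closedBall delayInit 0) (firedSet K 6 4) :=
  taoReachHalfPlane hK hML hMK hε hεle le_rfl hεd
    (by
      obtain ⟨-, -, -, -, -, -, -, h77, -⟩ := Ignition.ignition_params hK hML hMK hε hεle
      have hsq0 : (0 : ℝ) < Real.sqrt M := by linarith
      have hs0 : 0 ≤ ε ^ 2 * exp (-M) := by positivity
      rw [zero_add]
      exact div_lt_div_of_pos_right (by linarith) hsq0)

/-- **The defect axis, both sides, wide**: certified for `0 ≤ εd < 0.9867·ε²e^{-M}` (cycle time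
`2`), impossible for `εd ≥ ε²e^{-M}` (every cycle time `τc ≥ 0`, ReachCertificateSharp §5b) — the
factor `16` of `defectAxis_phases_W` is down to `1.0135`. [cite: Tao2016AveragedNS, §5.5 Theorem 5.3] -/
theorem defectAxis_phases_wide {εd : ℝ} (hεd : 0 ≤ εd) :
    (εd < 9867 / 10000 * (ε ^ 2 * exp (-M)) →
        Nonempty (ReachCertificate (delayCircuitWith K M ε) (ball (0 : Fin 5 → ℝ) 2) εd 2
          (closedBall delayInit 0) (firedSet K 6 4))) ∧
      (ε ^ 2 * exp (-M) ≤ εd → ∀ τc : ℝ, 0 ≤ τc →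
        IsEmpty (ReachCertificate (delayCircuitWith K M ε) (ball (0 : Fin 5 → ℝ) 2) εd τc
          (closedBall delayInit 0) (firedSet K 6 4))) := by
  obtain ⟨hK16, -, -, -, -, -⟩ := negKick_params hK hML hMK hε hεle
  exact ⟨fun h => ⟨taoReach_defectAxis_wide hK hML hMK hε hεle hεd h⟩,
    fun hs τc hτ => isEmpty_taoReach_of_seed_le (by linarith) le_rfl hs hτ⟩

/-- **The `(ρ, εd)` budget plane, wide update of `taoReach_phases_W`** (`u = ε²e^{-M}/√M`,
`s = ε²e^{-M}`): CERTIFIED on the open weighted half-plane `ρ + 1.27εd/√M < 1.2532u`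
(`ρ, εd ≥ 0`); IMPOSSIBLE for `ρ ≥ 1.2535u` (cycle time `2`) and for `εd ≥ s` (every cycle time).
Undecided: the strip `1.2532u - 1.27εd/√M ≤ ρ < 1.2535u` (with `εd < s`), whose width on the
defect axis is `s - 0.9868s`. [cite: Tao2016AveragedNS, §5.5 Theorem 5.3] -/
theorem taoReach_phases_wide {ρ εd : ℝ} (hρ : 0 ≤ ρ) (hεd : 0 ≤ εd) :
    (ρ + 127 / 100 * εd / Real.sqrt M < 3133 / 2500 * (ε ^ 2 * exp (-M)) / Real.sqrt M →
        Nonempty (ReachCertificate (delayCircuitWith K M ε) (ball (0 : Fin 5 → ℝ) 2) εd 2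
          (closedBall delayInit ρ) (firedSet K 6 4))) ∧
    (2507 / 2000 * (ε ^ 2 * exp (-M)) / Real.sqrt M ≤ ρ →
        IsEmpty (ReachCertificate (delayCircuitWith K M ε) (ball (0 : Fin 5 → ℝ) 2) εd 2
          (closedBall delayInit ρ) (firedSet K 6 4))) ∧
    (ε ^ 2 * exp (-M) ≤ εd → ∀ τc : ℝ, 0 ≤ τc →
        IsEmpty (ReachCertificate (delayCircuitWith K M ε) (ball (0 : Fin 5 → ℝ) 2) εd τc
          (closedBall delayInit ρ) (firedSet K 6 4))) := by
  obtain ⟨-, h2, h3⟩ := taoReach_phases hK hML hMK hε hεle hρ hεd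
  exact ⟨fun hW => ⟨taoReachHalfPlane hK hML hMK hε hεle hρ hεd hW⟩, h2, h3⟩

/-- **The certifiable radius is affine in the defect on the whole axis segment**: for
`0 ≤ εd < 0.9867·s`, `1.2532u - 1.27εd/√M ≤ reachRadius K M ε εd ≤ 1.2535u` — compare
`reachRadius_mem_Icc_W` (lower bound `min (1.2532u - 1.27εd/√M) (s/8 - 2εd)`, vacuous from
`εd = s/16` on). [cite: Tao2016AveragedNS, §5.5 Theorem 5.3] -/
theorem reachRadius_mem_Icc_wide {εd : ℝ} (hεd : 0 ≤ εd)
    (hWd : 127 / 100 * εd / Real.sqrt M < 3133 / 2500 * (ε ^ 2 * exp (-M)) / Real.sqrt M) :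
    reachRadius K M ε εd ∈
      Icc (3133 / 2500 * (ε ^ 2 * exp (-M)) / Real.sqrt M - 127 / 100 * εd / Real.sqrt M)
        (2507 / 2000 * (ε ^ 2 * exp (-M)) / Real.sqrt M) := by
  set S : Set ℝ := {ρ : ℝ | Nonempty (ReachCertificate (delayCircuitWith K M ε)
    (ball (0 : Fin 5 → ℝ) 2) εd 2 (closedBall delayInit ρ) (firedSet K 6 4))} with hS
  have hup : ∀ ρ ∈ S, ρ ≤ 2507 / 2000 * (ε ^ 2 * exp (-M)) / Real.sqrt M := fun ρ hρ => by
    by_contra hlt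
    exact (isEmpty_taoReach_of_ge hK hML hMK hε hεle hεd (not_le.1 hlt).le).false hρ.some
  have hbdd : BddAbove S := ⟨_, hup⟩
  have hlow : ∀ ρ, 0 ≤ ρ →
      ρ + 127 / 100 * εd / Real.sqrt M < 3133 / 2500 * (ε ^ 2 * exp (-M)) / Real.sqrt M → ρ ∈ S :=
    fun ρ hρ hW => ⟨taoReachHalfPlane hK hML hMK hε hεle hρ hεd hW⟩
  have h0S : (0 : ℝ) ∈ S := hlow 0 le_rfl (by linarith)
  have hne : S.Nonempty := ⟨0, h0S⟩
  refine ⟨?_, csSup_le hne hup⟩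
  by_contra hlt
  rw [not_le] at hlt
  change sSup S < _ at hlt
  have h0le : 0 ≤ sSup S := le_csSup hbdd h0S
  obtain ⟨ρ, hρ1, hρ2⟩ := exists_between hlt
  have hρS : ρ ∈ S := hlow ρ (h0le.trans hρ1.le) (by linarith)
  exact absurd (le_csSup hbdd hρS) (not_le.2 hρ1)

omit hK hML hMK hε hεle in
/-- **What the wide budget bought on the defect axis**: the certified segment grew from
`[0, s/16)` (`defectAxis_phases_W`) to `[0, 0.9867s)`, against the necessity threshold `s` —
`0.9867·16 > 15.78` times longer, and the residual factor is `1/0.9867 < 1.0135`. [folklore] -/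
theorem defectAxis_gain :
    (15 : ℝ) < 9867 / 10000 * 16 ∧ (10000 : ℝ) / 9867 < 10135 / 10000 ∧
      127 / 100 * (9867 / 10000 : ℝ) < 3133 / 2500 := by
  norm_num

end StandingHP


end Literature.Analysis.FluidPDE.Tao2016AveragedNS
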